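import Summits.Ventures.HSemireg.Pad4TowerClassScreen
import Summits.Ventures.HSemireg.Pad4TowerRuleDMu4
import Summits.Ventures.HSemireg.Pad4TowerDiamondMu4

/-!
# BlochSeedDiscOne — negation lens g5, LINE 5 (crux idea `twin-locality-law`): the GENERAL-BLOCK PAIR-IMAGE DICTIONARY of the
# first-order model of record (two-face law, A∕B frame coordinates — director-hodge U4-3 decided «(ii) δ-dependent» by the model),
# and the TWIN-LOCALITY LAW: an isolated unbalanced block is `f`-local, so the one-level (F3) twin packet is pad-dressed, `μ`-free and
# confined to the thin cells (it never meets the charged core); a core-touching (F3) object is a TWO-LEVEL `b`-column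

HONEST FRAMING. Ideator sketch (planner `plan-lens-HodgeAV-negation` g5, LENSES-v3 lens «negation», director-hodge req-36, lineage
rule R17.43) for the crux `Summit.HodgeConjecture.HodgeConjecture.Theses.EightfoldBlochSeeds.BlochSeedDiscOne` (item
stmt-HodgeConjecture-18881; verbatim `:= Literature.AlgebraicGeometry.HodgeTheory.HasHyperbolicBlochSeed 4 1`; skeleton `Lines/birth.lean`
814a6a70c14e831a, STUB R = `stub_rung_pad4_seedAt`). NOTHING HERE PROVES HC, HC_CM, HC_AV, H2 or stmt-18881; HC_CM is a displayed binder
of the ladder only; no variety, no sheaf, no `σ`, no seed is constructed. Width toward H2 = 0: necessary conditions only. Every theorem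
below is elementary algebra over a commutative ring; its MEANING is the cell's first-order model OF RECORD, cited, exactly as
`Pad4TowerRuleDMu4` cites the meaning of RULE D:
* PAD4-DIAGCLOSURE-search-1.md v1.2 7d6949f2a7067e18 §0 «IMAGE FORMULA, intrinsic form» (= PAD4-FIRSTORDER-search-1.md v1.1
  93f71c42cb445756 §1, s4-ref ×2 d3e93d646340bf59), stated for GENERAL blocks `a_f = [[α_f, β_f],[β̄_f, α′_f]] ∈ Herm₂(ℚ(i))`:
  on the Weil direction `E_{jg}` (`j ≠ g`) the image `(κ ∪ c₁X)^{0,2}` is `M_{jg}(X) = w_g^B ⊗ ē_{B_j} − ē_{A_g} ⊗ w_j^A ∈ V_g ⊗ V_j`,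
  `w^B = (α − t) ē_A + β ē_B`, `w^A = β̄ ē_A + (α′ − t) ē_B`, i.e. the matrix `[[−β̄_j, α_g − α′_j],[0, β_g]]` (rows `ē_{A_g}, ē_{B_g}`,
  columns `ē_{A_j}, ē_{B_j}`); on `E_{gg}` it is `(α_g − α′_g) ē_{A_g} ∧ ē_{B_g}`;
* v1.1 §0 PLANE TABLE: a partner `Y` of `X` (opposite level, `±(X − Y)` psd of Hermitian rank ≤ 2, `φ_{XY} ≠ 0`) is an (r1) LEG on one
  factor `a` (rank-1 block `d·vv^*`, plane `ξ̄_v ∧ Λ¹`, `ξ̄_v ∈ V_a`), an (r2a) PAIR of rank-1 blocks on factors `a ≠ b` (plane = the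
  line `ξ̄_v ⊗ ξ̄_u ⊂ V_a ⊗ V_b`) or an (r2b) rank-2 STEP on one factor `a` (plane = the line `Λ²V_a`); the DIAGONAL CRITERION
  (vhodge THEOREM P (a)(b)) is `Im(X) ⊂ A(X) := Σ_{Y ∼ X} Plane(X, Y)`.
As in LINE 4 (`Cruxes/BlochSeedDiscOne/UvSwapCompanionLaw.lean` rev 2 63b5bf4f0d0bed33, `gphi`; NOT imported — its module is not yet built on the farm, build-lane backlog — the two borrowed definitions `gphi` ↦ `Blk.letter`, `rest3` are restated verbatim), `β̄` is an independent ring element `βc`; `μ₄`-adapted letters are `β = b·w̄`, `β̄ = b·w` with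
`w·w̄ = 1` (`w`, `wc` ring elements with `w * wc = 1`).

CONTENT (all PROVED; 0 `sorry`, no `axiom`, no `instance`, no notation).
* §1 `Blk` (general block), `Mjg`∕`Mgj` (the pair images on `E_{jg}`∕`E_{gj}`), `Mjg_eq_intrinsic`∕`Mgj_eq_intrinsic` (they ARE the
  intrinsic `w^B ⊗ ē_B − ē_A ⊗ w^A` of DIAGCLOSURE §0, pad `t` cancelling), `Mgj_eq_transpose`, `selfCoeff` (`E_{gg} ↦ α − α′`).
* §2 **TWO-FACE LAW** `Mjg_two_face`∕`Mgj_two_face`: toward `E_{jg}` a cell shows its u-FACE `(α, β)` on the ROW factor `g` and its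
  v-FACE `(α′, β)` on the COLUMN factor `j` (and the other way round toward `E_{gj}`); **FRAME FORM** `frame_entry_Mjg`∕`frame_entry_Mgj`:
  paired with the dual frame `(1, r·w)` (`r² = 1`) the entries are `r′w_j·[(α_g + r b_g) − (α′_j + r′ b_j)]` and
  `r w_g·[(α_j + r′ b_j) − (α′_g + r b_g)]` — RULE D's node differences with A-COORDINATES `α + r b` on one factor against
  B-COORDINATES `α′ + r′ b` on the other (`frame_entry_balanced`: `α = α′` gives the PAIR-IMAGE THEOREM's `D_{rr′}` of record,
  PAD4-BALANCED §1′ 032a5afcfcd9fcbf). This is director-hodge's U4-3 decided BY THE MODEL: pair service of an unbalanced cell depends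
  on `δ = α − α′` pair by pair (branch (ii)); the xres2s readings (`Pad4TowerRuleDMu4.coord`, one node per letter) simply have no
  unbalanced letter. `no_coincidence_through_unbalanced`: against a balanced letter the `(r, r′)` entries of `M_{jg}` and `M_{gj}`
  never vanish together when `δ_g ≠ 0` — RULE D's free entries (apex coincidences) do not exist through an unbalanced factor, every
  frame entry there must be covered by a leg or an (r2a) line (imbalance only ADDS pair demand); `uncharged_unbalanced_images`: the
  skew helpers' demand shape (A-row ∕ B-row, one per face).
* §3 **VANISHING** `Mjg_eq_zero_iff`; **THREE-BLOCK LOCALITY** `three_blocks_local`: if all six pair images among three blocks vanish,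
  the three blocks are ONE PAD `s·I₂` (uncharged, balanced); contrast `two_blocks_vanishing_iff`: two blocks only force the
  TRANSPOSED pads `(s, s′), (s′, s)` — locality is a PAD-4 effect (three factors off `f`), on PAD-3 isolated imbalance propagates.
* §4 the plane table TYPED at the pairs (`PType`, `pairPlane`, `absorbAt`, `PairCriterion`) and **THE TWIN-LOCALITY LAW**
  `twin_locality`: if every partner type of `X` touches the factor `f` (which is the case when NO partner shares `X`'s `f`-block: a
  partner differing on `f` spends rank ≥ 1 there), the pair criterion forces `X = s·h + (one block on f)` off `f` — `X` is `f`-LOCAL;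
  `absorbAt_eq_bot_of_touches` is the one-line reason (such planes have no `V_g ⊗ V_j` component for `g, j ≠ f`). `SelfCriterion` ∕
  `self_demand` record the `E_{gg}` row (the card's «Λ²V_f lever ∕ (r2b) planes», bc5-plan v4.24 l.48): `δ_g ≠ 0` needs a leg or an
  (r2b) step ON `g`.
* §5 THE TWIN PACKET `{(a+d, a−d, β), (a−d, a+d, β)}` (LINE 4 `companion_pair` ∕ `twin_pair_exchange`): faces = READINGS
  (`uFace_twinPlus` …), the four COORDINATE LEGS to∕from its balanced readings (`twinPlus_sub_lower = diag(2d, 0)` …: rank-1, so the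
  readings are the packet's nearest `Λ²`-servers), `twin_diff_det = −4d²` (twins are never partners of each other), `local_cell_mu_zero`
  (an `f`-local cell has `Π_f β_f = 0`: no `μ`), and the NC-FAILURE WITNESS `nc_fails_witness` (a balanced charged letter `(α, α, 2)` is
  doubly served on its factor by TWO UNCHARGED letters, the balanced `(α−2, α−2, 0)` and the SKEW `(α−4, α−1, 0)`, along independent
  directions `(1,1)`, `(2,1)` — the card's «non-cancellation fails there»; the skew server is itself unbalanced, `δ = −3`).
* §6 **COLUMN LAW** (LINE 4's companion law `imbalance_moment_eq_zero`, taken as the hypothesis `hmom`, summed per `f`-letter value): `column_moment_eq_zero`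
  `Σ_b δ_b · T_b(x) = 0`, `T_b(x) := Σ_{j : v_{j,f} = b} c_j · Π_{g≠f} v_{j,g}(x_g)` the signed 3-factor class function of the
  `b`-COLUMN; `twin_columns_agree`: with exactly two unbalanced values of opposite `δ ≠ 0` (twin values) the two columns have EQUAL
  3-factor class functions.
* §7 (rev 2) **RETURN-TO-BALANCE TRIANGLES**: `det_vecMulVec_sub_vecMulVec` (a difference of two rank-one pieces is indefinite or
  parallel) and the integer certificates `triangle_D8` ∕ `triangle_D8_legs` ∕ `triangle_D10` of the one-level (F3) server
  `D₊ = diag(4,−4)` (+ uv-twin) under the thin heads `2I+3ℓ_{±u}`, `4I` of the ◇₈ core's clause #1 (resp. `diag(4,−2)` on ◇₁₀).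
* §8 (rev 3) **THIN HEADS IN THE TYPED PLANE TABLE**: `thin_one_codirection_forces_null` ((T0): one leg codirection forces a NULL
  head), `thin_two_legs_pass` ((T1∕T2): two legs of unit cross-determinant pass the pair criterion), and the instances
  `triangle_D8_pairCriterion` (D₊ with its two legs PASSES over `ℚ`), `D8_one_leg_fails`, `head_2I3l_one_leg_fails` (the kernel form of
  «clause #1 is the antipodal demand»).
* §9 (rev 4) **THE THIN-CELL BRIDGE TO THE ENCODER'S RULE D** (critic T5-1 at the cells LINE 5's census words are about; new import
  `Pad4TowerRuleDMu4`): `ruleD_thin_iff_pairCriterion` — for a thin `N`-cell `[O|O|O|t·I + c·ℓ_ζ]` (`t, c ≥ 1`) among effective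
  μ₄-phased `P`-letters, `RuleDMu4N C Z ↔ PairCriterion (ℂ-blocks of Z) (legsBelow C Z f)`; via `ruleDN_thin_iff` ((R-O)),
  `dir_below_charged` (below a charged axis letter only the two frame directions exist), `ruleDN_thin_charged_iff` (RULE D = service
  in BOTH frame directions) and §8; (rev 5) the RAY case `ruleD_thin_ray_iff_pairCriterion` (`[O|O|O|c·ℓ_ζ]`: one own-direction
  leg on both sides — this case pins the codirection convention `ξ_r = (1, conj(i^r))`) and the APEX case
  `ruleD_thin_apex_iff_pairCriterion` (`[O|O|O|t·I]`: two distinct directions on both sides): EVERY thin `N`-cell with a non-zero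
  ◇-letter is covered; (rev 6, §9b) `ruleD_thin_iff_pairCriterion_of_inDiamond`: on a `◇_h` configuration (`MConfig.InDiamond h`) the side
  conditions `hcone`∕`haxis` are DISCHARGED and the three cases merge into ONE statement with no hypothesis but thinness and `x ≠ O`; (rev 7, C5-3 ∕
  R18.26) `dir_eq_of_above_ceiling` ∕ `not_settledAbove_ceiling`: above a ceiling letter of `◇_h` only the INWARD direction stays in `◇_h`, so a
  ceiling factor's own-direction coordinate is never settled above — RULE D at all-ceiling `P`-cells is inward-lift presence, phase-blind up to
  orbit bookkeeping (the kernel-side reason RULE D is not the phase carrier at the ceiling); (rev 8) `ruleDP_ceiling_iff_lifts`: RULE D at an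
  all-charged-ceiling `P`-cell ⟺ every factor carries its inward lift — CLOSED FORM, kernel; (rev 9, §9c, critic C5-3 price «thin-P HOLDS stays
  PENCIL») `ruleDP_thin_iff_pairCriterion_of_inDiamond`: the MIRROR bridge at QUIET thin `P`-cells (no service above on the `O`-factors, no cover
  above the cell — both read off the supports of record, which have no cell with exactly one or two `O`-factors): RULE D ⟺ pair criterion against
  the legs ABOVE (`legsAbove`); the one asymmetric case is the RAY letter (above a ray both frame directions exist; the antipodal leg alone does
  not pass: `thin_codirections_parallel_row`); (rev 10, §9d, critic rev-9 price «≥ 2 charged factors (covers ↦ r2a)») THE FRAME FORM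
  `frame_coeff_charged` (`φ_{k,k′}(M_{(g,j)}) = (i^{k′}/4)·(c_k(x_g) − c_{k′}(x_j))`: the pair image of two charged factors IS RULE D's table of
  coordinate differences over the two frames), the pair bridge WITH COVERS `pair_charged_iff` ((r2a) cover moving `(g,a),(j,b)` ↦
  `PType.r2a g ξ_a j ξ_b`), and the cell theorems `ruleDN_charged_iff_pairCriterion` ∕ `ruleDP_charged_iff_pairCriterion`: at an `N`- or `P`-cell
  of `◇_h` ALL of whose factors are charged letters, RULE D ⟺ pair criterion against «legs + covers» (`partnersBelow` ∕ `partnersAbove`);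
  (rev 11, §9e–§9f) THE GENERAL BRIDGE SETTLED IN SHAPE: `ruleDN_of_pairCriterion'` ∕ `ruleDP_of_pairCriterion'` — at EVERY cell of every `◇_h`
  configuration (apex factors included, any service∕cover pattern) the pair criterion against «legs + covers» IMPLIES the typed RULE D (one
  functional `δ_k ⊗ δ_{k′}` per clause; an apex factor is a ray in every direction), and the converse is FALSE in general:
  `ruleDN_iff_pairCriterion_fails` — a `◇₈` configuration (`cfgApexGap`: `[4I | 8I | 2I+ℓ₁ | 2I+ℓ₁]` above four DIAGONAL covers and four legs)
  passes `RuleDMu4N` (`decide`) and fails the pair criterion (covers offer symmetric lines `ξ_a ⊗ ξ_a`, the apex–apex demand `e_A ⊗ e_B` is not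
  symmetric) — the gap is exactly FLAG F-1's apex freedom at a DOUBLY-UNSERVED apex–apex pair of UNEQUAL heights ((0.3) with a frame choice
  rejects the same family). So the typed RULE D is «necessary for the plane table», equivalent to it on all-charged (§9d) and thin (§9–§9c)
  cells; every RULE-D-UNSAT verdict is a plane-table-UNSAT verdict; a RULE-D-SAT support needs the exact test only at such apex pairs
  (R18.44's ceiling-line support has the single apex letter `10I`: none); (rev 12, §9g) THE GENERAL BRIDGE ON GAP-FREE CELLS:
  `ruleDN_iff_pairCriterion_of_noGap'` ∕ `ruleDP_iff_pairCriterion_of_noGap'` — at every `N`-∕`P`-cell of a `◇_h` configuration with NO APEX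
  GAP (`NoApexGapBelow` ∕ `NoApexGapAbove`: every pair of apex factors of unequal heights is served on at least one side; vacuous for
  all-charged cells and for cells whose apex factors share one height, `ruleDN_iff_pairCriterion_of_one_apex_height`) the typed RULE D —
  FLAG F-1 included — IS the pair criterion against legs + covers (kernel; at an apex factor RULE D's clauses over all four directions
  yield two DISTINCT codirections hitting each partner coordinate, `two_of_clauses`, and two codirections span, `vmv_mem_of_two_rows` ∕
  `_cols`); §9e shows the gap hypothesis cannot be dropped. T5-1 (i) for BALANCED letters is thereby kernel in full: ⟹ everywhere (§9f),
  ⟺ on gap-free cells (§9g ⊃ §9d ⊃ thin §9–§9c), a `◇₈` witness of failure at a gap (§9e). NOT covered: unbalanced letters `D_±`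
  on the RULE-D side (the typed rule has no `D_±`); (rev 13, §8b) on the PLANE-TABLE side the enlarged encoders' service rule (E) IS
  derived: `thin_legsOn_iff` — a non-null thin cell with legs on `f` of non-zero codirections `Ξ` passes iff two of them have non-zero
  cross-determinant; at the ◇₈ head the four codirections own∕anti∕`D₊`∕`D₋` are pairwise independent, so (E) = «two distinct legs
  present» (`head_2I3l_legsOn_iff`, `head_2I3l_twin_legs_pass`, `D8_legsOn_iff`); (rev 14, §7b) the REBALANCER CENSUS at `◇₈` is kernel:
  `det (x − D_±) = a² − 16 − c²` on the letter `a·I + c·ℓ_u`, and on the 45 `◇₈` letters `a² − c² = 16` iff `x` is a head `2I+3ℓ_u` or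
  the apex `4I` (`diamond8_rebalancer_census`, `decide`), whose differences ARE formal outer products (`letter53_sub_Dplus∕Dminus`,
  `apex4I_sub_twin`); the apex is served by the twin legs alone (`apex4I_twin_legs_pass`, `apex4I_legsOn_iff`).
COROLLARY (pencil, card §3): in the one-level twin packet ⊗ R of `companion_pair` (and in its N∕P partner-pair shape) no opposite-level
cell carries either unbalanced `f`-block, so by §4 both cells are `f`-local (R = pad): charged on ≤ 1 factor, `μ`-contribution 0 (§5),
partners only THIN cells `s·h + (≤ 1 rank-1 correction off f) + (f-block)` — it never partners a cell charged on ≥ 2 factors off `f`,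
so it cannot touch the charged core where (H1) lives; its only possible first-order role is the skew ∕ coordinate `f`-leg (or (r2b))
service among thin cells of `nc_fails_witness` (whether any census UNSAT core contains a thin cell's demand is the card's pre-registered
check C5-0, not decided here). An unbalanced cell that meets the core must share its `f`-block with an opposite-level cell: the first
core-touching (F3) object is TWO-LEVEL (a `b`-column present at both levels, §6). HC ∕ HC_CM ∕ HC_AV ∕ H2 ∕ stmt-18881 are NOT proved here.
-/

set_option linter.dupNamespace false
set_option linter.style.longFile 0

namespace Summit.HodgeConjecture.HodgeConjecture.Cruxes.BlochSeedDiscOne.TwinLocalityLaw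

open Matrix Finset Summit.Ventures.HSemireg.Pad4Tower

/-! ## §1 General blocks and the pair images of record -/

/-- a general ⊕-block letter `[[α, β],[β̄, α′]]` on one factor `S_f = E_A × E_B` (`β̄` an independent ring element `βc`). -/
@[ext] structure Blk (R : Type*) where
  /-- the `AA` entry (u-node) -/
  α : R
  /-- the `BB` entry (v-node) -/
  α' : R
  /-- the `AB` entry (charge) -/
  β : R
  /-- the `BA` entry (conjugate charge) -/
  βc : R

section PairImage

variable {R : Type*} [CommRing R]

/-- the block as a `2 × 2` matrix (rows∕columns `A, B`). -/
def Blk.toMat (x : Blk R) : Matrix (Fin 2) (Fin 2) R := !![x.α, x.β; x.βc, x.α']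

/-- the imbalance `δ = α − α′`. -/
def Blk.δ (x : Blk R) : R := x.α - x.α'

/-- the pad letter `s·I₂` (balanced, uncharged). -/
def Blk.pad (s : R) : Blk R := ⟨s, s, 0, 0⟩

/-- the u-FACE (u-reading) `(α, α, β, β̄)` and the v-FACE (v-reading) `(α′, α′, β, β̄)` of a block. -/
def Blk.uFace (x : Blk R) : Blk R := ⟨x.α, x.α, x.β, x.βc⟩
def Blk.vFace (x : Blk R) : Blk R := ⟨x.α', x.α', x.β, x.βc⟩

/-- the class-frame letter `(1, u, v, e, ē, p) = (1, α, α′, β, β̄, αα′ − ββ̄)` of a block — LINE 4's `gphi x.α x.α' x.β x.βc`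
verbatim (pad4lib `phi`); restated here because LINE 4's module is not yet built on the farm (build-lane backlog). -/
def Blk.letter (x : Blk R) : Fin 6 → R := ![1, x.α, x.α', x.β, x.βc, x.α * x.α' - x.β * x.βc]

/-- basis covectors `ē_A, ē_B` of `V = ⟨ē_A, ē_B⟩` as coefficient vectors. -/
def eA : Fin 2 → R := ![1, 0]
def eB : Fin 2 → R := ![0, 1]

/-- DIAGCLOSURE §0's `w^B = (α − t) ē_A + β ē_B` and `w^A = β̄ ē_A + (α′ − t) ē_B` (pad coefficient `t`). -/
def wB (t : R) (x : Blk R) : Fin 2 → R := ![x.α - t, x.β]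
def wA (t : R) (x : Blk R) : Fin 2 → R := ![x.βc, x.α' - t]

/-- **THE PAIR IMAGE on `E_{jg}`** (`j ≠ g`): `M_{jg}(X) ∈ V_g ⊗ V_j` as a matrix, rows `(ē_{A_g}, ē_{B_g})`, columns `(ē_{A_j}, ē_{B_j})`;
`xg`, `xj` the blocks of `X` on `g` and `j`. -/
def Mjg (xg xj : Blk R) : Matrix (Fin 2) (Fin 2) R := !![-xj.βc, xg.α - xj.α'; 0, xg.β]

/-- **THE PAIR IMAGE on `E_{gj}`**, in the same frame (rows `V_g`, columns `V_j`). -/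
def Mgj (xg xj : Blk R) : Matrix (Fin 2) (Fin 2) R := !![-xg.βc, 0; xj.α - xg.α', xj.β]

/-- the `E_{gg}` image coefficient: `(κ ∪ c₁X)^{0,2} = (α_g − α′_g) ē_{A_g} ∧ ē_{B_g}` for `κ = E_{gg}`. -/
def selfCoeff (x : Blk R) : R := x.α - x.α'

/-- `M_{jg}` IS the intrinsic `w_g^B ⊗ ē_{B_j} − ē_{A_g} ⊗ w_j^A` (the pad `t` cancels). -/
theorem Mjg_eq_intrinsic (t : R) (xg xj : Blk R) :
    Mjg xg xj = vecMulVec (wB t xg) eB - vecMulVec eA (wA t xj) := by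
  ext i j
  fin_cases i <;> fin_cases j <;> simp [Mjg, wB, wA, eA, eB]

/-- `M_{gj}` IS the intrinsic `ē_{B_g} ⊗ w_j^B − w_g^A ⊗ ē_{A_j}`. -/
theorem Mgj_eq_intrinsic (t : R) (xg xj : Blk R) :
    Mgj xg xj = vecMulVec eB (wB t xj) - vecMulVec (wA t xg) eA := by
  ext i j
  fin_cases i <;> fin_cases j <;> simp [Mgj, wB, wA, eA, eB]

/-- the two images of the unordered pair `{g, j}` are each other's transposes with the roles of `g`, `j` exchanged. -/
theorem Mgj_eq_transpose (xg xj : Blk R) : Mgj xg xj = (Mjg xj xg)ᵀ := by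
  ext i j
  fin_cases i <;> fin_cases j <;> simp [Mgj, Mjg]

/-- the `E_{gg}` coefficient is the intrinsic `w^B_A − w^A_B = (α − t) − (α′ − t)`. -/
theorem selfCoeff_eq_intrinsic (t : R) (x : Blk R) : selfCoeff x = wB t x 0 - wA t x 1 := by
  simp [selfCoeff, wB, wA]

theorem selfCoeff_eq_delta (x : Blk R) : selfCoeff x = x.δ := rfl

theorem selfCoeff_pad (s : R) : selfCoeff (Blk.pad s) = 0 := by simp [selfCoeff, Blk.pad]

/-! ## §2 The two-face law and the frame form (U4-3: δ-dependence is in the model) -/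

/-- **TWO-FACE LAW (row side).** `M_{jg}` reads only the u-face `(α_g, β_g)` of the row factor and the v-face `(α′_j, β_j)` of the
column factor. -/
theorem Mjg_two_face (xg xj : Blk R) : Mjg xg xj = Mjg xg.uFace xj.vFace := rfl

/-- **TWO-FACE LAW (column side).** `M_{gj}` reads only the v-face of `g` and the u-face of `j`. -/
theorem Mgj_two_face (xg xj : Blk R) : Mgj xg xj = Mgj xg.vFace xj.uFace := rfl

/-- `M_{jg}` does not see `α′_g`, `β̄_g`, `α_j`, `β_j`. -/
theorem Mjg_congr {xg yg xj yj : Blk R} (h₁ : xg.α = yg.α) (h₂ : xg.β = yg.β) (h₃ : xj.α' = yj.α') (h₄ : xj.βc = yj.βc) :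
    Mjg xg xj = Mjg yg yj := by
  simp [Mjg, h₁, h₂, h₃, h₄]

/-- the dual frame covector `(1, r·w)` of a `μ₄`-adapted letter (`β = b·w̄`; `r = ±1`, here any `r` with `r² = 1`). -/
def dfr (r w : R) : Fin 2 → R := ![1, r * w]

/-- **FRAME FORM of `M_{jg}`** (the general-block RULE D entry): for adapted letters `β_g = b_g w̄_g`, `β_j = b_j w̄_j`
(`w w̄ = 1`) and signs `r′² = 1`,
`(1, r w_g) · M_{jg} · (1, r′ w_j)ᵀ = r′ w_j · [(α_g + r b_g) − (α′_j + r′ b_j)]` —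
the A-COORDINATE `α + r b` of the row factor against the B-COORDINATE `α′ + r′ b` of the column factor. -/
theorem frame_entry_Mjg (αg αg' bg wg wcg αj αj' bj wj wcj r r' : R) (hg : wg * wcg = 1) (hr' : r' * r' = 1) :
    dfr r wg ⬝ᵥ (Mjg ⟨αg, αg', bg * wcg, bg * wg⟩ ⟨αj, αj', bj * wcj, bj * wj⟩ *ᵥ dfr r' wj)
      = r' * wj * ((αg + r * bg) - (αj' + r' * bj)) := by
  simp [Mjg, dfr, mulVec, dotProduct, Fin.sum_univ_two]
  linear_combination (bj * wj) * hr' + (bg * r * r' * wj) * hg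

/-- **FRAME FORM of `M_{gj}`**: `(1, r w_g) · M_{gj} · (1, r′ w_j)ᵀ = r w_g · [(α_j + r′ b_j) − (α′_g + r b_g)]` —
the A-coordinate of the column factor against the B-coordinate of the row factor. -/
theorem frame_entry_Mgj (αg αg' bg wg wcg αj αj' bj wj wcj r r' : R) (hj : wj * wcj = 1) (hr : r * r = 1) :
    dfr r wg ⬝ᵥ (Mgj ⟨αg, αg', bg * wcg, bg * wg⟩ ⟨αj, αj', bj * wcj, bj * wj⟩ *ᵥ dfr r' wj)
      = r * wg * ((αj + r' * bj) - (αg' + r * bg)) := by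
  simp [Mgj, dfr, mulVec, dotProduct, Fin.sum_univ_two]
  linear_combination (bg * wg) * hr + (bj * r * r' * wg) * hj

/-- BALANCED SPECIALISATION: for `α = α′` on both factors the two entries are `± unit · D_{rr′}`,
`D_{rr′} = (α_g + r b_g) − (α_j + r′ b_j)` (twice the node difference `c_r(x_g) − c_{r′}(x_j)` of the PAIR-IMAGE THEOREM of record). -/
theorem frame_entry_balanced (αg bg wg wcg αj bj wj wcj r r' : R) (hg : wg * wcg = 1) (hj : wj * wcj = 1)
    (hr : r * r = 1) (hr' : r' * r' = 1) :
    dfr r wg ⬝ᵥ (Mjg ⟨αg, αg, bg * wcg, bg * wg⟩ ⟨αj, αj, bj * wcj, bj * wj⟩ *ᵥ dfr r' wj)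
        = r' * wj * ((αg + r * bg) - (αj + r' * bj)) ∧
      dfr r wg ⬝ᵥ (Mgj ⟨αg, αg, bg * wcg, bg * wg⟩ ⟨αj, αj, bj * wcj, bj * wj⟩ *ᵥ dfr r' wj)
        = -(r * wg) * ((αg + r * bg) - (αj + r' * bj)) := by
  refine ⟨frame_entry_Mjg αg αg bg wg wcg αj αj bj wj wcj r r' hg hr', ?_⟩
  rw [frame_entry_Mgj αg αg bg wg wcg αj αj bj wj wcj r r' hj hr]
  ring

/-- U4-3 in one line: the `E_{jg}` entry of the twin letter `(a + d, a − d, b w̄)` against a balanced letter differs from that of its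
balanced centre `(a, a, b w̄)` by `r′ w_j · d` — the pair image SEES `δ = 2d`. -/
theorem frame_entry_sees_delta (a d bg wg wcg αj bj wj wcj r r' : R) (hg : wg * wcg = 1) (hr' : r' * r' = 1) :
    dfr r wg ⬝ᵥ (Mjg ⟨a + d, a - d, bg * wcg, bg * wg⟩ ⟨αj, αj, bj * wcj, bj * wj⟩ *ᵥ dfr r' wj)
      - dfr r wg ⬝ᵥ (Mjg ⟨a, a, bg * wcg, bg * wg⟩ ⟨αj, αj, bj * wcj, bj * wj⟩ *ᵥ dfr r' wj) = r' * wj * d := by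
  rw [frame_entry_Mjg _ _ _ _ _ _ _ _ _ _ _ _ hg hr', frame_entry_Mjg _ _ _ _ _ _ _ _ _ _ _ _ hg hr']
  ring

/-- **NO APEX COINCIDENCE THROUGH AN UNBALANCED FACTOR.** For an adapted UNBALANCED letter on `g` against a BALANCED letter on `j`,
the `(r, r′)` frame entries of `M_{jg}` and `M_{gj}` never vanish together — their joint vanishing forces `α_g = α′_g`. So RULE D's
«free entries» (`D_{rr′} = 0`, apex coincidence) do not exist through an unbalanced factor: there EVERY frame entry must be covered by
a leg row on `g`, a leg column on `j` or an (r2a) line (domain; `w_g`, `w_j` units, `r² = r′² = 1`). -/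
theorem no_coincidence_through_unbalanced [IsDomain R] (αg αg' bg wg wcg αj bj wj wcj r r' : R) (hg : wg * wcg = 1)
    (hj : wj * wcj = 1) (hr : r * r = 1) (hr' : r' * r' = 1)
    (h₁ : dfr r wg ⬝ᵥ (Mjg ⟨αg, αg', bg * wcg, bg * wg⟩ ⟨αj, αj, bj * wcj, bj * wj⟩ *ᵥ dfr r' wj) = 0)
    (h₂ : dfr r wg ⬝ᵥ (Mgj ⟨αg, αg', bg * wcg, bg * wg⟩ ⟨αj, αj, bj * wcj, bj * wj⟩ *ᵥ dfr r' wj) = 0) : αg = αg' := by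
  rw [frame_entry_Mjg αg αg' bg wg wcg αj αj bj wj wcj r r' hg hr'] at h₁
  rw [frame_entry_Mgj αg αg' bg wg wcg αj αj bj wj wcj r r' hj hr] at h₂
  have hr0 : r ≠ 0 := by
    rintro rfl
    simp at hr
  have hr'0 : r' ≠ 0 := by
    rintro rfl
    simp at hr'
  have hwg : wg ≠ 0 := by
    rintro rfl
    simp at hg
  have hwj : wj ≠ 0 := by
    rintro rfl
    simp at hj
  have e₁ := (mul_eq_zero.1 h₁).resolve_left (mul_ne_zero hr'0 hwj)
  have e₂ := (mul_eq_zero.1 h₂).resolve_left (mul_ne_zero hr0 hwg)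
  linear_combination e₁ + e₂

/-- the pair images of an UNCHARGED unbalanced letter `(α, α′, 0)` on `g` (the shape of the skew helpers of §5): toward `E_{jg}` its
`A`-ROW against the v-face of `j`, toward `E_{gj}` its `B`-ROW against the u-face of `j` — two rank-1 rows, one per face. -/
theorem uncharged_unbalanced_images (α α' : R) (xj : Blk R) :
    Mjg ⟨α, α', 0, 0⟩ xj = vecMulVec eA ![-xj.βc, α - xj.α'] ∧
      Mgj ⟨α, α', 0, 0⟩ xj = vecMulVec eB ![xj.α - α', xj.β] := by
  constructor
  · ext i j
    fin_cases i <;> fin_cases j <;> simp [Mjg, eA, vecMulVec_apply]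
  · ext i j
    fin_cases i <;> fin_cases j <;> simp [Mgj, eB, vecMulVec_apply]

/-! ## §3 Vanishing and three-block locality -/

/-- `M_{jg}(X) = 0 ⟺ β̄_j = 0 ∧ α_g = α′_j ∧ β_g = 0`. -/
theorem Mjg_eq_zero_iff (xg xj : Blk R) : Mjg xg xj = 0 ↔ xj.βc = 0 ∧ xg.α = xj.α' ∧ xg.β = 0 := by
  constructor
  · intro h
    have h00 := congr_fun (congr_fun h 0) 0
    have h01 := congr_fun (congr_fun h 0) 1
    have h11 := congr_fun (congr_fun h 1) 1
    simp [Mjg] at h00 h01 h11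
    exact ⟨h00, by rwa [sub_eq_zero] at h01, h11⟩
  · rintro ⟨h₁, h₂, h₃⟩
    ext i j
    fin_cases i <;> fin_cases j <;> simp [Mjg, h₁, h₂, h₃]

/-- `M_{gj}(X) = 0 ⟺ β̄_g = 0 ∧ α_j = α′_g ∧ β_j = 0`. -/
theorem Mgj_eq_zero_iff (xg xj : Blk R) : Mgj xg xj = 0 ↔ xg.βc = 0 ∧ xj.α = xg.α' ∧ xj.β = 0 := by
  rw [Mgj_eq_transpose, Matrix.transpose_eq_zero, Mjg_eq_zero_iff]

/-- a pad has no pair images at all. -/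
theorem Mjg_pad (s : R) : Mjg (Blk.pad s) (Blk.pad s) = 0 :=
  (Mjg_eq_zero_iff _ _).2 ⟨rfl, rfl, rfl⟩

/-- **THREE-BLOCK LOCALITY.** If all six pair images among three blocks vanish, the three blocks are one and the same PAD `s·I₂`. -/
theorem three_blocks_local (x y z : Blk R) (hxy : Mjg x y = 0) (hyx : Mjg y x = 0) (hxz : Mjg x z = 0)
    (hzx : Mjg z x = 0) (hyz : Mjg y z = 0) (hzy : Mjg z y = 0) :
    x = Blk.pad x.α ∧ y = Blk.pad x.α ∧ z = Blk.pad x.α := by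
  rw [Mjg_eq_zero_iff] at hxy hyx hxz hzx hyz hzy
  obtain ⟨e1, e2, e3⟩ := hxy
  obtain ⟨f1, f2, f3⟩ := hyx
  obtain ⟨g1, g2, g3⟩ := hxz
  obtain ⟨i1, i2, i3⟩ := hzx
  obtain ⟨k1, k2, k3⟩ := hyz
  obtain ⟨l1, l2, l3⟩ := hzy
  have ex : x.α' = x.α := by rw [← f2, k2, ← g2]
  refine ⟨Blk.ext rfl ex e3 f1, Blk.ext (f2.trans ex) e2.symm f3 e1, Blk.ext (i2.trans ex) g2.symm i3 g1⟩

/-- CONTRAST (two blocks only, the PAD-3 situation): the vanishing of both pair images of ONE pair forces only the TRANSPOSED pads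
`(s, s′)`, `(s′, s)` — uncharged but possibly unbalanced. Locality needs the third factor. -/
theorem two_blocks_vanishing_iff (x y : Blk R) :
    (Mjg x y = 0 ∧ Mjg y x = 0) ↔ (x = ⟨x.α, y.α, 0, 0⟩ ∧ y = ⟨y.α, x.α, 0, 0⟩) := by
  rw [Mjg_eq_zero_iff, Mjg_eq_zero_iff]
  constructor
  · rintro ⟨⟨e1, e2, e3⟩, ⟨f1, f2, f3⟩⟩
    exact ⟨Blk.ext rfl f2.symm e3 f1, Blk.ext rfl e2.symm f3 e1⟩
  · rintro ⟨hx, hy⟩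
    have hx' := congrArg Blk.α' hx
    have hy' := congrArg Blk.α' hy
    have hxβ := congrArg Blk.β hx
    have hyβ := congrArg Blk.β hy
    have hxc := congrArg Blk.βc hx
    have hyc := congrArg Blk.βc hy
    simp only at hx' hy' hxβ hyβ hxc hyc
    exact ⟨⟨hyc, hy'.symm, hxβ⟩, ⟨hxc, hx'.symm, hyβ⟩⟩

/-- the transposed pads DO pass the pair test (so the contrast is sharp). -/
theorem two_blocks_transposed_pads (s s' : R) : Mjg (⟨s, s', 0, 0⟩ : Blk R) ⟨s', s, 0, 0⟩ = 0 :=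
  (Mjg_eq_zero_iff _ _).2 ⟨rfl, rfl, rfl⟩

/-! ## §4 The plane table at the pairs, the pair criterion, and the twin-locality law

The table is v1.1 §0's, valid for EVERY rank-1 direction `v ≠ 0` (null, coordinate or skew): director-hodge R17.77's pre-typing
falsifier «THEOREM P(b) for non-null `v`» PASSED ×2 pencil (s4-search-1 g26, bus l.33906 2026-08-28T23:51:07Z: Künneth on
`P = S_f × P′` kills the component on `Λ²(Λ¹(P′))` for every `v` — the only fact `twin_locality` uses — and the surface sequence gives
`ξ̄_v ∧ Λ¹`; the seat's own pencil via the quotient `q_v : S_f → E′`, Leray and Serre duality; nullness used nowhere). -/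

/-- PARTNER TYPES of a constituent (v1.1 §0): an (r1) LEG on factor `a` with codirection `ξ ∈ V_a`; an (r2a) PAIR of rank-1 blocks
on factors `a`, `b` with codirections `ξ`, `η`; an (r2b) rank-2 STEP on factor `a`. -/
inductive PType (R : Type*)
  | leg (a : Fin 4) (ξ : Fin 2 → R)
  | r2a (a : Fin 4) (ξ : Fin 2 → R) (b : Fin 4) (η : Fin 2 → R)
  | r2b (a : Fin 4)

/-- the factors a partner type spends its rank on. -/
def PType.touches : PType R → Fin 4 → Prop
  | .leg a _, f => a = f
  | .r2a a _ b _, f => a = f ∨ b = f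
  | .r2b a, f => a = f

/-- **THE PLANE TABLE at an ordered pair `(g, j)`** (the `V_g ⊗ V_j` component of `Plane(X, Y)`, as `2 × 2` matrices with rows
`V_g` and columns `V_j`): a leg on `g` with codirection `ξ` gives the ROW space `ξ ⊗ V_j`; a leg on `j` gives the COLUMN space
`V_g ⊗ ξ`; an (r2a) on `{g, j}` gives its line `ξ ⊗ η`; every other type (legs elsewhere, (r2a) on another pair, any (r2b)) gives `0`. -/
def pairPlane (p : PType R) (g j : Fin 4) : Submodule R (Matrix (Fin 2) (Fin 2) R) :=
  match p with
  | .leg a ξ =>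
      if a = g then Submodule.span R {vecMulVec ξ eA, vecMulVec ξ eB}
      else if a = j then Submodule.span R {vecMulVec eA ξ, vecMulVec eB ξ} else ⊥
  | .r2a a ξ b η =>
      if a = g ∧ b = j then Submodule.span R {vecMulVec ξ η}
      else if a = j ∧ b = g then Submodule.span R {vecMulVec η ξ} else ⊥
  | .r2b _ => ⊥

/-- the absorbing space `A(X)_{(g,j)}` of a list of partner types. -/
def absorbAt (L : List (PType R)) (g j : Fin 4) : Submodule R (Matrix (Fin 2) (Fin 2) R) :=
  ⨆ p ∈ L, pairPlane p g j

/-- **THE DIAGONAL CRITERION AT THE PAIRS** for a constituent with blocks `x` and partner types `L`: every pair image is absorbed. -/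
def PairCriterion (x : Fin 4 → Blk R) (L : List (PType R)) : Prop :=
  ∀ g j : Fin 4, g ≠ j → Mjg (x g) (x j) ∈ absorbAt L g j

/-- a partner type that touches `f` has NO component at a pair avoiding `f`. -/
theorem pairPlane_eq_bot_of_touches (p : PType R) {f g j : Fin 4} (hp : p.touches f) (hg : g ≠ f) (hj : j ≠ f) :
    pairPlane p g j = ⊥ := by
  cases p with
  | leg a ξ =>
      simp only [PType.touches] at hp
      subst hp
      simp [pairPlane, hg.symm, hj.symm]
  | r2a a ξ b η =>
      simp only [PType.touches] at hp
      rcases hp with hp | hp <;> subst hp <;> simp [pairPlane, hg.symm, hj.symm]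
  | r2b a => rfl

/-- hence: if EVERY partner type touches `f`, nothing is absorbed at the pairs avoiding `f`. -/
theorem absorbAt_eq_bot_of_touches (L : List (PType R)) {f g j : Fin 4} (hL : ∀ p ∈ L, p.touches f) (hg : g ≠ f)
    (hj : j ≠ f) : absorbAt L g j = ⊥ := by
  simp only [absorbAt, iSup_eq_bot]
  exact fun p hp => pairPlane_eq_bot_of_touches p (hL p hp) hg hj

/-- the three factors other than `f`, as a function of `f`. -/
def others (f : Fin 4) : Fin 3 → Fin 4 := fun k => ![![1, 2, 3], ![0, 2, 3], ![0, 1, 3], ![0, 1, 2]] f k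

theorem others_ne (f : Fin 4) (k : Fin 3) : others f k ≠ f := by
  fin_cases f <;> fin_cases k <;> decide

theorem others_inj (f : Fin 4) {k l : Fin 3} (h : k ≠ l) : others f k ≠ others f l := by
  fin_cases f <;> fin_cases k <;> fin_cases l <;> first | exact absurd rfl h | decide

theorem eq_others_of_ne {f g : Fin 4} (h : g ≠ f) : ∃ k, g = others f k := by
  fin_cases f <;> fin_cases g <;> first | exact absurd rfl h | exact ⟨0, by decide⟩ | exact ⟨1, by decide⟩ | exact ⟨2, by decide⟩

/-- **THE TWIN-LOCALITY LAW.** If a constituent passes the pair criterion and every one of its partner types touches the factor `f`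
— which is forced when NO opposite-level partner shares its `f`-block (a partner differing on `f` spends rank ≥ 1 on `f`) — then
OFF `f` the constituent is ONE PAD: `x_g = s·I₂` for all `g ≠ f`. The cell is `f`-local. -/
theorem twin_locality (x : Fin 4 → Blk R) (L : List (PType R)) (f : Fin 4) (hcrit : PairCriterion x L)
    (hL : ∀ p ∈ L, p.touches f) : ∃ s : R, ∀ g, g ≠ f → x g = Blk.pad s := by
  have van : ∀ g j, g ≠ f → j ≠ f → g ≠ j → Mjg (x g) (x j) = 0 := by
    intro g j hg hj hgj
    have h := hcrit g j hgj
    rwa [absorbAt_eq_bot_of_touches L hL hg hj, Submodule.mem_bot] at h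
  have v3 : ∀ k l : Fin 3, k ≠ l → Mjg (x (others f k)) (x (others f l)) = 0 :=
    fun k l hkl => van _ _ (others_ne f k) (others_ne f l) (others_inj f hkl)
  obtain ⟨h0, h1, h2⟩ := three_blocks_local (x (others f 0)) (x (others f 1)) (x (others f 2))
    (v3 0 1 (by decide)) (v3 1 0 (by decide)) (v3 0 2 (by decide)) (v3 2 0 (by decide))
    (v3 1 2 (by decide)) (v3 2 1 (by decide))
  refine ⟨(x (others f 0)).α, fun g hg => ?_⟩
  obtain ⟨k, rfl⟩ := eq_others_of_ne hg
  fin_cases k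
  · exact h0
  · exact h1
  · exact h2

/-- so an `f`-local cell is balanced and uncharged off `f` (`δ_g = 0`, `β_g = β̄_g = 0` for `g ≠ f`). -/
theorem twin_locality_offcharge (x : Fin 4 → Blk R) (L : List (PType R)) (f : Fin 4) (hcrit : PairCriterion x L)
    (hL : ∀ p ∈ L, p.touches f) (g : Fin 4) (hg : g ≠ f) : (x g).δ = 0 ∧ (x g).β = 0 ∧ (x g).βc = 0 := by
  obtain ⟨s, hs⟩ := twin_locality x L f hcrit hL
  rw [hs g hg]
  exact ⟨sub_self s, rfl, rfl⟩

/-- the `Λ²V_g` row of the plane table: a leg on `g` (`ξ̄_v ∧ V_g = Λ²V_g`) or an (r2b) step on `g` fills `Λ²V_g`; (r2a) lines and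
everything on other factors miss it. -/
def PType.touchesSelf : PType R → Fin 4 → Prop
  | .leg a _, g => a = g
  | .r2a _ _ _ _, _ => False
  | .r2b a, g => a = g

/-- **THE `E_{gg}` ROW OF THE CRITERION** (record of v1.1 §0): the image `(α_g − α′_g) ē_A ∧ ē_B` is absorbed iff it is zero or
some partner fills `Λ²V_g`. -/
def SelfCriterion (x : Fin 4 → Blk R) (L : List (PType R)) : Prop :=
  ∀ g, selfCoeff (x g) = 0 ∨ ∃ p ∈ L, p.touchesSelf g

/-- **Λ²-SELF-DEMAND** (the card's «Λ²V_f lever ∕ (r2b) planes»): an unbalanced block needs a leg or an (r2b) step ON its factor. -/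
theorem self_demand (x : Fin 4 → Blk R) (L : List (PType R)) (h : SelfCriterion x L) (g : Fin 4) (hδ : (x g).δ ≠ 0) :
    ∃ p ∈ L, p.touchesSelf g :=
  (h g).resolve_left (by rwa [selfCoeff_eq_delta])

omit [CommRing R] in
/-- and a type filling `Λ²V_g` touches `g` (so the self-servers of the twin packet are `f`-touching, consistent with §4). -/
theorem touches_of_touchesSelf (p : PType R) (g : Fin 4) (h : p.touchesSelf g) : p.touches g := by
  cases p with
  | leg a ξ => exact h
  | r2a a ξ b η => exact h.elim
  | r2b a => exact h

end PairImage

/-! ## §5 The twin packet: faces, coordinate legs, no mutual partnership, no `μ`, and the NC-failure witness -/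

section TwinPacket

variable {R : Type*} [CommRing R]

/-- the twin letters `(a + d, a − d, β)` and `(a − d, a + d, β)` and their balanced READINGS `(a ∓ d, a ∓ d, β)`. -/
def twinPlus (a d β βc : R) : Blk R := ⟨a + d, a - d, β, βc⟩
def twinMinus (a d β βc : R) : Blk R := ⟨a - d, a + d, β, βc⟩
def lowerReading (a d β βc : R) : Blk R := ⟨a - d, a - d, β, βc⟩
def upperReading (a d β βc : R) : Blk R := ⟨a + d, a + d, β, βc⟩

theorem uFace_twinPlus (a d β βc : R) : (twinPlus a d β βc).uFace = upperReading a d β βc := rfl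
theorem vFace_twinPlus (a d β βc : R) : (twinPlus a d β βc).vFace = lowerReading a d β βc := rfl
theorem uFace_twinMinus (a d β βc : R) : (twinMinus a d β βc).uFace = lowerReading a d β βc := rfl
theorem vFace_twinMinus (a d β βc : R) : (twinMinus a d β βc).vFace = upperReading a d β βc := rfl

theorem delta_twinPlus (a d β βc : R) : (twinPlus a d β βc).δ = 2 * d := by simp only [twinPlus, Blk.δ]; ring
theorem delta_twinMinus (a d β βc : R) : (twinMinus a d β βc).δ = -(2 * d) := by simp only [twinMinus, Blk.δ]; ring

/-- **COORDINATE LEGS.** An `N`-level twin packet hangs over its lower reading by the two rank-1 coordinate differences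
`diag(2d, 0) = 2d · e_A e_A^*` and `diag(0, 2d) = 2d · e_B e_B^*` … -/
theorem twinPlus_sub_lower (a d β βc : R) :
    (twinPlus a d β βc).toMat - (lowerReading a d β βc).toMat = (2 * d) • vecMulVec eA eA := by
  ext i j
  fin_cases i <;> fin_cases j <;> simp [twinPlus, lowerReading, Blk.toMat, eA, two_mul]

theorem twinMinus_sub_lower (a d β βc : R) :
    (twinMinus a d β βc).toMat - (lowerReading a d β βc).toMat = (2 * d) • vecMulVec eB eB := by
  ext i j
  fin_cases i <;> fin_cases j <;> simp [twinMinus, lowerReading, Blk.toMat, eB, two_mul]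

/-- … and a `P`-level twin packet sits under its upper reading by the same two coordinate legs, exchanged. -/
theorem upper_sub_twinPlus (a d β βc : R) :
    (upperReading a d β βc).toMat - (twinPlus a d β βc).toMat = (2 * d) • vecMulVec eB eB := by
  ext i j
  fin_cases i <;> fin_cases j <;> simp [twinPlus, upperReading, Blk.toMat, eB, two_mul]

theorem upper_sub_twinMinus (a d β βc : R) :
    (upperReading a d β βc).toMat - (twinMinus a d β βc).toMat = (2 * d) • vecMulVec eA eA := by
  ext i j
  fin_cases i <;> fin_cases j <;> simp [twinMinus, upperReading, Blk.toMat, eA, two_mul]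

/-- the coordinate legs are rank-1: their `2 × 2` determinant vanishes. -/
theorem det_smul_vecMulVec (c : R) (u v : Fin 2 → R) : (c • vecMulVec u v).det = 0 := by
  simp [Matrix.det_fin_two, vecMulVec_apply]; ring

/-- **TWINS ARE NEVER PARTNERS OF EACH OTHER**: their difference `diag(2d, −2d)` has determinant `−4d²` (indefinite for `d ≠ 0`). -/
theorem twin_diff (a d β βc : R) :
    (twinPlus a d β βc).toMat - (twinMinus a d β βc).toMat = !![2 * d, 0; 0, -(2 * d)] := by
  ext i j
  fin_cases i <;> fin_cases j <;> simp [twinPlus, twinMinus, Blk.toMat] <;> ring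

theorem twin_diff_det (a d β βc : R) :
    ((twinPlus a d β βc).toMat - (twinMinus a d β βc).toMat).det = -(4 * d ^ 2) := by
  rw [twin_diff, Matrix.det_fin_two_of]
  ring

/-- over an ordered field: for `d ≠ 0` that determinant is negative, so neither `X₊ − X₋` nor `X₋ − X₊` is psd. -/
theorem twin_diff_det_neg {K : Type*} [Field K] [LinearOrder K] [IsStrictOrderedRing K] (a d β βc : K) (hd : d ≠ 0) :
    ((twinPlus a d β βc).toMat - (twinMinus a d β βc).toMat).det < 0 := by
  rw [twin_diff_det]
  have : 0 < d ^ 2 := by positivity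
  linarith

/-- **NO `μ` FROM A LOCAL CELL**: the `e`-word reading `Π_f β_f` (LINE 4 §7: `μ` is the `eWord` row) of a cell with an uncharged
factor vanishes. -/
theorem local_cell_mu_zero (x : Fin 4 → Blk R) (g : Fin 4) (hβ : (x g).β = 0) :
    chTensor (fun f => (x f).letter) eWord = 0 := by
  have e3 : ∀ f : Fin 4, eWord f = 3 := by decide
  have hg : g = 0 ∨ g = 1 ∨ g = 2 ∨ g = 3 := by fin_cases g <;> decide
  simp only [chTensor, e3]
  rcases hg with rfl | rfl | rfl | rfl <;> simp [Blk.letter, hβ]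

/-- **NC FAILS IN (F3) — witness.** The balanced charged letter `Z = (α, α, 2, 2)` is served on its factor by the two UNCHARGED
letters `W₁ = (α − 2, α − 2, 0, 0)` (balanced, difference `2·(1,1)(1,1)^*`) and `W₂ = (α − 4, α − 1, 0, 0)` (SKEW, `δ = −3`, difference
`(2,1)(2,1)^*`); the two codirections `(1,1)`, `(2,1)` are independent (determinant `−1`), so `L_f(Z) = V_f` — double service with
no charged server, which LEMMA NC forbids in the balanced alphabet. -/
theorem nc_fails_witness (α : ℤ) :
    (⟨α, α, 2, 2⟩ : Blk ℤ).toMat - (⟨α - 2, α - 2, 0, 0⟩ : Blk ℤ).toMat = (2 : ℤ) • vecMulVec ![1, 1] ![1, 1] ∧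
    (⟨α, α, 2, 2⟩ : Blk ℤ).toMat - (⟨α - 4, α - 1, 0, 0⟩ : Blk ℤ).toMat = vecMulVec ![2, 1] ![2, 1] ∧
    Matrix.det !![(1 : ℤ), 1; 2, 1] = -1 ∧
    (⟨α - 4, α - 1, 0, 0⟩ : Blk ℤ).δ = -3 := by
  refine ⟨?_, ?_, by decide, by simp only [Blk.δ]; ring⟩
  · ext i j
    fin_cases i <;> fin_cases j <;> simp [Blk.toMat]
  · ext i j
    fin_cases i <;> fin_cases j <;> simp [Blk.toMat, vecMulVec_apply]

/-- both servers of the witness are effective differences of the right kind: psd rank 1 (determinant `0`, diagonal entries squares). -/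
theorem nc_witness_rank_one :
    Matrix.det ((2 : ℤ) • vecMulVec ![(1 : ℤ), 1] ![1, 1]) = 0 ∧ Matrix.det (vecMulVec ![(2 : ℤ), 1] ![2, 1]) = 0 := by
  constructor <;> decide

end TwinPacket

/-! ## §6 The column law (LINE 4's companion law summed per `f`-letter value)

LINE 4's COMPANION LAW `UvSwapCompanionLaw.imbalance_moment_eq_zero` reads: under the class screen (A1),
`∑ j ∈ s, c j * (v j f 1 - v j f 2) * rest3 (v j) f x = 0` for every factor `f` and probe word `x`. LINE 4's module is not yet built
on the farm (build-lane backlog), so this section takes that conclusion as the HYPOTHESIS `hmom`, over the VERBATIM copy of LINE 4's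
`rest3`; once LINE 4 is importable, `hmom` is `imbalance_moment_eq_zero s c v hA f` on the nose. -/

section Column

variable {R : Type*} [CommRing R] {ι : Type*}

/-- LINE 4's `rest3` verbatim: the product of the three letters of `u` OFF factor `f` at the probe `x` (the `f`-th vector replaced by `1`). -/
def rest3 (u : Fin 4 → Fin 6 → R) (f : Fin 4) (x : CWord) : R := chTensor (Function.update u f fun _ => 1) x

/-- the signed 3-factor class function `T_b(x)` of the `b`-COLUMN on factor `f`: the cells whose `f`-letter vector is `b`. -/
def columnFn [DecidableEq R] (s : Finset ι) (c : ι → R) (v : ι → Fin 4 → Fin 6 → R) (f : Fin 4) (b : Fin 6 → R)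
    (x : CWord) : R :=
  ∑ j ∈ s.filter (fun j => v j f = b), c j * rest3 (v j) f x

/-- **COLUMN LAW.** If the imbalance moments vanish on factor `f` (LINE 4's companion law), then for every probe `x`:
`Σ_b δ_b · T_b(x) = 0`, the sum over the `f`-letter values `b` occurring in the design, `δ_b = b(u) − b(v)`. -/
theorem column_moment_eq_zero [DecidableEq R] (s : Finset ι) (c : ι → R) (v : ι → Fin 4 → Fin 6 → R) (f : Fin 4)
    (hmom : ∀ x : CWord, ∑ j ∈ s, c j * (v j f 1 - v j f 2) * rest3 (v j) f x = 0) (x : CWord) :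
    ∑ b ∈ s.image (fun j => v j f), (b 1 - b 2) * columnFn s c v f b x = 0 := by
  have key : ∀ b ∈ s.image (fun j => v j f),
      (b 1 - b 2) * columnFn s c v f b x
        = ∑ j ∈ s.filter (fun j => v j f = b), c j * (v j f 1 - v j f 2) * rest3 (v j) f x := by
    intro b _
    rw [columnFn, Finset.mul_sum]
    refine Finset.sum_congr rfl fun j hj => ?_
    rw [← (Finset.mem_filter.1 hj).2]
    ring
  rw [Finset.sum_congr rfl key,
    Finset.sum_fiberwise_of_maps_to (g := fun j => v j f) (fun j hj => Finset.mem_image_of_mem _ hj)]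
  exact hmom x

/-- **TWIN COLUMNS AGREE.** If the cells unbalanced on `f` take exactly two `f`-letter values `b₊ ≠ b₋` with opposite non-zero
imbalances (twin values `(a ± d, a ∓ d, β)`), then the two columns have the SAME signed 3-factor class function:
`T_{b₊}(x) = T_{b₋}(x)` for every probe `x` (in a domain). For one cell per column at one level this is LINE 4's
`companion_pair_agree_off`. -/
theorem twin_columns_agree [IsDomain R] [DecidableEq R] (s : Finset ι) (c : ι → R) (v : ι → Fin 4 → Fin 6 → R) (f : Fin 4)
    (hmom : ∀ x : CWord, ∑ j ∈ s, c j * (v j f 1 - v j f 2) * rest3 (v j) f x = 0)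
    (bp bm : Fin 6 → R) (hne : bp ≠ bm) (hδ : bm 1 - bm 2 = -(bp 1 - bp 2)) (hδ0 : bp 1 - bp 2 ≠ 0)
    (honly : ∀ j ∈ s, v j f 1 ≠ v j f 2 → v j f = bp ∨ v j f = bm) (x : CWord) :
    columnFn s c v f bp x = columnFn s c v f bm x := by
  have h := hmom x
  -- split the moment sum into the `bp`-column, the `bm`-column and the balanced rest
  rw [← Finset.sum_filter_add_sum_filter_not s (fun j => v j f = bp),
    ← Finset.sum_filter_add_sum_filter_not (s.filter fun j => ¬ v j f = bp) (fun j => v j f = bm)] at h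
  have hp : ∑ j ∈ s.filter (fun j => v j f = bp), c j * (v j f 1 - v j f 2) * rest3 (v j) f x
      = (bp 1 - bp 2) * columnFn s c v f bp x := by
    rw [columnFn, Finset.mul_sum]
    refine Finset.sum_congr rfl fun j hj => ?_
    rw [(Finset.mem_filter.1 hj).2]
    ring
  have hm : ∑ j ∈ (s.filter fun j => ¬ v j f = bp).filter (fun j => v j f = bm),
      c j * (v j f 1 - v j f 2) * rest3 (v j) f x = -(bp 1 - bp 2) * columnFn s c v f bm x := by
    rw [columnFn, Finset.mul_sum, Finset.filter_filter]
    have hs : s.filter (fun j => ¬ v j f = bp ∧ v j f = bm) = s.filter (fun j => v j f = bm) := by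
      refine Finset.filter_congr fun j _ => ⟨fun h => h.2, fun h => ⟨?_, h⟩⟩
      rw [h]; exact hne.symm
    rw [hs]
    refine Finset.sum_congr rfl fun j hj => ?_
    rw [(Finset.mem_filter.1 hj).2, hδ]
    ring
  have hr : ∑ j ∈ (s.filter fun j => ¬ v j f = bp).filter (fun j => ¬ v j f = bm),
      c j * (v j f 1 - v j f 2) * rest3 (v j) f x = 0 := by
    refine Finset.sum_eq_zero fun j hj => ?_
    simp only [Finset.mem_filter] at hj
    obtain ⟨⟨hjs, hjp⟩, hjm⟩ := hj
    have hbal : v j f 1 = v j f 2 := by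
      by_contra hne'
      rcases honly j hjs hne' with h' | h'
      · exact hjp h'
      · exact hjm h'
    rw [hbal, sub_self, mul_zero, zero_mul]
  rw [hp, hm, hr, add_zero] at h
  have h' : (bp 1 - bp 2) * (columnFn s c v f bp x - columnFn s c v f bm x) = 0 := by
    linear_combination h
  rcases mul_eq_zero.1 h' with h'' | h''
  · exact (hδ0 h'').elim
  · exact sub_eq_zero.1 h''

end Column

/-! ## §7 Return-to-balance triangles (rev 2; the C5-0 = YES follow-up, card §«C5-0 = YES»)

A thin head `X = [O|O|O|x]`, `x` balanced non-null, is served by an `f`-local unbalanced `W = [O|O|O|x − A]` (`A` rank-1 psd,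
non-null) iff `W` has ONE more leg partner `Z = [O|O|O|z]` at `X`'s level with `z − W = B` rank-1 psd, `B ∦ A`; then
`x − z = A − B`.  The algebra of record: a difference of two rank-one pieces has determinant `−(a × b)(ā × b̄)` — it is
INDEFINITE unless the pieces are parallel (`det_vecMulVec_sub_vecMulVec`) — and the hand-checked instance on the ◇₈ core's first
head `x = 2I + 3ℓ_u` (`u = 1`; other phases by rotation): `x − D₊ = (1,3)(1,3)ᵀ`, `z − D₊ = (1,−3)(1,−3)ᵀ` for the phase-sibling
`z = 2I + 3ℓ_{−u}`, `4I − D₊ = 8·e_B e_Bᵀ`, with `D₊ = diag(4, −4)` UNBALANCED (`δ = 8`) and both legs non-null and non-parallel;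
the ◇₁₀ head `2I + 4ℓ_u` likewise with `diag(4, −2)`.  Integer certificates (`decide`); the enumeration of all bounded
triangles is the card's table (hub-local, `triangles.py` 1e363af61cb886ef).  First order is NECESSARY only: nothing here makes a
design pass (H2).
-/

section Triangle

variable {R : Type*} [CommRing R]

/-- **a difference of two rank-one pieces is indefinite or the pieces are parallel**:
`det (a ⊗ ā − b ⊗ b̄) = −(a₀ b₁ − a₁ b₀)(ā₀ b̄₁ − ā₁ b̄₀)` (formal conjugates `ac`, `bc`). -/
theorem det_vecMulVec_sub_vecMulVec (a ac b bc : Fin 2 → R) :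
    (vecMulVec a ac - vecMulVec b bc).det = -((a 0 * b 1 - a 1 * b 0) * (ac 0 * bc 1 - ac 1 * bc 0)) := by
  simp [Matrix.det_fin_two, vecMulVec_apply]; ring

/-- hence a BALANCED difference `x − z = A − B` of two alphabet letters with `A ∦ B` has NEGATIVE determinant over `ℤ`
(real frame: `ac = a`, `bc = b`): `det = −(a × b)²`. -/
theorem det_vecMulVec_sub_vecMulVec_real (a b : Fin 2 → ℤ) :
    (vecMulVec a a - vecMulVec b b).det = -(a 0 * b 1 - a 1 * b 0) ^ 2 := by
  rw [det_vecMulVec_sub_vecMulVec]; ring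

/-- the ◇₈ instance (`u = 1`): head `x = 2I+3ℓ = (5,5,3,3)`, server `D₊ = diag(4,−4)`, rebalancers `z = 2I+3ℓ₋ = (5,5,−3,−3)`
and `4I`: `x − D₊ = (1,3)(1,3)ᵀ`, `z − D₊ = (1,−3)(1,−3)ᵀ`, `4I − D₊ = 8·e_B e_Bᵀ`; and the uv-twin `D₋ = diag(−4,4)`:
`x − D₋ = (3,1)(3,1)ᵀ`, `z − D₋ = (−3,1)(−3,1)ᵀ`, `4I − D₋ = 8·e_A e_Aᵀ`. -/
theorem triangle_D8 :
    (⟨5, 5, 3, 3⟩ : Blk ℤ).toMat - (⟨4, -4, 0, 0⟩ : Blk ℤ).toMat = vecMulVec ![1, 3] ![1, 3] ∧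
    (⟨5, 5, -3, -3⟩ : Blk ℤ).toMat - (⟨4, -4, 0, 0⟩ : Blk ℤ).toMat = vecMulVec ![1, -3] ![1, -3] ∧
    (⟨4, 4, 0, 0⟩ : Blk ℤ).toMat - (⟨4, -4, 0, 0⟩ : Blk ℤ).toMat = (8 : ℤ) • vecMulVec eB eB ∧
    (⟨5, 5, 3, 3⟩ : Blk ℤ).toMat - (⟨-4, 4, 0, 0⟩ : Blk ℤ).toMat = vecMulVec ![3, 1] ![3, 1] ∧
    (⟨5, 5, -3, -3⟩ : Blk ℤ).toMat - (⟨-4, 4, 0, 0⟩ : Blk ℤ).toMat = vecMulVec ![-3, 1] ![-3, 1] ∧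
    (⟨4, 4, 0, 0⟩ : Blk ℤ).toMat - (⟨-4, 4, 0, 0⟩ : Blk ℤ).toMat = (8 : ℤ) • vecMulVec eA eA := by
  refine ⟨?_, ?_, ?_, ?_, ?_, ?_⟩ <;> (ext i j; fin_cases i <;> fin_cases j <;> rfl)

/-- the two legs of `D₊` from `x` and `z` are NON-parallel (`(1,3) × (1,−3) = −6 ≠ 0`) and NON-null (`1 ≠ 9`), and `D₊`
is unbalanced (`δ = 8`): the head `2I+3ℓ_u` keeps a full set of legs WITHOUT its antipodal in-alphabet server `4ℓ_u`. -/
theorem triangle_D8_legs :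
    (1 : ℤ) * (-3) - 3 * 1 ≠ 0 ∧ ((1 : ℤ) ^ 2 ≠ 3 ^ 2) ∧ (⟨4, -4, 0, 0⟩ : Blk ℤ).δ = 8 := by
  refine ⟨by decide, by decide, by rfl⟩

/-- the ◇₁₀ instance: head `2I+4ℓ = (6,6,4,4)`, server `diag(4,−2)` (`δ = 6`): `x − S′ = 2·(1,2)(1,2)ᵀ`,
`z − S′ = 2·(1,−2)(1,−2)ᵀ` for `z = 2I+4ℓ₋`, `4I − S′ = 6·e_B e_Bᵀ`. -/
theorem triangle_D10 :
    (⟨6, 6, 4, 4⟩ : Blk ℤ).toMat - (⟨4, -2, 0, 0⟩ : Blk ℤ).toMat = (2 : ℤ) • vecMulVec ![1, 2] ![1, 2] ∧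
    (⟨6, 6, -4, -4⟩ : Blk ℤ).toMat - (⟨4, -2, 0, 0⟩ : Blk ℤ).toMat = (2 : ℤ) • vecMulVec ![1, -2] ![1, -2] ∧
    (⟨4, 4, 0, 0⟩ : Blk ℤ).toMat - (⟨4, -2, 0, 0⟩ : Blk ℤ).toMat = (6 : ℤ) • vecMulVec eB eB := by
  refine ⟨?_, ?_, ?_⟩ <;> (ext i j; fin_cases i <;> fin_cases j <;> rfl)

end Triangle

/-! ## §8 Thin heads in the typed plane table (rev 3; kernel for (T0)–(T2) of the triangle criterion, and the critic's T5-1∕T5-4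
down payment at the cells LINE 5's census words are about)

A THIN cell `[O|O|O|b]` (`thin f b`: block `b` on `f`, the zero pad elsewhere).  (T0) `thin_one_codirection_forces_null`: if all its
`f`-legs have ONE codirection `ξ`, the pair criterion forces `b` NULL (`α α′ = β β̄`) — so a non-null head (balanced or not) needs legs
of two independent codirections; (T1∕T2) `thin_two_legs_pass`: two legs on `f` with codirections of unit cross-determinant absorb
EVERY pair image, so the criterion holds whatever `b` is.  Instance: the ◇₈ server `D₊ = diag(4,−4)` with its two legs `(1,3)`,
`(1,−3)` from the heads `2I+3ℓ_{±1}` (§7) PASSES over `ℚ` (`triangle_D8_pairCriterion`), and with one leg it would FAIL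
(`D8_one_leg_fails`, det `D₊ = −16 ≠ 0`).  The encoder side of the same cells is `Pad4TowerRuleDMu4.settledBelow_of_O` ((R-O): an
`O`-factor forces every non-zero adapted coordinate elsewhere to be settled) — the bridge `RuleDMu4N ↔ PairCriterion` at thin cells is
these two facts plus the dictionary «leg of direction `k` ↦ `PType.leg f ξ_k`»; the general bridge (critic T5-1) is NOT typed here.
-/

section Thin

variable {R : Type*} [CommRing R]

/-- the thin cell with block `b` on factor `f` and the zero pad elsewhere. -/
def thin (f : Fin 4) (b : Blk R) : Fin 4 → Blk R := fun g => if g = f then b else Blk.pad 0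

@[simp] theorem thin_self (f : Fin 4) (b : Blk R) : thin f b f = b := by simp [thin]

theorem thin_ne (f : Fin 4) (b : Blk R) {g : Fin 4} (hg : g ≠ f) : thin f b g = Blk.pad 0 := by simp [thin, hg]

/-- a factor other than `f`. -/
theorem exists_ne_factor (f : Fin 4) : ∃ g : Fin 4, g ≠ f := ⟨f + 1, by fin_cases f <;> decide⟩

/-- the absorbing space of a one-type list is that type's plane. -/
theorem absorbAt_singleton (p : PType R) (g j : Fin 4) : absorbAt [p] g j = pairPlane p g j := by
  simp [absorbAt]

/-- each listed type's plane sits inside the absorbing space. -/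
theorem pairPlane_le_absorbAt {L : List (PType R)} {p : PType R} (hp : p ∈ L) (g j : Fin 4) :
    pairPlane p g j ≤ absorbAt L g j := by
  show pairPlane p g j ≤ ⨆ q ∈ L, pairPlane q g j
  exact le_iSup₂_of_le p hp le_rfl

/-- **(T0) ONE CODIRECTION FORCES A NULL HEAD.** If the thin cell `[O|O|O|b]` passes the pair criterion with the single partner type
«leg on `f` with codirection `ξ`», then `b` is NULL: `α α′ − β β̄ = 0`.  (Row space `ξ ⊗ V_j` must contain `(α, β)ᵀ ⊗ ē_B`, column
space `V_g ⊗ ξ` must contain `ē_A ⊗ (−β̄, −α′)`: both vectors are multiples of `ξ`.)  Contrapositive: a non-null thin head — every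
balanced alphabet letter except `O` and the rays, and every unbalanced `W` with `det W ≠ 0` — needs `f`-legs of at least two
codirections. -/
theorem thin_one_codirection_forces_null (f : Fin 4) (b : Blk R) (ξ : Fin 2 → R)
    (h : PairCriterion (thin f b) [PType.leg f ξ]) : b.α * b.α' - b.β * b.βc = 0 := by
  obtain ⟨g, hg⟩ := exists_ne_factor f
  have h1 : Mjg b (Blk.pad 0) ∈ Submodule.span R {vecMulVec ξ eA, vecMulVec ξ eB} := by
    simpa [absorbAt_singleton, pairPlane, thin_ne f b hg] using h f g (Ne.symm hg)
  have h2 : Mjg (Blk.pad 0) b ∈ Submodule.span R {vecMulVec eA ξ, vecMulVec eB ξ} := by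
    simpa [absorbAt_singleton, pairPlane, thin_ne f b hg, Ne.symm hg] using h g f hg
  rw [Submodule.mem_span_pair] at h1 h2
  obtain ⟨c, d, hcd⟩ := h1
  obtain ⟨c', d', hcd'⟩ := h2
  have e01 := congr_fun (congr_fun hcd 0) 1
  have e11 := congr_fun (congr_fun hcd 1) 1
  have f00 := congr_fun (congr_fun hcd' 0) 0
  have f01 := congr_fun (congr_fun hcd' 0) 1
  simp [Mjg, eA, eB, Blk.pad] at e01 e11 f00 f01
  -- e01 : d * ξ 0 = b.α ; e11 : d * ξ 1 = b.β ; f00 : c' * ξ 0 = -b.βc ; f01 : c' * ξ 1 = -b.α'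
  linear_combination b.α * f01 - b.β * f00 + (c' * ξ 1) * e01 - (c' * ξ 0) * e11

/-- two ROW legs with unit cross-determinant absorb every matrix. -/
theorem mem_sup_row_legs (ξ η : Fin 2 → R) (hdet : IsUnit (ξ 0 * η 1 - ξ 1 * η 0)) (M : Matrix (Fin 2) (Fin 2) R) :
    M ∈ Submodule.span R {vecMulVec ξ eA, vecMulVec ξ eB} ⊔ Submodule.span R {vecMulVec η eA, vecMulVec η eB} := by
  obtain ⟨u, hu⟩ := hdet.exists_left_inv
  have hrow : ∀ (ζ w : Fin 2 → R), vecMulVec ζ w ∈ Submodule.span R {vecMulVec ζ eA, vecMulVec ζ eB} := by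
    intro ζ w
    rw [Submodule.mem_span_pair]
    exact ⟨w 0, w 1, by ext i j; fin_cases j <;> simp [vecMulVec_apply, eA, eB, mul_comm]⟩
  have hM : M = vecMulVec ξ (fun j => u * (η 1 * M 0 j - η 0 * M 1 j)) + vecMulVec η (fun j => u * (-(ξ 1 * M 0 j) + ξ 0 * M 1 j)) := by
    ext i j
    fin_cases i
    · simp [vecMulVec_apply]; linear_combination (-(M 0 j)) * hu
    · simp [vecMulVec_apply]; linear_combination (-(M 1 j)) * hu
  rw [hM]
  exact Submodule.add_mem_sup (hrow ξ _) (hrow η _)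

/-- two COLUMN legs with unit cross-determinant absorb every matrix. -/
theorem mem_sup_col_legs (ξ η : Fin 2 → R) (hdet : IsUnit (ξ 0 * η 1 - ξ 1 * η 0)) (M : Matrix (Fin 2) (Fin 2) R) :
    M ∈ Submodule.span R {vecMulVec eA ξ, vecMulVec eB ξ} ⊔ Submodule.span R {vecMulVec eA η, vecMulVec eB η} := by
  obtain ⟨u, hu⟩ := hdet.exists_left_inv
  have hcol : ∀ (ζ w : Fin 2 → R), vecMulVec w ζ ∈ Submodule.span R {vecMulVec eA ζ, vecMulVec eB ζ} := by
    intro ζ w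
    rw [Submodule.mem_span_pair]
    exact ⟨w 0, w 1, by ext i j; fin_cases i <;> simp [vecMulVec_apply, eA, eB, mul_comm]⟩
  have hM : M = vecMulVec (fun i => u * (η 1 * M i 0 - η 0 * M i 1)) ξ + vecMulVec (fun i => u * (-(ξ 1 * M i 0) + ξ 0 * M i 1)) η := by
    ext i j
    fin_cases j
    · simp [vecMulVec_apply]; linear_combination (-(M i 0)) * hu
    · simp [vecMulVec_apply]; linear_combination (-(M i 1)) * hu
  rw [hM]
  exact Submodule.add_mem_sup (hcol ξ _) (hcol η _)

/-- **(T1∕T2) TWO INDEPENDENT LEGS PASS.** A thin cell with two `f`-legs of codirections `ξ`, `η`, `ξ × η` a unit, passes the pair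
criterion — whatever its block `b` (balanced head or unbalanced server) and whatever else is in the list. -/
theorem thin_two_legs_pass (f : Fin 4) (b : Blk R) (ξ η : Fin 2 → R) (hdet : IsUnit (ξ 0 * η 1 - ξ 1 * η 0))
    (L : List (PType R)) (hξ : PType.leg f ξ ∈ L) (hη : PType.leg f η ∈ L) : PairCriterion (thin f b) L := by
  intro g j hgj
  by_cases hg : g = f
  · subst hg
    have key := mem_sup_row_legs ξ η hdet (Mjg (thin g b g) (thin g b j))
    have h1 : Submodule.span R {vecMulVec ξ eA, vecMulVec ξ eB} ≤ absorbAt L g j := by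
      simpa [pairPlane] using pairPlane_le_absorbAt hξ g j
    have h2 : Submodule.span R {vecMulVec η eA, vecMulVec η eB} ≤ absorbAt L g j := by
      simpa [pairPlane] using pairPlane_le_absorbAt hη g j
    exact sup_le h1 h2 key
  · by_cases hj : j = f
    · subst hj
      have hjg : j ≠ g := fun e => hg e.symm
      have key := mem_sup_col_legs ξ η hdet (Mjg (thin j b g) (thin j b j))
      have h1 : Submodule.span R {vecMulVec eA ξ, vecMulVec eB ξ} ≤ absorbAt L g j := by
        simpa [pairPlane, hjg] using pairPlane_le_absorbAt hξ g j
      have h2 : Submodule.span R {vecMulVec eA η, vecMulVec eB η} ≤ absorbAt L g j := by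
        simpa [pairPlane, hjg] using pairPlane_le_absorbAt hη g j
      exact sup_le h1 h2 key
    · rw [thin_ne f b hg, thin_ne f b hj, Mjg_pad]
      exact Submodule.zero_mem _

/-- INSTANCE (§7's ◇₈ triangle, `u = 1`, over `ℚ`): the server `D₊ = diag(4,−4)` with its two legs from the heads `2I+3ℓ_{±1}`
(codirections `(1,3)`, `(1,−3)`, cross-determinant `−6`, a unit of `ℚ`) PASSES the pair criterion … -/
theorem triangle_D8_pairCriterion (f : Fin 4) :
    PairCriterion (thin f (⟨4, -4, 0, 0⟩ : Blk ℚ)) [PType.leg f ![1, 3], PType.leg f ![1, -3]] :=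
  thin_two_legs_pass f _ ![1, 3] ![1, -3] (isUnit_iff_ne_zero.2 (by norm_num)) _ (by simp) (by simp)

/-- … and with ONE leg it would FAIL (`det D₊ = −16 ≠ 0`): the return-to-balance partner is NECESSARY. -/
theorem D8_one_leg_fails (f : Fin 4) (ξ : Fin 2 → ℚ) : ¬ PairCriterion (thin f (⟨4, -4, 0, 0⟩ : Blk ℚ)) [PType.leg f ξ] := by
  intro h
  have := thin_one_codirection_forces_null f _ ξ h
  norm_num at this

/-- and the balanced HEAD `2I+3ℓ` itself (`det = 16 ≠ 0`) likewise needs two codirections: with its own-direction null leg alone it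
fails — the kernel form of «clause #1 of the ◇₈ core is the antipodal demand». -/
theorem head_2I3l_one_leg_fails (f : Fin 4) (ξ : Fin 2 → ℚ) : ¬ PairCriterion (thin f (⟨5, 5, 3, 3⟩ : Blk ℚ)) [PType.leg f ξ] := by
  intro h
  have := thin_one_codirection_forces_null f _ ξ h
  norm_num at this

end Thin

/-! ## §9 The thin-cell BRIDGE to the encoder's RULE D (rev 4; critic T5-1 at the cells LINE 5's census words are about)

`Pad4TowerRuleDMu4.RuleDMu4N` is the census encoder's first-order predicate on 𝔅(μ₄) configurations (typed by the Ventures typer,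
= PAD4-BALANCED §1′ RULE D).  For a THIN `N`-cell `Z = [O|O|O|x]` whose `f`-letter is a CHARGED NON-RAY μ₄ letter
`x = t·I + c·ℓ_{ζ}` (`t ≥ 1`, `c ≥ 1`: every tower and raised node of ◇ — in particular the heads `2I+3ℓ_u`, `2I+4ℓ_u` of the
cores' clause #1), in a configuration whose `P`-letters are effective and μ₄-phased on `f`, we PROVE
`RuleDMu4N C Z ↔ PairCriterion (blocks of Z over ℂ) (the legs Z is served along below)`:
RULE D ⟺ `Z` is served below on `f` in BOTH frame directions `k₀`, `k₀+2` (`ruleDN_thin_charged_iff`: (R-O) = `settledBelow_of_O`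
plus «below a charged axis letter only the two frame directions exist», `dir_below_charged`) ⟺ the typed plane table absorbs every
pair image (§8: two independent codirections pass; ONE codirection forces a null letter, and `x` is not null).  Dictionary line used:
«served along direction `r` on `f`» ↦ `PType.leg f ξ_r`, `ξ_r = (1, conj(i^r))` = the row of the unit letter `ℓ_{i^r}` (for the
charged non-ray case only «distinct directions give independent codirections» is used; the RAY case `ruleD_thin_ray_iff_pairCriterion`
fixes the conjugation: one own-direction leg must absorb both demands of the null letter, and it does exactly with this `ξ_r`).
Rev 5 adds the RAY case (`t = 0`, `c ≥ 1`: RULE D ⟺ own-direction service ⟺ criterion, `thin_parallel_leg_pass` ∕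
`thin_no_partner_alpha` ∕ `dir_eq_of_below_ray`) and the APEX case (`c = 0`, `t ≥ 1`: two distinct directions on both sides), so every
thin `N`-cell with a non-zero ◇-letter is covered.  NOT covered (still owed on T5-1): cells charged on ≥ 2 factors ((r2a) covers ↦
`PType.r2a` lines, apex freedom `DirOK` ↦ `no_coincidence_through_unbalanced`), NON-QUIET `P`-cells (`RuleDMu4P`: NOT merely symmetric — an
`O`-factor of a `P`-cell is not a floor, `N`-cells `[d·ℓ|O|O|y]` sit above it and serve on that factor), and unbalanced letters (the
encoder has none: U4-3 (ii)).
-/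

section Bridge

/-- the `ℂ`-block `⟨α, α, β, β̄⟩` of a balanced 𝔅(μ₄) point `(α, Re β, Im β)`. -/
noncomputable def blkOfPt (x : BPoint) : Blk ℂ :=
  ⟨(x.1 : ℂ), (x.1 : ℂ), (x.2.1 : ℂ) + (x.2.2 : ℂ) * Complex.I, (x.2.1 : ℂ) - (x.2.2 : ℂ) * Complex.I⟩

theorem blkOfPt_O : blkOfPt (0, 0, 0) = Blk.pad 0 := by
  simp [blkOfPt, Blk.pad]

/-- the blocks of a thin 𝔅(μ₄) cell are `thin f (block on f)`. -/
theorem blk_thin {Z : MCell} {f : Fin 4} (hthin : ∀ g, g ≠ f → Z g = (0, 0, 0)) :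
    (fun g => blkOfPt (Z g)) = thin f (blkOfPt (Z f)) := by
  funext g
  by_cases hg : g = f
  · subst hg; simp [thin]
  · rw [thin_ne f _ hg, hthin g hg, blkOfPt_O]

/-- the codirection of the null direction `r`: `ξ_r = (1, conj(i^r))` — the ROW `(α, β)` of the unit letter `ℓ_{i^r}` (its block
is `[[1, ζ̄],[ζ, 1]]`, `ζ = i^r`), so that a null ray's own-direction leg absorbs both its row demand `(α, β) = c(1, ζ̄)` and its
column demand `(β̄, α′) = cζ·(1, ζ̄)` (`ruleD_thin_ray_iff_pairCriterion` below would be FALSE for the phases `±i` with `(1, ζ)`). -/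
noncomputable def ξdir (r : Fin 4) : Fin 2 → ℂ := ![1, ![1, -Complex.I, -1, Complex.I] r]

/-- distinct directions have independent codirections (cross-determinant `conj(i^{r′}) − conj(i^{r}) ≠ 0`). -/
theorem ξdir_cross_isUnit {r r' : Fin 4} (h : r ≠ r') : IsUnit (ξdir r 0 * ξdir r' 1 - ξdir r 1 * ξdir r' 0) := by
  rw [isUnit_iff_ne_zero]
  fin_cases r <;> fin_cases r' <;> first | exact absurd rfl h | norm_num [ξdir, Complex.ext_iff]

/-- the typed partner list of an `N`-cell on `f`: one LEG per direction it is served along below. -/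
noncomputable def legsBelow (C : MConfig) (Z : MCell) (f : Fin 4) : List (PType ℂ) :=
  ((Finset.univ.filter fun r => MServedBelow C Z f r).toList).map fun r => PType.leg f (ξdir r)

theorem mem_legsBelow {C : MConfig} {Z : MCell} {f r : Fin 4} (h : MServedBelow C Z f r) :
    PType.leg f (ξdir r) ∈ legsBelow C Z f :=
  List.mem_map.2 ⟨r, by simpa [Finset.mem_toList] using h, rfl⟩

theorem of_mem_legsBelow {C : MConfig} {Z : MCell} {f : Fin 4} {p : PType ℂ} (h : p ∈ legsBelow C Z f) :
    ∃ r, MServedBelow C Z f r ∧ p = PType.leg f (ξdir r) := by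
  obtain ⟨r, hr, rfl⟩ := List.mem_map.1 h
  exact ⟨r, by simpa [Finset.mem_toList] using hr, rfl⟩

/-- **(T0′)** the list form of `thin_one_codirection_forces_null`: if EVERY listed type is a leg on `f` with codirection a multiple
of `ξ` (none at all included), the pair criterion forces the thin cell's letter NULL. -/
theorem thin_codirections_parallel_forces_null {R : Type*} [CommRing R] (f : Fin 4) (b : Blk R) (ξ : Fin 2 → R)
    (L : List (PType R)) (hL : ∀ p ∈ L, ∃ c : R, p = PType.leg f (c • ξ)) (h : PairCriterion (thin f b) L) :
    b.α * b.α' - b.β * b.βc = 0 := by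
  obtain ⟨g, hg⟩ := exists_ne_factor f
  have smul_vmv_l : ∀ (c : R) (v w : Fin 2 → R), vecMulVec (c • v) w = c • vecMulVec v w := fun c v w => by
    ext i j; simp [vecMulVec_apply, mul_assoc]
  have smul_vmv_r : ∀ (c : R) (v w : Fin 2 → R), vecMulVec v (c • w) = c • vecMulVec v w := fun c v w => by
    ext i j; simp [vecMulVec_apply, mul_left_comm]
  have hrow : absorbAt L f g ≤ Submodule.span R {vecMulVec ξ eA, vecMulVec ξ eB} := by
    refine iSup₂_le fun p hp => ?_
    obtain ⟨c, rfl⟩ := hL p hp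
    simp only [pairPlane, if_true]
    refine Submodule.span_le.2 ?_
    rintro M (rfl | rfl)
    · rw [smul_vmv_l]; exact Submodule.smul_mem _ c (Submodule.subset_span (by simp))
    · rw [smul_vmv_l]; exact Submodule.smul_mem _ c (Submodule.subset_span (by simp))
  have hcol : absorbAt L g f ≤ Submodule.span R {vecMulVec eA ξ, vecMulVec eB ξ} := by
    refine iSup₂_le fun p hp => ?_
    obtain ⟨c, rfl⟩ := hL p hp
    have e : pairPlane (PType.leg f (c • ξ)) g f = Submodule.span R {vecMulVec eA (c • ξ), vecMulVec eB (c • ξ)} := by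
      simp [pairPlane, Ne.symm hg]
    rw [e]
    refine Submodule.span_le.2 ?_
    rintro M (rfl | rfl)
    · rw [smul_vmv_r]; exact Submodule.smul_mem _ c (Submodule.subset_span (by simp))
    · rw [smul_vmv_r]; exact Submodule.smul_mem _ c (Submodule.subset_span (by simp))
  have h1 : Mjg b (Blk.pad 0) ∈ Submodule.span R {vecMulVec ξ eA, vecMulVec ξ eB} := by
    have := h f g (Ne.symm hg); rw [thin_self, thin_ne f b hg] at this; exact hrow this
  have h2 : Mjg (Blk.pad 0) b ∈ Submodule.span R {vecMulVec eA ξ, vecMulVec eB ξ} := by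
    have := h g f hg; rw [thin_self, thin_ne f b hg] at this; exact hcol this
  rw [Submodule.mem_span_pair] at h1 h2
  obtain ⟨c, d, hcd⟩ := h1
  obtain ⟨c', d', hcd'⟩ := h2
  have e01 := congr_fun (congr_fun hcd 0) 1
  have e11 := congr_fun (congr_fun hcd 1) 1
  have f00 := congr_fun (congr_fun hcd' 0) 0
  have f01 := congr_fun (congr_fun hcd' 0) 1
  simp [Mjg, eA, eB, Blk.pad] at e01 e11 f00 f01
  linear_combination b.α * f01 - b.β * f00 + (c' * ξ 1) * e01 - (c' * ξ 0) * e11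

variable {C : MConfig}

/-- **RULE D at a thin cell** (encoder side, (R-O)): with all `P`-letters effective, `[O|O|O|x]` passes RULE D iff every adapted
NON-ZERO frame coordinate of `x` is settled below. -/
theorem ruleDN_thin_iff (hcone : ∀ P ∈ C.upper, ∀ g, Effective (P g)) {Z : MCell} {f : Fin 4}
    (hthin : ∀ g, g ≠ f → Z g = (0, 0, 0)) :
    RuleDMu4N C Z ↔ ∀ k, Adapted (Z f) k → coord (Z f) k ≠ 0 → SettledBelow C Z f k := by
  have hcO : ∀ g, g ≠ f → ∀ k, coord (Z g) k = 0 := fun g hg k => by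
    rw [hthin g hg]; fin_cases k <;> simp [coord]
  constructor
  · intro hZ k hadk hne
    obtain ⟨g, hg⟩ := exists_ne_factor f
    exact settledBelow_of_O hZ hcone (hthin g hg) (Ne.symm hg) hadk hne
  · intro h g j hgj k k' hadg hadj hne
    by_cases hg : g = f
    · subst hg
      rw [hcO j (Ne.symm hgj) k'] at hne
      exact Or.inl (h k hadg hne)
    · by_cases hj : j = f
      · subst hj
        rw [hcO g hg k] at hne
        exact Or.inr (Or.inl (h k' hadj (Ne.symm hne)))
      · rw [hcO g hg k, hcO j hj k'] at hne
        exact absurd rfl hne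

/-- below a CHARGED μ₄ letter `t·I + c·ℓ_{i^{k₀}}` (`c ≥ 1`) only the two FRAME directions `k₀`, `k₀ + 2` lead to μ₄-phased
letters («from a tower DOWN: own direction or antipodal», memo (0.2)). -/
theorem dir_below_charged {t c d : ℤ} (hc : 1 ≤ c) (hd : 1 ≤ d) {k₀ r : Fin 4} {y : BPoint}
    (hy : y.2.1 = 0 ∨ y.2.2 = 0) (h : ray (t, 0, 0) k₀ c = ray y r d) : r = k₀ ∨ r = k₀ + 2 := by
  fin_cases k₀ <;> fin_cases r <;> simp [ray, Prod.ext_iff] at h ⊢ <;> omega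

/-- hence a thin cell with charged `f`-letter is served below on `f` only along `k₀` or `k₀ + 2`. -/
theorem served_dir_thin_charged {Z : MCell} {f k₀ : Fin 4} {t c : ℤ} (hc : 1 ≤ c)
    (haxis : ∀ P ∈ C.upper, (P f).2.1 = 0 ∨ (P f).2.2 = 0) (hZf : Z f = ray (t, 0, 0) k₀ c) {r : Fin 4}
    (hr : MServedBelow C Z f r) : r = k₀ ∨ r = k₀ + 2 := by
  obtain ⟨P, hP, -, hlt, hray⟩ := hr
  rw [hZf] at hlt hray
  exact dir_below_charged hc (d := (ray (t, 0, 0) k₀ c).1 - (P f).1) (by omega) (haxis P hP) hray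

/-- **RULE D at a thin cell with a charged non-ray letter = service in BOTH frame directions.** -/
theorem ruleDN_thin_charged_iff (hcone : ∀ P ∈ C.upper, ∀ g, Effective (P g)) {Z : MCell} {f k₀ : Fin 4} {t c : ℤ}
    (hthin : ∀ g, g ≠ f → Z g = (0, 0, 0)) (haxis : ∀ P ∈ C.upper, (P f).2.1 = 0 ∨ (P f).2.2 = 0)
    (hZf : Z f = ray (t, 0, 0) k₀ c) (hc : 1 ≤ c) (ht : 1 ≤ t) :
    RuleDMu4N C Z ↔ MServedBelow C Z f k₀ ∧ MServedBelow C Z f (k₀ + 2) := by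
  rw [ruleDN_thin_iff hcone hthin]
  have hk22 : k₀ + 2 + 2 = k₀ := by fin_cases k₀ <;> decide
  have had₀ : Adapted (Z f) k₀ ∧ coord (Z f) k₀ ≠ 0 := by
    rw [hZf]; fin_cases k₀ <;> simp [Adapted, coord] <;> omega
  have had₂ : Adapted (Z f) (k₀ + 2) ∧ coord (Z f) (k₀ + 2) ≠ 0 := by
    rw [hZf]; fin_cases k₀ <;> simp [Adapted, coord] <;> omega
  constructor
  · intro h
    obtain ⟨r, hr, hsr⟩ := h k₀ had₀.1 had₀.2
    obtain ⟨r', hr', hsr'⟩ := h (k₀ + 2) had₂.1 had₂.2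
    rw [hk22] at hr'
    refine ⟨?_, ?_⟩
    · rcases served_dir_thin_charged hc haxis hZf hsr with rfl | rfl
      · exact hsr
      · exact absurd rfl hr
    · rcases served_dir_thin_charged hc haxis hZf hsr' with rfl | rfl
      · exact absurd rfl hr'
      · exact hsr'
  · rintro ⟨h₀, h₂⟩ k - -
    by_cases hk : k₀ = k + 2
    · refine ⟨k₀ + 2, ?_, h₂⟩
      rw [hk]; fin_cases k <;> decide
    · exact ⟨k₀, hk, h₀⟩

/-- the `ℂ`-letter of a charged non-ray μ₄ point is NOT null: `α² − |β|² = t(t + 2c) ≠ 0`. -/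
theorem blkOfPt_charged_not_null {t c : ℤ} (hc : 1 ≤ c) (ht : 1 ≤ t) (k₀ : Fin 4) :
    (blkOfPt (ray (t, 0, 0) k₀ c)).α * (blkOfPt (ray (t, 0, 0) k₀ c)).α' -
      (blkOfPt (ray (t, 0, 0) k₀ c)).β * (blkOfPt (ray (t, 0, 0) k₀ c)).βc ≠ 0 := by
  have ht' : (1 : ℝ) ≤ t := by exact_mod_cast ht
  have hc' : (1 : ℝ) ≤ c := by exact_mod_cast hc
  intro h
  have hre := congrArg Complex.re h
  fin_cases k₀ <;> simp [blkOfPt] at hre <;> nlinarith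

/-- **THE THIN-CELL BRIDGE.** For a thin `N`-cell `[O|O|O|t·I + c·ℓ_ζ]` (`t, c ≥ 1`) in a configuration with effective, μ₄-phased
`P`-letters: the encoder's RULE D holds at `Z` IFF the typed plane table's pair criterion holds for `Z`'s `ℂ`-blocks against the
legs `Z` is served along. -/
theorem ruleD_thin_iff_pairCriterion (hcone : ∀ P ∈ C.upper, ∀ g, Effective (P g)) {Z : MCell} {f k₀ : Fin 4} {t c : ℤ}
    (hthin : ∀ g, g ≠ f → Z g = (0, 0, 0)) (haxis : ∀ P ∈ C.upper, (P f).2.1 = 0 ∨ (P f).2.2 = 0)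
    (hZf : Z f = ray (t, 0, 0) k₀ c) (hc : 1 ≤ c) (ht : 1 ≤ t) :
    RuleDMu4N C Z ↔ PairCriterion (fun g => blkOfPt (Z g)) (legsBelow C Z f) := by
  rw [ruleDN_thin_charged_iff hcone hthin haxis hZf hc ht, blk_thin hthin]
  have hk : k₀ ≠ k₀ + 2 := by fin_cases k₀ <;> decide
  constructor
  · rintro ⟨h₀, h₂⟩
    exact thin_two_legs_pass f _ (ξdir k₀) (ξdir (k₀ + 2)) (ξdir_cross_isUnit hk) _ (mem_legsBelow h₀) (mem_legsBelow h₂)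
  · intro hcrit
    by_contra hnot
    -- all served directions coincide with one frame direction r₀
    have hone : ∃ r₀, ∀ r, MServedBelow C Z f r → r = r₀ := by
      by_cases h₀ : MServedBelow C Z f k₀
      · refine ⟨k₀, fun r hr => ?_⟩
        rcases served_dir_thin_charged hc haxis hZf hr with rfl | rfl
        · rfl
        · exact absurd ⟨h₀, hr⟩ hnot
      · refine ⟨k₀ + 2, fun r hr => ?_⟩
        rcases served_dir_thin_charged hc haxis hZf hr with rfl | rfl
        · exact absurd hr h₀
        · rfl
    obtain ⟨r₀, hr₀⟩ := hone
    have hL : ∀ p ∈ legsBelow C Z f, ∃ cc : ℂ, p = PType.leg f (cc • ξdir r₀) := by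
      intro p hp
      obtain ⟨r, hr, rfl⟩ := of_mem_legsBelow hp
      exact ⟨1, by rw [hr₀ r hr, one_smul]⟩
    have hnull := thin_codirections_parallel_forces_null f _ (ξdir r₀) _ hL hcrit
    rw [hZf] at hnull
    exact blkOfPt_charged_not_null hc ht k₀ hnull

/-- a thin cell whose row demand `(α, β)` and column demand `(β̄, α′)` are both multiples of ONE listed leg codirection `ξ` passes
the pair criterion (the null-letter mechanism: for a NULL `b` the two demands are parallel). -/
theorem thin_parallel_leg_pass {R : Type*} [CommRing R] (f : Fin 4) (b : Blk R) (ξ : Fin 2 → R) (a a' : R)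
    (hα : b.α = a * ξ 0) (hβ : b.β = a * ξ 1) (hβc : b.βc = a' * ξ 0) (hα' : b.α' = a' * ξ 1)
    (L : List (PType R)) (hξ : PType.leg f ξ ∈ L) : PairCriterion (thin f b) L := by
  intro g j hgj
  by_cases hg : g = f
  · subst hg
    have h1 : Submodule.span R {vecMulVec ξ eA, vecMulVec ξ eB} ≤ absorbAt L g j := by
      simpa [pairPlane] using pairPlane_le_absorbAt hξ g j
    refine h1 ?_
    rw [thin_self, thin_ne g b (Ne.symm hgj), Submodule.mem_span_pair]
    refine ⟨0, a, ?_⟩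
    ext i k; fin_cases i <;> fin_cases k <;> simp [Mjg, eA, eB, Blk.pad, hα, hβ]
  · by_cases hj : j = f
    · subst hj
      have hjg : j ≠ g := fun e => hg e.symm
      have h1 : Submodule.span R {vecMulVec eA ξ, vecMulVec eB ξ} ≤ absorbAt L g j := by
        simpa [pairPlane, hjg] using pairPlane_le_absorbAt hξ g j
      refine h1 ?_
      rw [thin_self, thin_ne j b hg, Submodule.mem_span_pair]
      refine ⟨-a', 0, ?_⟩
      ext i k; fin_cases i <;> fin_cases k <;> simp [Mjg, eA, eB, Blk.pad, hβc, hα']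
    · rw [thin_ne f b hg, thin_ne f b hj, Mjg_pad]
      exact Submodule.zero_mem _

/-- with NO partner at all a thin cell with `α ≠ 0` fails (its row demand `(α, β)ᵀ ⊗ ē_B` is not absorbed). -/
theorem thin_no_partner_alpha {R : Type*} [CommRing R] (f : Fin 4) (b : Blk R) (L : List (PType R))
    (hL : ∀ p ∈ L, False) (h : PairCriterion (thin f b) L) : b.α = 0 := by
  obtain ⟨g, hg⟩ := exists_ne_factor f
  have hbot : absorbAt L f g = ⊥ := le_bot_iff.1 (iSup₂_le fun p hp => (hL p hp).elim)
  have := h f g (Ne.symm hg)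
  rw [thin_self, thin_ne f b hg, hbot, Submodule.mem_bot, Mjg_eq_zero_iff] at this
  simpa [Blk.pad] using this.2.1

/-- **RULE D at a thin RAY cell** `[O|O|O|c·ℓ_ζ]` (`c ≥ 1`; encoder side): service in the OWN direction (the antipodal coordinate is
`0` = the `O`-coordinates, no demand; below a ray only its own direction exists, `dir_eq_of_below_ray`). -/
theorem ruleDN_thin_ray_iff (hcone : ∀ P ∈ C.upper, ∀ g, Effective (P g)) {Z : MCell} {f k₀ : Fin 4} {c : ℤ}
    (hthin : ∀ g, g ≠ f → Z g = (0, 0, 0)) (hZf : Z f = lpt c k₀) (hc : 1 ≤ c) :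
    RuleDMu4N C Z ↔ MServedBelow C Z f k₀ := by
  rw [ruleDN_thin_iff hcone hthin]
  have hdir : ∀ r, MServedBelow C Z f r → r = k₀ := by
    rintro r ⟨P, hP, -, hlt, hray⟩
    rw [hZf] at hlt hray
    exact dir_eq_of_below_ray hc (hcone P hP f) hlt hray
  constructor
  · intro h
    have had₀ : Adapted (Z f) k₀ ∧ coord (Z f) k₀ ≠ 0 := by
      rw [hZf]; fin_cases k₀ <;> simp [Adapted, coord, lpt] <;> omega
    obtain ⟨r, -, hsr⟩ := h k₀ had₀.1 had₀.2
    rwa [hdir r hsr] at hsr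
  · rintro h₀ k - hne
    refine ⟨k₀, fun hk => hne ?_, h₀⟩
    have : k = k₀ + 2 := by rw [hk]; fin_cases k <;> decide
    rw [this, hZf]; fin_cases k₀ <;> simp [coord, lpt]

/-- **THE THIN-CELL BRIDGE, RAY CASE** (`t = 0`): RULE D ⟺ pair criterion for `[O|O|O|c·ℓ_ζ]`, `c ≥ 1` — ONE own-direction leg
suffices on both sides; this is the case that pins the codirection convention `ξ_r = (1, conj(i^r))`. -/
theorem ruleD_thin_ray_iff_pairCriterion (hcone : ∀ P ∈ C.upper, ∀ g, Effective (P g)) {Z : MCell} {f k₀ : Fin 4} {c : ℤ}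
    (hthin : ∀ g, g ≠ f → Z g = (0, 0, 0)) (hZf : Z f = lpt c k₀) (hc : 1 ≤ c) :
    RuleDMu4N C Z ↔ PairCriterion (fun g => blkOfPt (Z g)) (legsBelow C Z f) := by
  rw [ruleDN_thin_ray_iff hcone hthin hZf hc, blk_thin hthin]
  have hdir : ∀ r, MServedBelow C Z f r → r = k₀ := by
    rintro r ⟨P, hP, -, hlt, hray⟩
    rw [hZf] at hlt hray
    exact dir_eq_of_below_ray hc (hcone P hP f) hlt hray
  constructor
  · intro h₀
    refine thin_parallel_leg_pass f _ (ξdir k₀) (c : ℂ) ((c : ℂ) * ![1, Complex.I, -1, -Complex.I] k₀)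
      ?_ ?_ ?_ ?_ _ (mem_legsBelow h₀) <;>
      (rw [hZf]; fin_cases k₀ <;> simp [blkOfPt, lpt, ξdir] <;> ring_nf <;> simp [Complex.I_sq])
  · intro hcrit
    by_contra h₀
    have hL : ∀ p ∈ legsBelow C Z f, False := by
      intro p hp
      obtain ⟨r, hr, -⟩ := of_mem_legsBelow hp
      exact h₀ (hdir r hr ▸ hr)
    have hα := thin_no_partner_alpha f _ _ hL hcrit
    rw [hZf] at hα
    have : (c : ℂ) = 0 := by fin_cases k₀ <;> simpa [blkOfPt, lpt] using hα
    exact absurd (by exact_mod_cast this : c = 0) (by omega)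

/-- **RULE D at a thin APEX cell** `[O|O|O|t·I]` (`t ≥ 1`; encoder side): service in TWO DISTINCT directions (all four coordinates
equal `t ≠ 0`; each needs a served direction other than its antipode). -/
theorem ruleDN_thin_apex_iff (hcone : ∀ P ∈ C.upper, ∀ g, Effective (P g)) {Z : MCell} {f : Fin 4} {t : ℤ}
    (hthin : ∀ g, g ≠ f → Z g = (0, 0, 0)) (hZf : Z f = (t, 0, 0)) (ht : 1 ≤ t) :
    RuleDMu4N C Z ↔ ∃ r r', r ≠ r' ∧ MServedBelow C Z f r ∧ MServedBelow C Z f r' := by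
  rw [ruleDN_thin_iff hcone hthin]
  have had : ∀ k, Adapted (Z f) k ∧ coord (Z f) k ≠ 0 := fun k => by
    rw [hZf]; fin_cases k <;> simp [Adapted, coord] <;> omega
  constructor
  · intro h
    obtain ⟨r, -, hsr⟩ := h 0 (had 0).1 (had 0).2
    obtain ⟨r', hr', hsr'⟩ := h (r + 2) (had _).1 (had _).2
    have : r + 2 + 2 = r := by fin_cases r <;> decide
    rw [this] at hr'
    exact ⟨r, r', Ne.symm hr', hsr, hsr'⟩
  · rintro ⟨r, r', hrr', hsr, hsr'⟩ k - -
    by_cases hk : r = k + 2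
    · refine ⟨r', fun e => hrr' (hk.trans e.symm), hsr'⟩
    · exact ⟨r, hk, hsr⟩

/-- the `ℂ`-letter of an apex point `t·I`, `t ≥ 1`, is not null (`det = t²`). -/
theorem blkOfPt_apex_not_null {t : ℤ} (ht : 1 ≤ t) :
    (blkOfPt (t, 0, 0)).α * (blkOfPt (t, 0, 0)).α' - (blkOfPt (t, 0, 0)).β * (blkOfPt (t, 0, 0)).βc ≠ 0 := by
  have ht' : (1 : ℝ) ≤ t := by exact_mod_cast ht
  intro h
  have hre := congrArg Complex.re h
  simp [blkOfPt] at hre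
  nlinarith

/-- **THE THIN-CELL BRIDGE, APEX CASE** (`c = 0`): RULE D ⟺ pair criterion for `[O|O|O|t·I]`, `t ≥ 1` (e.g. the rebalancer `4I` of §7). -/
theorem ruleD_thin_apex_iff_pairCriterion (hcone : ∀ P ∈ C.upper, ∀ g, Effective (P g)) {Z : MCell} {f : Fin 4} {t : ℤ}
    (hthin : ∀ g, g ≠ f → Z g = (0, 0, 0)) (hZf : Z f = (t, 0, 0)) (ht : 1 ≤ t) :
    RuleDMu4N C Z ↔ PairCriterion (fun g => blkOfPt (Z g)) (legsBelow C Z f) := by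
  rw [ruleDN_thin_apex_iff hcone hthin hZf ht, blk_thin hthin]
  constructor
  · rintro ⟨r, r', hrr', hsr, hsr'⟩
    exact thin_two_legs_pass f _ (ξdir r) (ξdir r') (ξdir_cross_isUnit hrr') _ (mem_legsBelow hsr) (mem_legsBelow hsr')
  · intro hcrit
    by_contra hnot
    -- all served directions coincide
    have hone : ∃ r₀, ∀ r, MServedBelow C Z f r → r = r₀ := by
      by_cases hex : ∃ r, MServedBelow C Z f r
      · obtain ⟨r₀, h₀⟩ := hex
        refine ⟨r₀, fun r hr => ?_⟩
        by_contra hne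
        exact hnot ⟨r, r₀, hne, hr, h₀⟩
      · exact ⟨0, fun r hr => (hex ⟨r, hr⟩).elim⟩
    obtain ⟨r₀, hr₀⟩ := hone
    have hL : ∀ p ∈ legsBelow C Z f, ∃ cc : ℂ, p = PType.leg f (cc • ξdir r₀) := by
      intro p hp
      obtain ⟨r, hr, rfl⟩ := of_mem_legsBelow hp
      exact ⟨1, by rw [hr₀ r hr, one_smul]⟩
    have hnull := thin_codirections_parallel_forces_null f _ (ξdir r₀) _ hL hcrit
    rw [hZf] at hnull
    exact blkOfPt_apex_not_null ht hnull

/-! ### §9b (rev 6, critic (A) 01:32Z) The side conditions are discharged by `◇`-membership — ONE statement for every thin `N`-cell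

`hcone` (effective `P`-letters) and `haxis` (μ₄-phased `P`-letters on `f`) are not content: every `◇_h` letter (`Pad4TowerDiamondMu4.InDiamond`)
is effective and μ₄-phased, and every non-zero `◇_h` letter is `ray (t,0,0) k c` with `t, c ≥ 0`, `t + c ≥ 1`. Hence the bridge for a `◇_h`
configuration reads: for every thin `N`-cell with a non-zero letter, RULE D ⟺ pair criterion — no other hypothesis. -/

/-- a `◇_h` letter is μ₄-phased (`β` on an axis or zero). -/
theorem axis_of_inDiamond {h : ℤ} {x : BPoint} (hx : InDiamond h x) : x.2.1 = 0 ∨ x.2.2 = 0 := by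
  rcases hx.1 with h0 | ⟨-, h2⟩ | ⟨h1, -⟩
  · left; simp only [Prod.ext_iff] at h0; exact h0.1
  · exact Or.inr h2
  · exact Or.inl h1

/-- a `◇_h` letter is effective (`|β| ≤ α`). -/
theorem effective_of_inDiamond {h : ℤ} {x : BPoint} (hx : InDiamond h x) : Effective x := by
  obtain ⟨α, b1, b2⟩ := x
  obtain ⟨hax, hc, -, -⟩ := hx
  simp only [absCharge, chargeOf] at hc
  have hα : 0 ≤ α := le_trans (abs_nonneg _) hc
  rcases hax with h0 | ⟨-, h2⟩ | ⟨h1, -⟩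
  · simp only [Prod.mk.injEq] at h0
    obtain ⟨rfl, rfl⟩ := h0
    exact ⟨hα, by nlinarith⟩
  · simp only at h2; subst h2
    refine ⟨hα, ?_⟩
    simp only [sub_zero] at hc
    have := abs_le.1 hc
    show b1 ^ 2 + 0 ^ 2 ≤ α ^ 2
    nlinarith [this.1, this.2]
  · simp only at h1; subst h1
    refine ⟨hα, ?_⟩
    simp only [zero_sub, abs_neg] at hc
    have := abs_le.1 hc
    show 0 ^ 2 + b2 ^ 2 ≤ α ^ 2
    nlinarith [this.1, this.2]

/-- a `◇_h` letter is `t·I + c·ℓ_{i^k}` with `t, c ≥ 0`: `x = ray (t,0,0) k c`. -/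
theorem ray_rep_of_inDiamond {h : ℤ} {x : BPoint} (hx : InDiamond h x) :
    ∃ (t c : ℤ) (k : Fin 4), 0 ≤ t ∧ 0 ≤ c ∧ x = ray (t, 0, 0) k c := by
  obtain ⟨α, b1, b2⟩ := x
  obtain ⟨hax, hc, -, -⟩ := hx
  simp only [absCharge, chargeOf] at hc
  rcases hax with h0 | ⟨h1, h2⟩ | ⟨h1, h2⟩
  · simp only [Prod.mk.injEq] at h0
    obtain ⟨rfl, rfl⟩ := h0
    exact ⟨α, 0, 0, by simpa using hc, le_rfl, by simp [ray]⟩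
  · simp only at h1 h2; subst h2
    simp only [sub_zero] at hc
    rcases lt_or_gt_of_ne h1 with hneg | hpos
    · refine ⟨α + b1, -b1, 2, ?_, by omega, ?_⟩
      · have := (abs_le.1 hc).1; omega
      · simp [ray]
    · refine ⟨α - b1, b1, 0, ?_, by omega, ?_⟩
      · have := (abs_le.1 hc).2; omega
      · simp [ray]
  · simp only at h1 h2; subst h1
    simp only [zero_sub, abs_neg] at hc
    rcases lt_or_gt_of_ne h2 with hneg | hpos
    · refine ⟨α + b2, -b2, 1, ?_, by omega, ?_⟩
      · have := (abs_le.1 hc).1; omega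
      · simp [ray]
    · refine ⟨α - b2, b2, 3, ?_, by omega, ?_⟩
      · have := (abs_le.1 hc).2; omega
      · simp [ray]

/-- **above a CEILING letter of `◇_h` only the INWARD direction stays in `◇_h`** (rev 7, for C5-3 ∕ R18.26): if `x = t·I + c·ℓ_{i^k}`,
`c ≥ 1`, lies on the ceiling line `t + 2c = h` and `x + e·n_{i^r}` (`e ≥ 1`) is again a `◇_h` letter, then `r = k + 2` — the antipode
of `x`'s own direction. Hence a ceiling factor of a `P`-cell is served ABOVE only inward, its own-direction coordinate `(g, k)` (value `h`)
is never settled above, and RULE D at an all-ceiling `P`-cell reduces to the presence of the inward lifts (phase-blind up to orbit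
bookkeeping) — the kernel-side reason why RULE D is not the phase carrier at the ceiling (g54's conflict census, control's mixfate read). -/
theorem dir_eq_of_above_ceiling {h t c e : ℤ} {k r : Fin 4} (hc : 1 ≤ c) (hceil : t + 2 * c = h) (he : 1 ≤ e)
    (hy : InDiamond h (ray (ray (t, 0, 0) k c) r e)) : r = k + 2 := by
  obtain ⟨t', c', k', ht', hc', hyeq⟩ := ray_rep_of_inDiamond hy
  have hh : (ray (t', 0, 0) k' c').1 + absCharge (ray (t', 0, 0) k' c') ≤ h := by rw [← hyeq]; exact hy.2.2.2
  fin_cases k <;> fin_cases r <;> fin_cases k' <;>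
    simp [ray, absCharge, chargeOf, Prod.ext_iff, abs_of_nonneg hc'] at hyeq hh ⊢ <;> omega

/-- consequently the OWN-direction coordinate of a charged ceiling factor of a `P`-cell is never settled above inside `◇_h`
(`SettledAbove P g k` needs a served direction `≠ k + 2`). -/
theorem not_settledAbove_ceiling {h : ℤ} (hC : C.InDiamond h) {P : MCell} {g k : Fin 4} {t c : ℤ} (hc : 1 ≤ c)
    (hceil : t + 2 * c = h) (hPg : P g = ray (t, 0, 0) k c) : ¬ SettledAbove C P g k := by
  rintro ⟨r, hr, N, hN, -, hlt, hray⟩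
  have hy : InDiamond h (N g) := hC.1 N hN g
  rw [hray, hPg] at hy
  rw [hPg] at hlt
  exact hr (dir_eq_of_above_ceiling hc hceil (by omega) hy)

/-- frame facts of a charged μ₄ letter `x = t·I + c·ℓ_{i^k}`, `c ≥ 1`: adapted exactly to `k` and `k + 2`. -/
theorem adapted_ray_iff {t c : ℤ} (hc : 1 ≤ c) (k k' : Fin 4) : Adapted (ray (t, 0, 0) k c) k' ↔ k' = k ∨ k' = k + 2 := by
  fin_cases k <;> fin_cases k' <;> simp [Adapted] <;> omega

/-- its own-direction coordinate is `t + 2c` … -/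
theorem coord_ray_own (t c : ℤ) (k : Fin 4) : coord (ray (t, 0, 0) k c) k = t + 2 * c := by
  fin_cases k <;> simp [coord] <;> ring

/-- … and its antipodal coordinate is `t`. -/
theorem coord_ray_anti (t c : ℤ) (k : Fin 4) : coord (ray (t, 0, 0) k c) (k + 2) = t := by
  fin_cases k <;> simp [coord]

/-- **RULE D AT AN ALL-CEILING `P`-CELL IN CLOSED FORM** (rev 7; for C5-3 ∕ R18.26 and control's LINE 2″): if every factor of the `P`-cell is a
CHARGED CEILING letter of `◇_h` (`P g = t_g·I + c_g·ℓ_{i^{k_g}}`, `c_g ≥ 1`, `t_g + 2c_g = h`), then RULE D holds at `P` iff EVERY factor carries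
its INWARD LIFT (`P` is served above on `g` in the direction `k_g + 2`). No phase coupling between factors appears: the condition names four lifts,
one per factor — for `P[8I+ℓ_*]⁴ ⊂ ◇₁₀` the four cells `P[g ↦ 10I]`, whatever the phase pattern. (Covers cannot help: a cover would move the
own-direction coordinate outward, `dir_eq_of_above_ceiling`.) -/
theorem ruleDP_ceiling_iff_lifts {h : ℤ} (hC : C.InDiamond h) {P : MCell} (t c : Fin 4 → ℤ) (k : Fin 4 → Fin 4)
    (hc : ∀ g, 1 ≤ c g) (hceil : ∀ g, t g + 2 * c g = h) (hP : ∀ g, P g = ray (t g, 0, 0) (k g) (c g)) :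
    RuleDMu4P C P ↔ ∀ j, MServedAbove C P j (k j + 2) := by
  have hkne : ∀ x : Fin 4, x + 2 ≠ x + 2 + 2 := by decide
  have hkne' : ∀ x : Fin 4, x + 2 ≠ x := by decide
  -- every upward move on a factor is inward
  have hin : ∀ g (N : MCell), N ∈ C.lower → (P g).1 < (N g).1 → ∀ a, N g = ray (P g) a ((N g).1 - (P g).1) → a = k g + 2 := by
    intro g N hN hlt a hray
    have hy : InDiamond h (N g) := hC.1 N hN g
    rw [hray, hP] at hy; rw [hP] at hlt
    exact dir_eq_of_above_ceiling (hc g) (hceil g) (by omega) hy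
  constructor
  · intro hD j
    obtain ⟨g, hg⟩ := exists_ne_factor j
    -- the pair (g, k_g) [value h] vs (j, k_j + 2) [value t_j = h - 2 c_j]
    have hne : coord (P g) (k g) ≠ coord (P j) (k j + 2) := by
      rw [hP g, hP j, coord_ray_own, coord_ray_anti]; have := hc j; have := hceil g; have := hceil j; omega
    rcases hD g j hg (k g) (k j + 2) (by rw [hP]; exact (adapted_ray_iff (hc g) _ _).2 (Or.inl rfl))
        (by rw [hP]; exact (adapted_ray_iff (hc j) _ _).2 (Or.inr rfl)) hne with hs | hs | hcov
    · exact absurd hs (not_settledAbove_ceiling hC (hc g) (hceil g) (hP g))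
    · obtain ⟨r, -, hsr⟩ := hs
      obtain ⟨N, hN, -, hlt, hray⟩ := id hsr
      obtain rfl := hin j N hN hlt r hray
      exact hsr
    · obtain ⟨a, b, ha, -, N, hN, -, hlt, hra, -⟩ := hcov
      have ha' := hin g N hN hlt a hra
      rcases ha with h1 | ⟨⟨h1, h2⟩, -⟩
      · exact absurd (ha'.symm.trans h1) (hkne' (k g))
      · rw [hP g] at h1 h2
        have := hc g
        generalize k g = x at h1 h2
        fin_cases x <;> simp at h1 h2 <;> omega
  · intro hL g j _ k₁ k₂ had₁ had₂ hne
    rw [hP g] at had₁; rw [hP j] at had₂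
    rcases (adapted_ray_iff (hc g) _ _).1 had₁ with h1 | h1
    · rcases (adapted_ray_iff (hc j) _ _).1 had₂ with h2 | h2
      · exfalso; apply hne; rw [h1, h2, hP g, hP j, coord_ray_own, coord_ray_own, hceil, hceil]
      · subst h2; exact Or.inr (Or.inl ⟨k j + 2, hkne (k j), hL j⟩)
    · subst h1; exact Or.inl ⟨k g + 2, hkne (k g), hL g⟩

/-- **THE THIN-CELL BRIDGE ON `◇_h` SUPPORTS — one statement, no side conditions** (rev 6): in a configuration whose cells lie in `◇_h`,
for every thin `N`-cell `Z = [O|O|O|x]` with `x ≠ O`, the census encoder's RULE D holds at `Z` iff LINE 5's pair criterion holds for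
`Z`'s letters against the legs the configuration provides below `Z` on `f`. (Cases: ray ∕ apex ∕ charged non-ray, §9.) -/
theorem ruleD_thin_iff_pairCriterion_of_inDiamond {h : ℤ} (hC : C.InDiamond h) {Z : MCell} (hZ : Z ∈ C.lower) {f : Fin 4}
    (hthin : ∀ g, g ≠ f → Z g = (0, 0, 0)) (hx : Z f ≠ (0, 0, 0)) :
    RuleDMu4N C Z ↔ PairCriterion (fun g => blkOfPt (Z g)) (legsBelow C Z f) := by
  have hcone : ∀ P ∈ C.upper, ∀ g, Effective (P g) := fun P hP g => effective_of_inDiamond (hC.2 P hP g)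
  have haxis : ∀ P ∈ C.upper, (P f).2.1 = 0 ∨ (P f).2.2 = 0 := fun P hP => axis_of_inDiamond (hC.2 P hP f)
  obtain ⟨t, c, k₀, ht, hc, hZf⟩ := ray_rep_of_inDiamond (hC.1 Z hZ f)
  rcases ht.eq_or_lt with ht0 | ht1
  · -- `t = 0`: a ray (and `c ≥ 1` since `x ≠ O`)
    subst ht0
    rcases hc.eq_or_lt with hc0 | hc1
    · subst hc0; exact absurd (by rw [hZf]; fin_cases k₀ <;> simp [ray]) hx
    · exact ruleD_thin_ray_iff_pairCriterion hcone hthin (by rw [hZf]; rfl) (by omega)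
  · rcases hc.eq_or_lt with hc0 | hc1
    · -- `c = 0`: an apex
      subst hc0
      have hZf' : Z f = (t, 0, 0) := by rw [hZf]; fin_cases k₀ <;> simp [ray]
      exact ruleD_thin_apex_iff_pairCriterion hcone hthin hZf' (by omega)
    · exact ruleD_thin_iff_pairCriterion hcone hthin haxis hZf (by omega) (by omega)

/-- INSTANCE: the ◇₈ head `2I+3ℓ₁ = ray (2,0,0) 0 3` qualifies (`t = 2`, `c = 3`), as does every tower `2I + c·ℓ` and raised
node letter `t·I + c·ℓ` of ◇ with `t, c ≥ 1`; so at these heads «RULE D» (census encoder) and «pair criterion» (LINE 5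
dictionary) are ONE predicate, kernel-checked. -/
example (hcone : ∀ P ∈ C.upper, ∀ g, Effective (P g)) {Z : MCell} {f : Fin 4}
    (hthin : ∀ g, g ≠ f → Z g = (0, 0, 0)) (haxis : ∀ P ∈ C.upper, (P f).2.1 = 0 ∨ (P f).2.2 = 0)
    (hZf : Z f = ray (2, 0, 0) 0 3) :
    RuleDMu4N C Z ↔ PairCriterion (fun g => blkOfPt (Z g)) (legsBelow C Z f) :=
  ruleD_thin_iff_pairCriterion hcone hthin haxis hZf (by norm_num) (by norm_num)

/-! ### §9c (rev 9, critic C5-3 price «thin-P HOLDS stays PENCIL») THIN `P`-CELLS — the mirror bridge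

The plane table is LEVEL-SYMMETRIC: the pair plane of a leg `{N, P}` with `N f = P f + e·n_{i^r}` depends only on the difference
letter `e·ℓ_{i^r}`, so a thin `P`-cell `[O|O|O|x]` served ABOVE on `f` in direction `r` carries the partner type `leg f (ξdir r)`,
exactly as a thin `N`-cell served below does. What is NOT symmetric is the `O`-factor: below an `O` nothing exists
(`settledBelow_of_O`), above an `O` legs `[e·ℓ_a|…]` and covers may exist. On the supports of record (j317021 rows 1∕2∕5) they do
not — no cell has exactly one or two `O`-factors — so we state the `P`-bridge under the two QUIETNESS hypotheses «no service above on
the `O`-factors» and «no cover above `P`», both read off the model. Under them RULE D at a thin `P`-cell ⟺ the pair criterion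
against the legs ABOVE — kernel; the one asymmetry in the case analysis is the RAY letter `c·ℓ_ζ`: above a ray BOTH frame
directions exist (below only the own one), and the antipodal leg alone does NOT pass (row demand `(α, β) = c(1, conj ζ)` is not a
multiple of `ξ_{−ζ}`, `thin_codirections_parallel_row`). -/

/-- if every listed type is an `f`-leg with codirection a multiple of `ξ`, the pair criterion at a thin cell forces the ROW demand
`(α, β)` to be parallel to `ξ` (the first half of `thin_codirections_parallel_forces_null`). -/
theorem thin_codirections_parallel_row {R : Type*} [CommRing R] (f : Fin 4) (b : Blk R) (ξ : Fin 2 → R)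
    (L : List (PType R)) (hL : ∀ p ∈ L, ∃ c : R, p = PType.leg f (c • ξ)) (h : PairCriterion (thin f b) L) :
    b.α * ξ 1 = b.β * ξ 0 := by
  obtain ⟨g, hg⟩ := exists_ne_factor f
  have smul_vmv_l : ∀ (c : R) (v w : Fin 2 → R), vecMulVec (c • v) w = c • vecMulVec v w := fun c v w => by
    ext i j; simp [vecMulVec_apply, mul_assoc]
  have hrow : absorbAt L f g ≤ Submodule.span R {vecMulVec ξ eA, vecMulVec ξ eB} := by
    refine iSup₂_le fun p hp => ?_
    obtain ⟨c, rfl⟩ := hL p hp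
    simp only [pairPlane, if_true]
    refine Submodule.span_le.2 ?_
    rintro M (rfl | rfl)
    · rw [smul_vmv_l]; exact Submodule.smul_mem _ c (Submodule.subset_span (by simp))
    · rw [smul_vmv_l]; exact Submodule.smul_mem _ c (Submodule.subset_span (by simp))
  have h1 : Mjg b (Blk.pad 0) ∈ Submodule.span R {vecMulVec ξ eA, vecMulVec ξ eB} := by
    have := h f g (Ne.symm hg); rw [thin_self, thin_ne f b hg] at this; exact hrow this
  rw [Submodule.mem_span_pair] at h1
  obtain ⟨c, d, hcd⟩ := h1
  have e01 := congr_fun (congr_fun hcd 0) 1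
  have e11 := congr_fun (congr_fun hcd 1) 1
  simp [Mjg, eA, eB, Blk.pad] at e01 e11
  -- e01 : d * ξ 0 = b.α ; e11 : d * ξ 1 = b.β
  linear_combination (-(ξ 1)) * e01 + ξ 0 * e11

/-- the legs ABOVE a `P`-cell on `f`, as partner types. -/
noncomputable def legsAbove (C : MConfig) (P : MCell) (f : Fin 4) : List (PType ℂ) :=
  ((Finset.univ.filter fun r => MServedAbove C P f r).toList).map fun r => PType.leg f (ξdir r)

theorem mem_legsAbove {P : MCell} {f r : Fin 4} (h : MServedAbove C P f r) : PType.leg f (ξdir r) ∈ legsAbove C P f :=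
  List.mem_map.2 ⟨r, by simpa [Finset.mem_toList] using h, rfl⟩

theorem of_mem_legsAbove {P : MCell} {f : Fin 4} {p : PType ℂ} (h : p ∈ legsAbove C P f) :
    ∃ r, MServedAbove C P f r ∧ p = PType.leg f (ξdir r) := by
  obtain ⟨r, hr, rfl⟩ := List.mem_map.1 h
  exact ⟨r, by simpa [Finset.mem_toList] using hr, rfl⟩

/-- **RULE D at a QUIET thin `P`-cell** `[O|O|O|x]` (no service above on the `O`-factors, no cover above `P`): every adapted non-zero
frame coordinate of `x` is settled above — the mirror of `ruleDN_thin_iff`, with the quietness read off the model instead of (R-O). -/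
theorem ruleDP_thin_iff {P : MCell} {f : Fin 4} (hthin : ∀ g, g ≠ f → P g = (0, 0, 0))
    (hnoO : ∀ g, g ≠ f → ∀ r, ¬ MServedAbove C P g r) (hnocov : ∀ g a j b, ¬ MCoverAbove C P g a j b) :
    RuleDMu4P C P ↔ ∀ k, Adapted (P f) k → coord (P f) k ≠ 0 → SettledAbove C P f k := by
  have hcO : ∀ g, g ≠ f → ∀ k, coord (P g) k = 0 := fun g hg k => by
    rw [hthin g hg]; fin_cases k <;> simp [coord]
  have hadO : ∀ g, g ≠ f → ∀ k, Adapted (P g) k := fun g hg k => by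
    rw [hthin g hg]; fin_cases k <;> simp [Adapted]
  constructor
  · intro hD k hadk hne
    obtain ⟨g, hg⟩ := exists_ne_factor f
    rcases hD f g (Ne.symm hg) k 0 hadk (hadO g hg 0) (by rw [hcO g hg]; exact hne) with hs | hs | hcov
    · exact hs
    · obtain ⟨r, -, hsr⟩ := hs
      exact absurd hsr (hnoO g hg r)
    · obtain ⟨a, b, -, -, hc⟩ := hcov
      exact absurd hc (hnocov f a g b)
  · intro h g j hgj k k' hadg hadj hne
    by_cases hg : g = f
    · subst hg
      rw [hcO j (Ne.symm hgj) k'] at hne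
      exact Or.inl (h k hadg hne)
    · by_cases hj : j = f
      · subst hj
        rw [hcO g hg k] at hne
        exact Or.inr (Or.inl (h k' hadj (Ne.symm hne)))
      · rw [hcO g hg k, hcO j hj k'] at hne
        exact absurd rfl hne

/-- above a charged or ray μ₄ letter `t·I + c·ℓ_{i^{k₀}}` (`c ≥ 1`, `t ≥ 0`) only the two FRAME directions lead to μ₄-phased letters. -/
theorem dir_above_charged {t c d : ℤ} (hc : 1 ≤ c) (hd : 1 ≤ d) {k₀ r : Fin 4} {y : BPoint}
    (hy : y.2.1 = 0 ∨ y.2.2 = 0) (h : y = ray (ray (t, 0, 0) k₀ c) r d) : r = k₀ ∨ r = k₀ + 2 := by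
  subst h
  fin_cases k₀ <;> fin_cases r <;> simp at hy ⊢ <;> omega

/-- hence a thin `P`-cell with charged or ray `f`-letter is served above on `f` only along `k₀` or `k₀ + 2`. -/
theorem served_dir_thin_charged_above {P : MCell} {f k₀ : Fin 4} {t c : ℤ} (hc : 1 ≤ c)
    (haxis : ∀ N ∈ C.lower, (N f).2.1 = 0 ∨ (N f).2.2 = 0) (hPf : P f = ray (t, 0, 0) k₀ c) {r : Fin 4}
    (hr : MServedAbove C P f r) : r = k₀ ∨ r = k₀ + 2 := by
  obtain ⟨N, hN, -, hlt, hray⟩ := hr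
  rw [hPf] at hlt hray
  exact dir_above_charged hc (d := (N f).1 - (ray (t, 0, 0) k₀ c).1) (by omega) (haxis N hN) hray

/-- **RULE D at a quiet thin `P`-cell with a charged non-ray letter = service above in BOTH frame directions.** -/
theorem ruleDP_thin_charged_iff {P : MCell} {f k₀ : Fin 4} {t c : ℤ} (hthin : ∀ g, g ≠ f → P g = (0, 0, 0))
    (hnoO : ∀ g, g ≠ f → ∀ r, ¬ MServedAbove C P g r) (hnocov : ∀ g a j b, ¬ MCoverAbove C P g a j b)
    (haxis : ∀ N ∈ C.lower, (N f).2.1 = 0 ∨ (N f).2.2 = 0) (hPf : P f = ray (t, 0, 0) k₀ c) (hc : 1 ≤ c) (ht : 1 ≤ t) :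
    RuleDMu4P C P ↔ MServedAbove C P f k₀ ∧ MServedAbove C P f (k₀ + 2) := by
  rw [ruleDP_thin_iff hthin hnoO hnocov]
  have hk22 : k₀ + 2 + 2 = k₀ := by fin_cases k₀ <;> decide
  have had₀ : Adapted (P f) k₀ ∧ coord (P f) k₀ ≠ 0 := by
    rw [hPf]; fin_cases k₀ <;> simp [Adapted, coord] <;> omega
  have had₂ : Adapted (P f) (k₀ + 2) ∧ coord (P f) (k₀ + 2) ≠ 0 := by
    rw [hPf]; fin_cases k₀ <;> simp [Adapted, coord] <;> omega
  constructor
  · intro h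
    obtain ⟨r, hr, hsr⟩ := h k₀ had₀.1 had₀.2
    obtain ⟨r', hr', hsr'⟩ := h (k₀ + 2) had₂.1 had₂.2
    rw [hk22] at hr'
    refine ⟨?_, ?_⟩
    · rcases served_dir_thin_charged_above hc haxis hPf hsr with rfl | rfl
      · exact hsr
      · exact absurd rfl hr
    · rcases served_dir_thin_charged_above hc haxis hPf hsr' with rfl | rfl
      · exact absurd rfl hr'
      · exact hsr'
  · rintro ⟨h₀, h₂⟩ k - -
    by_cases hk : k₀ = k + 2
    · refine ⟨k₀ + 2, ?_, h₂⟩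
      rw [hk]; fin_cases k <;> decide
    · exact ⟨k₀, hk, h₀⟩

/-- **THE THIN `P`-CELL BRIDGE, charged non-ray letter.** -/
theorem ruleDP_thin_iff_pairCriterion {P : MCell} {f k₀ : Fin 4} {t c : ℤ} (hthin : ∀ g, g ≠ f → P g = (0, 0, 0))
    (hnoO : ∀ g, g ≠ f → ∀ r, ¬ MServedAbove C P g r) (hnocov : ∀ g a j b, ¬ MCoverAbove C P g a j b)
    (haxis : ∀ N ∈ C.lower, (N f).2.1 = 0 ∨ (N f).2.2 = 0) (hPf : P f = ray (t, 0, 0) k₀ c) (hc : 1 ≤ c) (ht : 1 ≤ t) :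
    RuleDMu4P C P ↔ PairCriterion (fun g => blkOfPt (P g)) (legsAbove C P f) := by
  rw [ruleDP_thin_charged_iff hthin hnoO hnocov haxis hPf hc ht, blk_thin hthin]
  have hk : k₀ ≠ k₀ + 2 := by fin_cases k₀ <;> decide
  constructor
  · rintro ⟨h₀, h₂⟩
    exact thin_two_legs_pass f _ (ξdir k₀) (ξdir (k₀ + 2)) (ξdir_cross_isUnit hk) _ (mem_legsAbove h₀) (mem_legsAbove h₂)
  · intro hcrit
    by_contra hnot
    have hone : ∃ r₀, ∀ r, MServedAbove C P f r → r = r₀ := by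
      by_cases h₀ : MServedAbove C P f k₀
      · refine ⟨k₀, fun r hr => ?_⟩
        rcases served_dir_thin_charged_above hc haxis hPf hr with rfl | rfl
        · rfl
        · exact absurd ⟨h₀, hr⟩ hnot
      · refine ⟨k₀ + 2, fun r hr => ?_⟩
        rcases served_dir_thin_charged_above hc haxis hPf hr with rfl | rfl
        · exact absurd hr h₀
        · rfl
    obtain ⟨r₀, hr₀⟩ := hone
    have hL : ∀ p ∈ legsAbove C P f, ∃ cc : ℂ, p = PType.leg f (cc • ξdir r₀) := by
      intro p hp
      obtain ⟨r, hr, rfl⟩ := of_mem_legsAbove hp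
      exact ⟨1, by rw [hr₀ r hr, one_smul]⟩
    have hnull := thin_codirections_parallel_forces_null f _ (ξdir r₀) _ hL hcrit
    rw [hPf] at hnull
    exact blkOfPt_charged_not_null hc ht k₀ hnull

/-- **RULE D at a quiet thin RAY `P`-cell** `[O|O|O|c·ℓ_ζ]`: service above in the OWN direction (the antipodal coordinate is `0`, no
demand; an antipodal leg exists above a ray but settles nothing that is demanded). -/
theorem ruleDP_thin_ray_iff {P : MCell} {f k₀ : Fin 4} {c : ℤ} (hthin : ∀ g, g ≠ f → P g = (0, 0, 0))
    (hnoO : ∀ g, g ≠ f → ∀ r, ¬ MServedAbove C P g r) (hnocov : ∀ g a j b, ¬ MCoverAbove C P g a j b)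
    (haxis : ∀ N ∈ C.lower, (N f).2.1 = 0 ∨ (N f).2.2 = 0) (hPf : P f = lpt c k₀) (hc : 1 ≤ c) :
    RuleDMu4P C P ↔ MServedAbove C P f k₀ := by
  rw [ruleDP_thin_iff hthin hnoO hnocov]
  have hdir : ∀ r, MServedAbove C P f r → r = k₀ ∨ r = k₀ + 2 := fun r hr =>
    served_dir_thin_charged_above (t := 0) hc haxis (by rw [hPf]; rfl) hr
  have hk22 : k₀ + 2 + 2 = k₀ := by fin_cases k₀ <;> decide
  constructor
  · intro h
    have had₀ : Adapted (P f) k₀ ∧ coord (P f) k₀ ≠ 0 := by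
      rw [hPf]; fin_cases k₀ <;> simp [Adapted, coord, lpt] <;> omega
    obtain ⟨r, hr, hsr⟩ := h k₀ had₀.1 had₀.2
    rcases hdir r hsr with rfl | rfl
    · exact hsr
    · exact absurd rfl hr
  · rintro h₀ k - hne
    refine ⟨k₀, fun hk => hne ?_, h₀⟩
    have : k = k₀ + 2 := by rw [hk]; fin_cases k <;> decide
    rw [this, hPf]; fin_cases k₀ <;> simp [coord, lpt]

/-- **THE THIN `P`-CELL BRIDGE, RAY CASE.** -/
theorem ruleDP_thin_ray_iff_pairCriterion {P : MCell} {f k₀ : Fin 4} {c : ℤ} (hthin : ∀ g, g ≠ f → P g = (0, 0, 0))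
    (hnoO : ∀ g, g ≠ f → ∀ r, ¬ MServedAbove C P g r) (hnocov : ∀ g a j b, ¬ MCoverAbove C P g a j b)
    (haxis : ∀ N ∈ C.lower, (N f).2.1 = 0 ∨ (N f).2.2 = 0) (hPf : P f = lpt c k₀) (hc : 1 ≤ c) :
    RuleDMu4P C P ↔ PairCriterion (fun g => blkOfPt (P g)) (legsAbove C P f) := by
  rw [ruleDP_thin_ray_iff hthin hnoO hnocov haxis hPf hc, blk_thin hthin]
  have hdir : ∀ r, MServedAbove C P f r → r = k₀ ∨ r = k₀ + 2 := fun r hr =>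
    served_dir_thin_charged_above (t := 0) hc haxis (by rw [hPf]; rfl) hr
  constructor
  · intro h₀
    refine thin_parallel_leg_pass f _ (ξdir k₀) (c : ℂ) ((c : ℂ) * ![1, Complex.I, -1, -Complex.I] k₀)
      ?_ ?_ ?_ ?_ _ (mem_legsAbove h₀) <;>
      (rw [hPf]; fin_cases k₀ <;> simp [blkOfPt, lpt, ξdir] <;> ring_nf <;> simp [Complex.I_sq])
  · intro hcrit
    by_contra h₀
    -- every leg above is antipodal
    have hL : ∀ p ∈ legsAbove C P f, ∃ cc : ℂ, p = PType.leg f (cc • ξdir (k₀ + 2)) := by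
      intro p hp
      obtain ⟨r, hr, rfl⟩ := of_mem_legsAbove hp
      rcases hdir r hr with rfl | rfl
      · exact absurd hr h₀
      · exact ⟨1, by rw [one_smul]⟩
    have hpar := thin_codirections_parallel_row f _ (ξdir (k₀ + 2)) _ hL hcrit
    rw [hPf] at hpar
    have hc1 : (1 : ℝ) ≤ c := by exact_mod_cast hc
    fin_cases k₀ <;> simp [blkOfPt, lpt, ξdir, Complex.ext_iff] at hpar <;> first | omega | linarith

/-- **RULE D at a quiet thin APEX `P`-cell** `[O|O|O|t·I]`: service above in TWO DISTINCT directions. -/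
theorem ruleDP_thin_apex_iff {P : MCell} {f : Fin 4} {t : ℤ} (hthin : ∀ g, g ≠ f → P g = (0, 0, 0))
    (hnoO : ∀ g, g ≠ f → ∀ r, ¬ MServedAbove C P g r) (hnocov : ∀ g a j b, ¬ MCoverAbove C P g a j b)
    (hPf : P f = (t, 0, 0)) (ht : 1 ≤ t) :
    RuleDMu4P C P ↔ ∃ r r', r ≠ r' ∧ MServedAbove C P f r ∧ MServedAbove C P f r' := by
  rw [ruleDP_thin_iff hthin hnoO hnocov]
  have had : ∀ k, Adapted (P f) k ∧ coord (P f) k ≠ 0 := fun k => by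
    rw [hPf]; fin_cases k <;> simp [Adapted, coord] <;> omega
  constructor
  · intro h
    obtain ⟨r, -, hsr⟩ := h 0 (had 0).1 (had 0).2
    obtain ⟨r', hr', hsr'⟩ := h (r + 2) (had _).1 (had _).2
    have : r + 2 + 2 = r := by fin_cases r <;> decide
    rw [this] at hr'
    exact ⟨r, r', Ne.symm hr', hsr, hsr'⟩
  · rintro ⟨r, r', hrr', hsr, hsr'⟩ k - -
    by_cases hk : r = k + 2
    · refine ⟨r', fun e => hrr' (hk.trans e.symm), hsr'⟩
    · exact ⟨r, hk, hsr⟩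

/-- **THE THIN `P`-CELL BRIDGE, APEX CASE.** -/
theorem ruleDP_thin_apex_iff_pairCriterion {P : MCell} {f : Fin 4} {t : ℤ} (hthin : ∀ g, g ≠ f → P g = (0, 0, 0))
    (hnoO : ∀ g, g ≠ f → ∀ r, ¬ MServedAbove C P g r) (hnocov : ∀ g a j b, ¬ MCoverAbove C P g a j b)
    (hPf : P f = (t, 0, 0)) (ht : 1 ≤ t) :
    RuleDMu4P C P ↔ PairCriterion (fun g => blkOfPt (P g)) (legsAbove C P f) := by
  rw [ruleDP_thin_apex_iff hthin hnoO hnocov hPf ht, blk_thin hthin]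
  constructor
  · rintro ⟨r, r', hrr', hsr, hsr'⟩
    exact thin_two_legs_pass f _ (ξdir r) (ξdir r') (ξdir_cross_isUnit hrr') _ (mem_legsAbove hsr) (mem_legsAbove hsr')
  · intro hcrit
    by_contra hnot
    have hone : ∃ r₀, ∀ r, MServedAbove C P f r → r = r₀ := by
      by_cases hex : ∃ r, MServedAbove C P f r
      · obtain ⟨r₀, h₀⟩ := hex
        refine ⟨r₀, fun r hr => ?_⟩
        by_contra hne
        exact hnot ⟨r, r₀, hne, hr, h₀⟩
      · exact ⟨0, fun r hr => (hex ⟨r, hr⟩).elim⟩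
    obtain ⟨r₀, hr₀⟩ := hone
    have hL : ∀ p ∈ legsAbove C P f, ∃ cc : ℂ, p = PType.leg f (cc • ξdir r₀) := by
      intro p hp
      obtain ⟨r, hr, rfl⟩ := of_mem_legsAbove hp
      exact ⟨1, by rw [hr₀ r hr, one_smul]⟩
    have hnull := thin_codirections_parallel_forces_null f _ (ξdir r₀) _ hL hcrit
    rw [hPf] at hnull
    exact blkOfPt_apex_not_null ht hnull

/-- **THE THIN `P`-CELL BRIDGE ON `◇_h` SUPPORTS — one statement** (rev 9): for a QUIET thin `P`-cell of a `◇_h` configuration with a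
non-zero letter, RULE D ⟺ pair criterion against the legs above. The quietness hypotheses (no service above on the three
`O`-factors, no cover above the cell) hold on every SAT support of record (no cell with exactly one or two `O`-factors). -/
theorem ruleDP_thin_iff_pairCriterion_of_inDiamond {h : ℤ} (hC : C.InDiamond h) {P : MCell} (hP : P ∈ C.upper) {f : Fin 4}
    (hthin : ∀ g, g ≠ f → P g = (0, 0, 0)) (hx : P f ≠ (0, 0, 0))
    (hnoO : ∀ g, g ≠ f → ∀ r, ¬ MServedAbove C P g r) (hnocov : ∀ g a j b, ¬ MCoverAbove C P g a j b) :
    RuleDMu4P C P ↔ PairCriterion (fun g => blkOfPt (P g)) (legsAbove C P f) := by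
  have haxis : ∀ N ∈ C.lower, (N f).2.1 = 0 ∨ (N f).2.2 = 0 := fun N hN => axis_of_inDiamond (hC.1 N hN f)
  obtain ⟨t, c, k₀, ht, hc, hPf⟩ := ray_rep_of_inDiamond (hC.2 P hP f)
  rcases ht.eq_or_lt with ht0 | ht1
  · subst ht0
    rcases hc.eq_or_lt with hc0 | hc1
    · subst hc0; exact absurd (by rw [hPf]; fin_cases k₀ <;> simp [ray]) hx
    · exact ruleDP_thin_ray_iff_pairCriterion hthin hnoO hnocov haxis (by rw [hPf]; rfl) (by omega)
  · rcases hc.eq_or_lt with hc0 | hc1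
    · subst hc0
      have hPf' : P f = (t, 0, 0) := by rw [hPf]; fin_cases k₀ <;> simp [ray]
      exact ruleDP_thin_apex_iff_pairCriterion hthin hnoO hnocov hPf' (by omega)
    · exact ruleDP_thin_iff_pairCriterion hthin hnoO hnocov haxis hPf (by omega) (by omega)

/-! ### §9d (rev 10) THE FRAME FORM and the bridge at a PAIR OF CHARGED FACTORS — (r2a) covers included

The general (non-thin) dictionary. At an ordered pair `(g, j)` of CHARGED non-apex factors `x_g = t·I + c·ℓ_{i^u}`,
`x_j = t′·I + c′·ℓ_{i^v}` (`c, c′ ≥ 1`) expand the pair image `M_{(g,j)} = [[−β̄_j, α_g − α′_j],[0, β_g]]` in the codirection frame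
`{ξ_u, ξ_{u+2}} ⊗ {ξ_v, ξ_{v+2}}` (`frame_expand`, dual coefficients `φ_{k,k′} = δ_k ⊗ δ_{k′}`, `δ_k = ½(1, i^k)`):
**`φ_{k,k′}(M_{(g,j)}) = (i^{k′}/4)·(c_k(x_g) − c_{k′}(x_j))`** (`frame_coeff_charged`) — THE FRAME FORM: the pair image IS the
table of RULE D's coordinate differences over the two frames (PAD4-BALANCED §1′ `D_{rr′}`, now kernel). Consequently
(`pair_charged_iff`): if at `(g, j)` the typed partner list offers legs on `g` in directions `S_g ⊆ {u, u+2}`, legs on `j` in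
`S_j ⊆ {v, v+2}` and (r2a) covers in direction pairs `Cov ⊆ {u,u+2} × {v,v+2}` (an (r2a) cover moving `(g, a)` and `(j, b)` ↦
`PType.r2a g ξ_a j ξ_b`, the rank-one line `ξ_a ⊗ ξ_b`), then the pair image is absorbed iff every NON-ZERO coordinate difference
`c_k(x_g) ≠ c_{k′}(x_j)` has `k ∈ S_g ∨ k′ ∈ S_j ∨ (k, k′) ∈ Cov` — literally RULE D at the pair. `ruleDN_charged_iff_pairCriterion`
assembles the pairs: for an `N`-cell of `◇_h` ALL of whose factors are charged (no `O`, no apex), RULE D ⟺ the pair criterion for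
its blocks and the typed list «one leg per served direction on each factor + one (r2a) type per cover below». Together with §9–§9c
this leaves, of T5-1 (i), only cells mixing charged factors with `O`∕apex factors in the presence of covers, and the unbalanced
letters `D_±`.
-/

/-- the unit `i^k ∈ ℂ`. -/
noncomputable def ζu (k : Fin 4) : ℂ := ![1, Complex.I, -1, -Complex.I] k

theorem ζu_add_two (k : Fin 4) : ζu (k + 2) = -ζu k := by
  fin_cases k <;> simp [ζu]

/-- `i^k · conj(i^k) = 1`, with `conj(i^k) = ξdir k 1`. -/
theorem ζu_mul_conj (k : Fin 4) : ζu k * ξdir k 1 = 1 := by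
  fin_cases k <;> simp [ζu, ξdir]

theorem ζu_ne_zero (k : Fin 4) : ζu k ≠ 0 := by
  fin_cases k <;> simp [ζu, Complex.ext_iff]

theorem ξdir_fst (k : Fin 4) : ξdir k 0 = 1 := rfl

theorem ξdir_add_two_snd (k : Fin 4) : ξdir (k + 2) 1 = -ξdir k 1 := by
  fin_cases k <;> simp [ξdir]

/-- the DUAL codirection `δ_k = ½(1, i^k)`: `δ_k · ξ_k = 1`, `δ_k · ξ_{k+2} = 0`. -/
noncomputable def δdir (k : Fin 4) : Fin 2 → ℂ := ![1 / 2, ζu k / 2]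

theorem δdir_dot_self (k : Fin 4) : ∑ i, δdir k i * ξdir k i = 1 := by
  have h := ζu_mul_conj k
  simp only [Fin.sum_univ_two, δdir, ξdir_fst, Matrix.cons_val_zero, Matrix.cons_val_one]
  linear_combination h / 2

theorem δdir_dot_anti (k : Fin 4) : ∑ i, δdir k i * ξdir (k + 2) i = 0 := by
  have h := ζu_mul_conj k
  simp only [Fin.sum_univ_two, δdir, ξdir_fst, ξdir_add_two_snd, Matrix.cons_val_zero, Matrix.cons_val_one]
  linear_combination -(h / 2)

/-- the frame functional `M ↦ Σ_{i,j} a_i M_{ij} b_j`. -/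
noncomputable def φfun (a b : Fin 2 → ℂ) : Matrix (Fin 2) (Fin 2) ℂ →ₗ[ℂ] ℂ where
  toFun M := ∑ i, ∑ j, a i * M i j * b j
  map_add' M N := by simp only [Matrix.add_apply, mul_add, add_mul, Finset.sum_add_distrib]
  map_smul' s M := by
    simp only [Matrix.smul_apply, smul_eq_mul, Finset.mul_sum, RingHom.id_apply]
    exact Finset.sum_congr rfl fun i _ => Finset.sum_congr rfl fun j _ => by ring

theorem φfun_apply (a b : Fin 2 → ℂ) (M : Matrix (Fin 2) (Fin 2) ℂ) :
    φfun a b M = ∑ i, ∑ j, a i * M i j * b j := rfl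

theorem φfun_vecMulVec (a b ξ η : Fin 2 → ℂ) :
    φfun a b (vecMulVec ξ η) = (∑ i, a i * ξ i) * (∑ j, b j * η j) := by
  simp [φfun_apply, vecMulVec_apply, Fin.sum_univ_two]; ring

/-- expansion of a vector in the codirection frame `{ξ_u, ξ_{u+2}}` with dual coefficients. -/
theorem vec_expand (u : Fin 4) (w : Fin 2 → ℂ) :
    w = (∑ i, δdir u i * w i) • ξdir u + (∑ i, δdir (u + 2) i * w i) • ξdir (u + 2) := by
  ext i
  fin_cases u <;> fin_cases i <;> simp [δdir, ζu, ξdir, Fin.sum_univ_two] <;> ring_nf <;>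
    simp only [Complex.I_sq] <;> ring

/-- **DUAL-BASIS EXPANSION** of a `2 × 2` matrix in the frame `{ξ_u, ξ_{u+2}} ⊗ {ξ_v, ξ_{v+2}}`. -/
theorem frame_expand (u v : Fin 4) (M : Matrix (Fin 2) (Fin 2) ℂ) :
    M = φfun (δdir u) (δdir v) M • vecMulVec (ξdir u) (ξdir v)
      + φfun (δdir u) (δdir (v + 2)) M • vecMulVec (ξdir u) (ξdir (v + 2))
      + φfun (δdir (u + 2)) (δdir v) M • vecMulVec (ξdir (u + 2)) (ξdir v)
      + φfun (δdir (u + 2)) (δdir (v + 2)) M • vecMulVec (ξdir (u + 2)) (ξdir (v + 2)) := by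
  ext i j
  have hc := congrFun (vec_expand u (fun i' => M i' j)) i
  have hr1 := congrFun (vec_expand v (fun j' => ∑ i', δdir u i' * M i' j')) j
  have hr2 := congrFun (vec_expand v (fun j' => ∑ i', δdir (u + 2) i' * M i' j')) j
  simp only [Pi.add_apply, Pi.smul_apply, smul_eq_mul, Fin.sum_univ_two] at hc hr1 hr2
  simp only [Matrix.add_apply, Matrix.smul_apply, vecMulVec_apply, φfun_apply, smul_eq_mul, Fin.sum_univ_two]
  rw [hc, hr1, hr2]; ring

/-- the frame functional on a pair image. -/
theorem φfun_Mjg (k k' : Fin 4) (xg xj : Blk ℂ) :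
    φfun (δdir k) (δdir k') (Mjg xg xj) = (-xj.βc + (xg.α - xj.α') * ζu k' + ζu k * ζu k' * xg.β) / 4 := by
  simp [φfun_apply, Mjg, δdir, Fin.sum_univ_two]; ring

/-- the block of the charged letter `t·I + c·ℓ_{i^u}`: `α = α′ = t + c`, `β = c·conj(i^u)`, `β̄ = c·i^u`. -/
theorem blkOfPt_ray (t c : ℤ) (u : Fin 4) :
    blkOfPt (ray (t, 0, 0) u c) = ⟨(t : ℂ) + c, (t : ℂ) + c, (c : ℂ) * ξdir u 1, (c : ℂ) * ζu u⟩ := by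
  fin_cases u <;> simp [blkOfPt, ξdir, ζu]

/-- **THE FRAME FORM (kernel).** `φ_{k,k′}(M_{(g,j)}) = (i^{k′}/4)·(c_k(x_g) − c_{k′}(x_j))` for `k` in the frame of `x_g` and `k′`
in the frame of `x_j`. -/
theorem frame_coeff_charged (t c t' c' : ℤ) (u v : Fin 4) {k k' : Fin 4} (hk : k = u ∨ k = u + 2)
    (hk' : k' = v ∨ k' = v + 2) :
    φfun (δdir k) (δdir k') (Mjg (blkOfPt (ray (t, 0, 0) u c)) (blkOfPt (ray (t', 0, 0) v c'))) =
      ζu k' / 4 * (((coord (ray (t, 0, 0) u c) k - coord (ray (t', 0, 0) v c') k' : ℤ)) : ℂ) := by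
  have hu := ζu_mul_conj u
  rw [φfun_Mjg, blkOfPt_ray, blkOfPt_ray]
  rcases hk with rfl | rfl <;> rcases hk' with rfl | rfl <;>
    simp only [coord_ray_own, coord_ray_anti, ζu_add_two] <;> push_cast <;>
    first
    | linear_combination ((c : ℂ) * ζu k' / 4) * hu
    | linear_combination (-((c : ℂ) * ζu k' / 4)) * hu
    | linear_combination ((c : ℂ) * ζu v / 4) * hu
    | linear_combination (-((c : ℂ) * ζu v / 4)) * hu

/-- two members of one frame that differ are antipodal. -/
theorem frame_antipode {u r k : Fin 4} (hr : r = u ∨ r = u + 2) (hk : k = u ∨ k = u + 2) (h : r ≠ k) : r = k + 2 := by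
  have h4 : ∀ x : Fin 4, x = x + 2 + 2 := by decide
  rcases hr with rfl | rfl <;> rcases hk with rfl | rfl
  exacts [absurd rfl h, h4 _, rfl, absurd rfl h]

/-- two members of one frame that are not antipodal coincide. -/
theorem frame_eq {u r k : Fin 4} (hr : r = u ∨ r = u + 2) (hk : k = u ∨ k = u + 2) (h : r ≠ k + 2) : r = k := by
  by_contra hne
  exact h (frame_antipode hr hk hne)

/-- plane-table membership: a rank-one matrix with row codirection `ξ` lies in the ROW plane of a leg on `g` … -/
theorem vecMulVec_mem_pairPlane_row (ξ w : Fin 2 → ℂ) (g j : Fin 4) :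
    vecMulVec ξ w ∈ pairPlane (PType.leg g ξ) g j := by
  have hP : pairPlane (PType.leg g ξ) g j = Submodule.span ℂ {vecMulVec ξ eA, vecMulVec ξ eB} := by simp [pairPlane]
  have hw : vecMulVec ξ w = w 0 • vecMulVec ξ eA + w 1 • vecMulVec ξ eB := by
    ext i j; fin_cases j <;> simp [vecMulVec_apply, eA, eB, mul_comm]
  rw [hP, hw]
  exact add_mem (Submodule.smul_mem _ _ (Submodule.subset_span (by simp)))
    (Submodule.smul_mem _ _ (Submodule.subset_span (by simp)))

/-- … one with column codirection `ξ` in the COLUMN plane of a leg on `j ≠ g` … -/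
theorem vecMulVec_mem_pairPlane_col {g j : Fin 4} (hgj : g ≠ j) (w ξ : Fin 2 → ℂ) :
    vecMulVec w ξ ∈ pairPlane (PType.leg j ξ) g j := by
  have hP : pairPlane (PType.leg j ξ) g j = Submodule.span ℂ {vecMulVec eA ξ, vecMulVec eB ξ} := by
    simp [pairPlane, hgj.symm]
  have hw : vecMulVec w ξ = w 0 • vecMulVec eA ξ + w 1 • vecMulVec eB ξ := by
    ext i j; fin_cases i <;> simp [vecMulVec_apply, eA, eB]
  rw [hP, hw]
  exact add_mem (Submodule.smul_mem _ _ (Submodule.subset_span (by simp)))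
    (Submodule.smul_mem _ _ (Submodule.subset_span (by simp)))

/-- … and `ξ ⊗ η` in the line of an (r2a) type on `(g, j)`, recorded in either orientation. -/
theorem pairPlane_r2a {g j : Fin 4} (ξ η : Fin 2 → ℂ) :
    pairPlane (PType.r2a g ξ j η) g j = Submodule.span ℂ {vecMulVec ξ η} := by
  simp [pairPlane]

theorem pairPlane_r2a_flip {g j : Fin 4} (hgj : g ≠ j) (ξ η : Fin 2 → ℂ) :
    pairPlane (PType.r2a j η g ξ) g j = Submodule.span ℂ {vecMulVec ξ η} := by
  simp [pairPlane, hgj.symm]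

/-- **THE PAIR BRIDGE AT TWO CHARGED FACTORS, COVERS INCLUDED.** Hypotheses: what the list `L` offers AT the pair `(g, j)` is
exactly legs on `g` in the frame directions `S_g`, legs on `j` in `S_j`, (r2a) covers in the frame direction pairs `Cov` (either
orientation), and types with no `(g, j)` component. Conclusion: absorption of the pair image ⟺ RULE D's clause at the pair with
the cover relation `Cov`. -/
theorem pair_charged_iff {L : List (PType ℂ)} {g j : Fin 4} (hgj : g ≠ j) (t c t' c' : ℤ) (u v : Fin 4)
    (Sg Sj : Fin 4 → Prop) (Cov : Fin 4 → Fin 4 → Prop)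
    (hL : ∀ p ∈ L, pairPlane p g j = ⊥ ∨ (∃ r, Sg r ∧ p = PType.leg g (ξdir r)) ∨ (∃ r, Sj r ∧ p = PType.leg j (ξdir r)) ∨
      (∃ a b, Cov a b ∧ (p = PType.r2a g (ξdir a) j (ξdir b) ∨ p = PType.r2a j (ξdir b) g (ξdir a))))
    (hSg : ∀ r, Sg r → PType.leg g (ξdir r) ∈ L) (hSj : ∀ r, Sj r → PType.leg j (ξdir r) ∈ L)
    (hCov : ∀ a b, Cov a b → PType.r2a g (ξdir a) j (ξdir b) ∈ L ∨ PType.r2a j (ξdir b) g (ξdir a) ∈ L)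
    (hSgf : ∀ r, Sg r → r = u ∨ r = u + 2) (hSjf : ∀ r, Sj r → r = v ∨ r = v + 2)
    (hCovf : ∀ a b, Cov a b → (a = u ∨ a = u + 2) ∧ (b = v ∨ b = v + 2)) :
    Mjg (blkOfPt (ray (t, 0, 0) u c)) (blkOfPt (ray (t', 0, 0) v c')) ∈ absorbAt L g j ↔
      ∀ k k', (k = u ∨ k = u + 2) → (k' = v ∨ k' = v + 2) →
        coord (ray (t, 0, 0) u c) k ≠ coord (ray (t', 0, 0) v c') k' → Sg k ∨ Sj k' ∨ Cov k k' := by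
  constructor
  · intro hM k k' hk hk' hne
    by_contra hnot
    simp only [not_or] at hnot
    obtain ⟨h1, h2, h3⟩ := hnot
    have hker : absorbAt L g j ≤ LinearMap.ker (φfun (δdir k) (δdir k')) := by
      refine iSup₂_le fun p hp => ?_
      rcases hL p hp with h0 | ⟨r, hr, rfl⟩ | ⟨r, hr, rfl⟩ | ⟨a, b, hab, hp'⟩
      · rw [h0]; exact bot_le
      · have hrk : r = k + 2 := frame_antipode (hSgf r hr) hk (by rintro rfl; exact h1 hr)
        have hP : pairPlane (PType.leg g (ξdir r)) g j = Submodule.span ℂ {vecMulVec (ξdir r) eA, vecMulVec (ξdir r) eB} := by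
          simp [pairPlane]
        rw [hP, Submodule.span_le]
        rintro _ (rfl | rfl) <;>
          simp only [SetLike.mem_coe, LinearMap.mem_ker, φfun_vecMulVec, hrk, δdir_dot_anti, zero_mul]
      · have hrk : r = k' + 2 := frame_antipode (hSjf r hr) hk' (by rintro rfl; exact h2 hr)
        have hP : pairPlane (PType.leg j (ξdir r)) g j = Submodule.span ℂ {vecMulVec eA (ξdir r), vecMulVec eB (ξdir r)} := by
          simp [pairPlane, hgj.symm]
        rw [hP, Submodule.span_le]
        rintro _ (rfl | rfl) <;>
          simp only [SetLike.mem_coe, LinearMap.mem_ker, φfun_vecMulVec, hrk, δdir_dot_anti, mul_zero]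
      · have hab2 : a = k + 2 ∨ b = k' + 2 := by
          by_cases ha : a = k
          · subst ha
            by_cases hb : b = k'
            · subst hb; exact absurd hab h3
            · exact Or.inr (frame_antipode (hCovf _ _ hab).2 hk' hb)
          · exact Or.inl (frame_antipode (hCovf _ _ hab).1 hk ha)
        have hP : pairPlane p g j = Submodule.span ℂ {vecMulVec (ξdir a) (ξdir b)} := by
          rcases hp' with rfl | rfl
          exacts [pairPlane_r2a _ _, pairPlane_r2a_flip hgj _ _]
        rw [hP, Submodule.span_le, Set.singleton_subset_iff, SetLike.mem_coe, LinearMap.mem_ker, φfun_vecMulVec]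
        rcases hab2 with rfl | rfl
        · rw [δdir_dot_anti, zero_mul]
        · rw [δdir_dot_anti, mul_zero]
    have h0 := hker hM
    rw [LinearMap.mem_ker, frame_coeff_charged t c t' c' u v hk hk'] at h0
    have hd : (((coord (ray (t, 0, 0) u c) k - coord (ray (t', 0, 0) v c') k' : ℤ)) : ℂ) ≠ 0 := by
      exact_mod_cast sub_ne_zero.2 hne
    exact mul_ne_zero (div_ne_zero (ζu_ne_zero k') (by norm_num)) hd h0
  · intro hD
    have term : ∀ k k', (k = u ∨ k = u + 2) → (k' = v ∨ k' = v + 2) →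
        φfun (δdir k) (δdir k') (Mjg (blkOfPt (ray (t, 0, 0) u c)) (blkOfPt (ray (t', 0, 0) v c'))) •
          vecMulVec (ξdir k) (ξdir k') ∈ absorbAt L g j := by
      intro k k' hk hk'
      by_cases hz : coord (ray (t, 0, 0) u c) k = coord (ray (t', 0, 0) v c') k'
      · rw [frame_coeff_charged t c t' c' u v hk hk', hz, sub_self, Int.cast_zero, mul_zero, zero_smul]
        exact zero_mem _
      · refine Submodule.smul_mem _ _ ?_
        rcases hD k k' hk hk' hz with h | h | h
        · exact pairPlane_le_absorbAt (hSg k h) g j (vecMulVec_mem_pairPlane_row _ _ g j)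
        · exact pairPlane_le_absorbAt (hSj k' h) g j (vecMulVec_mem_pairPlane_col hgj _ _)
        · rcases hCov k k' h with hp | hp
          · exact pairPlane_le_absorbAt hp g j (by rw [pairPlane_r2a]; exact Submodule.subset_span rfl)
          · exact pairPlane_le_absorbAt hp g j (by rw [pairPlane_r2a_flip hgj]; exact Submodule.subset_span rfl)
    rw [frame_expand u v (Mjg _ _)]
    exact add_mem (add_mem (add_mem (term u v (Or.inl rfl) (Or.inl rfl)) (term u (v + 2) (Or.inl rfl) (Or.inr rfl)))
      (term (u + 2) v (Or.inr rfl) (Or.inl rfl))) (term (u + 2) (v + 2) (Or.inr rfl) (Or.inr rfl))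


/-- (r2a) covers are recorded symmetrically. -/
theorem mcoverBelow_comm {Z : MCell} {g a j b : Fin 4} : MCoverBelow C Z g a j b ↔ MCoverBelow C Z j b g a := by
  constructor <;> rintro ⟨P, hP, hag, h1, h2, h3, h4⟩ <;> exact ⟨P, hP, fun i hi hi' => hag i hi' hi, h3, h4, h1, h2⟩

/-- the typed (r2a) list of an `N`-cell: one `PType.r2a g ξ_a j ξ_b` per cover below moving `(g, a)` and `(j, b)`, `g ≠ j` (both
orientations get listed; they carry the same line `ξ_a ⊗ ξ_b` at the pair). -/
noncomputable def coversBelow (C : MConfig) (Z : MCell) : List (PType ℂ) :=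
  ((Finset.univ.filter fun q : Fin 4 × Fin 4 × Fin 4 × Fin 4 =>
      q.1 ≠ q.2.2.1 ∧ MCoverBelow C Z q.1 q.2.1 q.2.2.1 q.2.2.2).toList).map
    fun q => PType.r2a q.1 (ξdir q.2.1) q.2.2.1 (ξdir q.2.2.2)

theorem mem_coversBelow {Z : MCell} {g a j b : Fin 4} (hgj : g ≠ j) (h : MCoverBelow C Z g a j b) :
    PType.r2a g (ξdir a) j (ξdir b) ∈ coversBelow C Z :=
  List.mem_map.2 ⟨(g, a, j, b), by simpa [Finset.mem_toList] using ⟨hgj, h⟩, rfl⟩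

theorem of_mem_coversBelow {Z : MCell} {p : PType ℂ} (h : p ∈ coversBelow C Z) :
    ∃ g a j b, g ≠ j ∧ MCoverBelow C Z g a j b ∧ p = PType.r2a g (ξdir a) j (ξdir b) := by
  obtain ⟨⟨g, a, j, b⟩, hq, rfl⟩ := List.mem_map.1 h
  simp only [Finset.mem_toList, Finset.mem_filter, Finset.mem_univ, true_and] at hq
  exact ⟨g, a, j, b, hq.1, hq.2, rfl⟩

/-- ALL typed partners below an `N`-cell: the legs of the four factors, then the covers. -/
noncomputable def partnersBelow (C : MConfig) (Z : MCell) : List (PType ℂ) :=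
  (List.finRange 4).flatMap (legsBelow C Z) ++ coversBelow C Z

/-- the direction pair of a cover below two CHARGED factors lies in their frames. -/
theorem cover_dirs_charged {Z : MCell} (haxis : ∀ P ∈ C.upper, ∀ f, (P f).2.1 = 0 ∨ (P f).2.2 = 0) {g a j b : Fin 4}
    {tg cg tj cj : ℤ} {ug uj : Fin 4} (hcg : 1 ≤ cg) (hcj : 1 ≤ cj) (hZg : Z g = ray (tg, 0, 0) ug cg)
    (hZj : Z j = ray (tj, 0, 0) uj cj) (h : MCoverBelow C Z g a j b) : (a = ug ∨ a = ug + 2) ∧ (b = uj ∨ b = uj + 2) := by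
  obtain ⟨P, hP, -, h1, h2, h3, h4⟩ := h
  rw [hZg] at h1 h2
  rw [hZj] at h3 h4
  exact ⟨dir_below_charged hcg (by simp at h1 ⊢; omega) (haxis P hP g) h2,
    dir_below_charged hcj (by simp at h3 ⊢; omega) (haxis P hP j) h4⟩

/-- at a CHARGED factor a frame coordinate is settled below iff the factor is served below in that very direction. -/
theorem settledBelow_charged_iff {Z : MCell} (haxis : ∀ P ∈ C.upper, ∀ f, (P f).2.1 = 0 ∨ (P f).2.2 = 0) {f k u : Fin 4}
    {t c : ℤ} (hc : 1 ≤ c) (hZf : Z f = ray (t, 0, 0) u c) (hk : k = u ∨ k = u + 2) :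
    SettledBelow C Z f k ↔ MServedBelow C Z f k := by
  have hkne : ∀ x : Fin 4, x ≠ x + 2 := by decide
  constructor
  · rintro ⟨r, hr, hsr⟩
    obtain rfl := frame_eq (served_dir_thin_charged hc (fun P hP => haxis P hP f) hZf hsr) hk hr
    exact hsr
  · exact fun h => ⟨k, hkne k, h⟩

theorem not_isApex_ray {t c : ℤ} (hc : 1 ≤ c) (u : Fin 4) : ¬ isApex (ray (t, 0, 0) u c) := by
  fin_cases u <;> simp [isApex] <;> omega

/-- at CHARGED (non-apex) factors a pair of frame coordinates is covered below iff there is the (r2a) cover moving exactly them. -/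
theorem coveredBelow_charged_iff {Z : MCell} {g k j k' : Fin 4} {tg cg tj cj : ℤ} {ug uj : Fin 4} (hcg : 1 ≤ cg) (hcj : 1 ≤ cj)
    (hZg : Z g = ray (tg, 0, 0) ug cg) (hZj : Z j = ray (tj, 0, 0) uj cj) :
    CoveredBelow C Z g k j k' ↔ MCoverBelow C Z g k j k' := by
  constructor
  · rintro ⟨a, b, ha, hb, h⟩
    rcases ha with rfl | ⟨ha, -⟩
    · rcases hb with rfl | ⟨hb, -⟩
      · exact h
      · exact absurd hb (hZj ▸ not_isApex_ray hcj uj)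
    · exact absurd ha (hZg ▸ not_isApex_ray hcg ug)
  · exact fun h => ⟨k, k', Or.inl rfl, Or.inl rfl, h⟩

/-- **RULE D ⟺ PAIR CRITERION AT AN ALL-CHARGED `N`-CELL OF `◇_h`, COVERS INCLUDED** (T5-1 (i) beyond thin cells). If every
factor of the `N`-cell `Z` is a charged letter `t_g·I + c_g·ℓ_{i^{u_g}}` (`c_g ≥ 1`), then RULE D holds at `Z` iff its blocks pass
the pair criterion against the typed list «one leg per served direction on each factor (`legsBelow`) + one (r2a) type per cover
below (`coversBelow`)». The dictionary is the frame form pair by pair (`pair_charged_iff`). -/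
theorem ruleDN_charged_iff_pairCriterion {h : ℤ} (hC : C.InDiamond h) {Z : MCell} (t c : Fin 4 → ℤ) (u : Fin 4 → Fin 4)
    (hc : ∀ g, 1 ≤ c g) (hZ : ∀ g, Z g = ray (t g, 0, 0) (u g) (c g)) :
    RuleDMu4N C Z ↔ PairCriterion (fun g => blkOfPt (Z g)) (partnersBelow C Z) := by
  have haxis : ∀ P ∈ C.upper, ∀ f, (P f).2.1 = 0 ∨ (P f).2.2 = 0 := fun P hP f => axis_of_inDiamond (hC.2 P hP f)
  have hpair : ∀ g j, g ≠ j → (Mjg (blkOfPt (Z g)) (blkOfPt (Z j)) ∈ absorbAt (partnersBelow C Z) g j ↔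
      ∀ k k', (k = u g ∨ k = u g + 2) → (k' = u j ∨ k' = u j + 2) → coord (Z g) k ≠ coord (Z j) k' →
        MServedBelow C Z g k ∨ MServedBelow C Z j k' ∨ (MCoverBelow C Z g k j k' ∨ MCoverBelow C Z j k' g k)) := by
    intro g j hgj
    rw [hZ g, hZ j]
    refine pair_charged_iff hgj (t g) (c g) (t j) (c j) (u g) (u j) (MServedBelow C Z g) (MServedBelow C Z j)
      (fun a b => MCoverBelow C Z g a j b ∨ MCoverBelow C Z j b g a) ?_ ?_ ?_ ?_ ?_ ?_ ?_
    · intro p hp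
      rcases List.mem_append.1 hp with hp | hp
      · obtain ⟨a, -, hp⟩ := List.mem_flatMap.1 hp
        obtain ⟨r, hr, rfl⟩ := of_mem_legsBelow hp
        by_cases hag : a = g
        · subst hag; exact Or.inr (Or.inl ⟨r, hr, rfl⟩)
        by_cases haj : a = j
        · subst haj; exact Or.inr (Or.inr (Or.inl ⟨r, hr, rfl⟩))
        exact Or.inl (pairPlane_eq_bot_of_touches _ (f := a) rfl (Ne.symm hag) (Ne.symm haj))
      · obtain ⟨a, ra, b, rb, -, hcov, rfl⟩ := of_mem_coversBelow hp
        by_cases h1 : a = g ∧ b = j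
        · obtain ⟨rfl, rfl⟩ := h1
          exact Or.inr (Or.inr (Or.inr ⟨ra, rb, Or.inl hcov, Or.inl rfl⟩))
        by_cases h2 : a = j ∧ b = g
        · obtain ⟨rfl, rfl⟩ := h2
          exact Or.inr (Or.inr (Or.inr ⟨rb, ra, Or.inr hcov, Or.inr rfl⟩))
        left
        simp only [pairPlane, h1, h2, if_false]
    · exact fun r hr => List.mem_append.2 (Or.inl (List.mem_flatMap.2 ⟨g, List.mem_finRange g, mem_legsBelow hr⟩))
    · exact fun r hr => List.mem_append.2 (Or.inl (List.mem_flatMap.2 ⟨j, List.mem_finRange j, mem_legsBelow hr⟩))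
    · exact fun a b hab => hab.elim (fun h' => Or.inl (List.mem_append.2 (Or.inr (mem_coversBelow hgj h'))))
        fun h' => Or.inr (List.mem_append.2 (Or.inr (mem_coversBelow hgj.symm h')))
    · exact fun r hr => served_dir_thin_charged (hc g) (fun P hP => haxis P hP g) (hZ g) hr
    · exact fun r hr => served_dir_thin_charged (hc j) (fun P hP => haxis P hP j) (hZ j) hr
    · exact fun a b hab => hab.elim (cover_dirs_charged haxis (hc g) (hc j) (hZ g) (hZ j))
        fun h' => (cover_dirs_charged haxis (hc j) (hc g) (hZ j) (hZ g) h').symm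
  constructor
  · intro hD g j hgj
    refine (hpair g j hgj).2 fun k k' hk hk' hne => ?_
    have hak : Adapted (Z g) k := by rw [hZ g, adapted_ray_iff (hc g)]; exact hk
    have hak' : Adapted (Z j) k' := by rw [hZ j, adapted_ray_iff (hc j)]; exact hk'
    rcases hD g j hgj k k' hak hak' hne with h' | h' | h'
    · exact Or.inl ((settledBelow_charged_iff haxis (hc g) (hZ g) hk).1 h')
    · exact Or.inr (Or.inl ((settledBelow_charged_iff haxis (hc j) (hZ j) hk').1 h'))
    · exact Or.inr (Or.inr (Or.inl ((coveredBelow_charged_iff (hcg := hc g) (hcj := hc j) (hZ g) (hZ j)).1 h')))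
  · intro hP g j hgj k k' hak hak' hne
    rw [hZ g, adapted_ray_iff (hc g)] at hak
    rw [hZ j, adapted_ray_iff (hc j)] at hak'
    rcases (hpair g j hgj).1 (hP g j hgj) k k' hak hak' hne with h' | h' | h' | h'
    · exact Or.inl ((settledBelow_charged_iff haxis (hc g) (hZ g) hak).2 h')
    · exact Or.inr (Or.inl ((settledBelow_charged_iff haxis (hc j) (hZ j) hak').2 h'))
    · exact Or.inr (Or.inr ((coveredBelow_charged_iff (hcg := hc g) (hcj := hc j) (hZ g) (hZ j)).2 h'))
    · exact Or.inr (Or.inr ((coveredBelow_charged_iff (hcg := hc g) (hcj := hc j) (hZ g) (hZ j)).2 (mcoverBelow_comm.2 h')))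


/-! #### The mirror at `P`-cells (legs and covers ABOVE; partners `N ∈ ◇_h` have axis letters). -/

theorem mcoverAbove_comm {P : MCell} {g a j b : Fin 4} : MCoverAbove C P g a j b ↔ MCoverAbove C P j b g a := by
  constructor <;> rintro ⟨N, hN, hag, h1, h2, h3, h4⟩ <;> exact ⟨N, hN, fun i hi hi' => hag i hi' hi, h3, h4, h1, h2⟩

/-- the typed (r2a) list ABOVE a `P`-cell. -/
noncomputable def coversAbove (C : MConfig) (P : MCell) : List (PType ℂ) :=
  ((Finset.univ.filter fun q : Fin 4 × Fin 4 × Fin 4 × Fin 4 =>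
      q.1 ≠ q.2.2.1 ∧ MCoverAbove C P q.1 q.2.1 q.2.2.1 q.2.2.2).toList).map
    fun q => PType.r2a q.1 (ξdir q.2.1) q.2.2.1 (ξdir q.2.2.2)

theorem mem_coversAbove {P : MCell} {g a j b : Fin 4} (hgj : g ≠ j) (h : MCoverAbove C P g a j b) :
    PType.r2a g (ξdir a) j (ξdir b) ∈ coversAbove C P :=
  List.mem_map.2 ⟨(g, a, j, b), by simpa [Finset.mem_toList] using ⟨hgj, h⟩, rfl⟩

theorem of_mem_coversAbove {P : MCell} {p : PType ℂ} (h : p ∈ coversAbove C P) :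
    ∃ g a j b, g ≠ j ∧ MCoverAbove C P g a j b ∧ p = PType.r2a g (ξdir a) j (ξdir b) := by
  obtain ⟨⟨g, a, j, b⟩, hq, rfl⟩ := List.mem_map.1 h
  simp only [Finset.mem_toList, Finset.mem_filter, Finset.mem_univ, true_and] at hq
  exact ⟨g, a, j, b, hq.1, hq.2, rfl⟩

/-- ALL typed partners above a `P`-cell: the legs of the four factors, then the covers. -/
noncomputable def partnersAbove (C : MConfig) (P : MCell) : List (PType ℂ) :=
  (List.finRange 4).flatMap (legsAbove C P) ++ coversAbove C P

theorem cover_dirs_charged_above {P : MCell} (haxis : ∀ N ∈ C.lower, ∀ f, (N f).2.1 = 0 ∨ (N f).2.2 = 0) {g a j b : Fin 4}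
    {tg cg tj cj : ℤ} {ug uj : Fin 4} (hcg : 1 ≤ cg) (hcj : 1 ≤ cj) (hPg : P g = ray (tg, 0, 0) ug cg)
    (hPj : P j = ray (tj, 0, 0) uj cj) (h : MCoverAbove C P g a j b) : (a = ug ∨ a = ug + 2) ∧ (b = uj ∨ b = uj + 2) := by
  obtain ⟨N, hN, -, h1, h2, h3, h4⟩ := h
  rw [hPg] at h1 h2
  rw [hPj] at h3 h4
  exact ⟨dir_above_charged hcg (by simp at h1 ⊢; omega) (haxis N hN g) h2,
    dir_above_charged hcj (by simp at h3 ⊢; omega) (haxis N hN j) h4⟩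

theorem settledAbove_charged_iff {P : MCell} (haxis : ∀ N ∈ C.lower, ∀ f, (N f).2.1 = 0 ∨ (N f).2.2 = 0) {f k u : Fin 4}
    {t c : ℤ} (hc : 1 ≤ c) (hPf : P f = ray (t, 0, 0) u c) (hk : k = u ∨ k = u + 2) :
    SettledAbove C P f k ↔ MServedAbove C P f k := by
  have hkne : ∀ x : Fin 4, x ≠ x + 2 := by decide
  constructor
  · rintro ⟨r, hr, hsr⟩
    obtain rfl := frame_eq (served_dir_thin_charged_above hc (fun N hN => haxis N hN f) hPf hsr) hk hr
    exact hsr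
  · exact fun h => ⟨k, hkne k, h⟩

theorem coveredAbove_charged_iff {P : MCell} {g k j k' : Fin 4} {tg cg tj cj : ℤ} {ug uj : Fin 4} (hcg : 1 ≤ cg) (hcj : 1 ≤ cj)
    (hPg : P g = ray (tg, 0, 0) ug cg) (hPj : P j = ray (tj, 0, 0) uj cj) :
    CoveredAbove C P g k j k' ↔ MCoverAbove C P g k j k' := by
  constructor
  · rintro ⟨a, b, ha, hb, h⟩
    rcases ha with rfl | ⟨ha, -⟩
    · rcases hb with rfl | ⟨hb, -⟩
      · exact h
      · exact absurd hb (hPj ▸ not_isApex_ray hcj uj)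
    · exact absurd ha (hPg ▸ not_isApex_ray hcg ug)
  · exact fun h => ⟨k, k', Or.inl rfl, Or.inl rfl, h⟩

/-- **RULE D ⟺ PAIR CRITERION AT AN ALL-CHARGED `P`-CELL OF `◇_h`, COVERS INCLUDED** — the mirror of
`ruleDN_charged_iff_pairCriterion` (rev 8's all-ceiling closed form `ruleDP_ceiling_iff_lifts` is the top-row instance, where no cover
and no own-direction leg exists above). -/
theorem ruleDP_charged_iff_pairCriterion {h : ℤ} (hC : C.InDiamond h) {P : MCell} (t c : Fin 4 → ℤ) (u : Fin 4 → Fin 4)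
    (hc : ∀ g, 1 ≤ c g) (hP : ∀ g, P g = ray (t g, 0, 0) (u g) (c g)) :
    RuleDMu4P C P ↔ PairCriterion (fun g => blkOfPt (P g)) (partnersAbove C P) := by
  have haxis : ∀ N ∈ C.lower, ∀ f, (N f).2.1 = 0 ∨ (N f).2.2 = 0 := fun N hN f => axis_of_inDiamond (hC.1 N hN f)
  have hpair : ∀ g j, g ≠ j → (Mjg (blkOfPt (P g)) (blkOfPt (P j)) ∈ absorbAt (partnersAbove C P) g j ↔
      ∀ k k', (k = u g ∨ k = u g + 2) → (k' = u j ∨ k' = u j + 2) → coord (P g) k ≠ coord (P j) k' →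
        MServedAbove C P g k ∨ MServedAbove C P j k' ∨ (MCoverAbove C P g k j k' ∨ MCoverAbove C P j k' g k)) := by
    intro g j hgj
    rw [hP g, hP j]
    refine pair_charged_iff hgj (t g) (c g) (t j) (c j) (u g) (u j) (MServedAbove C P g) (MServedAbove C P j)
      (fun a b => MCoverAbove C P g a j b ∨ MCoverAbove C P j b g a) ?_ ?_ ?_ ?_ ?_ ?_ ?_
    · intro p hp
      rcases List.mem_append.1 hp with hp | hp
      · obtain ⟨a, -, hp⟩ := List.mem_flatMap.1 hp
        obtain ⟨r, hr, rfl⟩ := of_mem_legsAbove hp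
        by_cases hag : a = g
        · subst hag; exact Or.inr (Or.inl ⟨r, hr, rfl⟩)
        by_cases haj : a = j
        · subst haj; exact Or.inr (Or.inr (Or.inl ⟨r, hr, rfl⟩))
        exact Or.inl (pairPlane_eq_bot_of_touches _ (f := a) rfl (Ne.symm hag) (Ne.symm haj))
      · obtain ⟨a, ra, b, rb, -, hcov, rfl⟩ := of_mem_coversAbove hp
        by_cases h1 : a = g ∧ b = j
        · obtain ⟨rfl, rfl⟩ := h1
          exact Or.inr (Or.inr (Or.inr ⟨ra, rb, Or.inl hcov, Or.inl rfl⟩))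
        by_cases h2 : a = j ∧ b = g
        · obtain ⟨rfl, rfl⟩ := h2
          exact Or.inr (Or.inr (Or.inr ⟨rb, ra, Or.inr hcov, Or.inr rfl⟩))
        left
        simp only [pairPlane, h1, h2, if_false]
    · exact fun r hr => List.mem_append.2 (Or.inl (List.mem_flatMap.2 ⟨g, List.mem_finRange g, mem_legsAbove hr⟩))
    · exact fun r hr => List.mem_append.2 (Or.inl (List.mem_flatMap.2 ⟨j, List.mem_finRange j, mem_legsAbove hr⟩))
    · exact fun a b hab => hab.elim (fun h' => Or.inl (List.mem_append.2 (Or.inr (mem_coversAbove hgj h'))))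
        fun h' => Or.inr (List.mem_append.2 (Or.inr (mem_coversAbove hgj.symm h')))
    · exact fun r hr => served_dir_thin_charged_above (hc g) (fun N hN => haxis N hN g) (hP g) hr
    · exact fun r hr => served_dir_thin_charged_above (hc j) (fun N hN => haxis N hN j) (hP j) hr
    · exact fun a b hab => hab.elim (cover_dirs_charged_above haxis (hc g) (hc j) (hP g) (hP j))
        fun h' => (cover_dirs_charged_above haxis (hc j) (hc g) (hP j) (hP g) h').symm
  constructor
  · intro hD g j hgj
    refine (hpair g j hgj).2 fun k k' hk hk' hne => ?_
    have hak : Adapted (P g) k := by rw [hP g, adapted_ray_iff (hc g)]; exact hk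
    have hak' : Adapted (P j) k' := by rw [hP j, adapted_ray_iff (hc j)]; exact hk'
    rcases hD g j hgj k k' hak hak' hne with h' | h' | h'
    · exact Or.inl ((settledAbove_charged_iff haxis (hc g) (hP g) hk).1 h')
    · exact Or.inr (Or.inl ((settledAbove_charged_iff haxis (hc j) (hP j) hk').1 h'))
    · exact Or.inr (Or.inr (Or.inl ((coveredAbove_charged_iff (hcg := hc g) (hcj := hc j) (hP g) (hP j)).1 h')))
  · intro hQ g j hgj k k' hak hak' hne
    rw [hP g, adapted_ray_iff (hc g)] at hak
    rw [hP j, adapted_ray_iff (hc j)] at hak'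
    rcases (hpair g j hgj).1 (hQ g j hgj) k k' hak hak' hne with h' | h' | h' | h'
    · exact Or.inl ((settledAbove_charged_iff haxis (hc g) (hP g) hak).2 h')
    · exact Or.inr (Or.inl ((settledAbove_charged_iff haxis (hc j) (hP j) hak').2 h'))
    · exact Or.inr (Or.inr ((coveredAbove_charged_iff (hcg := hc g) (hcj := hc j) (hP g) (hP j)).2 h'))
    · exact Or.inr (Or.inr ((coveredAbove_charged_iff (hcg := hc g) (hcj := hc j) (hP g) (hP j)).2 (mcoverAbove_comm.2 h')))


/-! ### §9e (rev 11) THE APEX GAP — the general bridge is NOT an equivalence for the typed RULE D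

`Pad4TowerRuleDMu4`'s FLAG F-1 lets a cover through an APEX factor in direction `a` resolve every coordinate `k ≠ a + 2` («at least as
permissive as (0.3) under either frame choice»; justified there for a SINGLY-served apex factor). At a pair of APEX factors of DIFFERENT
heights that are BOTH UNSERVED this is strictly more permissive than the plane table: the pair image is `(t_g − t_j)·e_A ⊗ e_B`, NOT
symmetric, while a DIAGONAL family of covers (directions `(a, a)`) offers only the symmetric lines `ξ_a ⊗ ξ_a` — yet it satisfies F-1's
clause at every `(k, k′)` (three pairwise distinct `a` always leave one with `a ∉ {k+2, k′+2}`). Kernel witness in `◇₈`: the `N`-cell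
`[4I | 8I | 2I+ℓ₁ | 2I+ℓ₁]` above the four diagonal covers `[2I+ℓ_{i^{a+2}} | 6I+ℓ_{i^{a+2}} | 2I+ℓ₁ | 2I+ℓ₁]` and the four legs `2I`, `2ℓ₁`
under its charged factors passes `RuleDMu4N` (`decide`) and FAILS the pair criterion (`apexGap_not_pairCriterion`). So T5-1's general
bridge can only be the implication «pair criterion ⇒ RULE D» plus an equivalence on cells without such pairs (all-charged: §9d; thin:
§9–§9c); (0.3) read with a frame CHOICE per apex factor rejects the diagonal family (no frame rectangle `{w,w+2} × {w′,w′+2}` lies on the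
diagonal), so the printed rule and the plane table agree here and the gap is F-1's. Consequences: RULE-D-UNSAT verdicts are untouched as
long as the plane table implies RULE D (weaker = still necessary); a RULE-D-SAT support needs the exact test only at doubly-unserved
apex–apex pairs of unequal heights — R18.44's ceiling-line support has the single apex letter `10I` (equal heights, zero demand), and the
typer's exact re-checks (F-1 (ii)) found 0 differences on the census supports.
-/

/-- the `N`-cell `[4I | 8I | 2I+ℓ₁ | 2I+ℓ₁]`: two APEX factors of different heights next to two charged ones. -/
def zApexGap : MCell := mcellOf (4, 0, 0) (8, 0, 0) (ray (2, 0, 0) 0 1) (ray (2, 0, 0) 0 1)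

/-- the diagonal (r2a) cover below `zApexGap` moving `(0, a)` and `(1, a)`: `[2I+ℓ_{i^{a+2}} | 6I+ℓ_{i^{a+2}} | 2I+ℓ₁ | 2I+ℓ₁]`. -/
def pDiagCover (a : Fin 4) : MCell :=
  mcellOf (ray (2, 0, 0) (a + 2) 1) (ray (6, 0, 0) (a + 2) 1) (ray (2, 0, 0) 0 1) (ray (2, 0, 0) 0 1)

/-- `zApexGap` above the four diagonal covers and the legs `2I`, `2ℓ₁` (directions `0` and `2`) under each charged factor. -/
def cfgApexGap : MConfig where
  lower := {zApexGap}
  upper := {pDiagCover 0, pDiagCover 1, pDiagCover 2, pDiagCover 3,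
    mcellOf (4, 0, 0) (8, 0, 0) (2, 0, 0) (ray (2, 0, 0) 0 1), mcellOf (4, 0, 0) (8, 0, 0) (lpt 2 0) (ray (2, 0, 0) 0 1),
    mcellOf (4, 0, 0) (8, 0, 0) (ray (2, 0, 0) 0 1) (2, 0, 0), mcellOf (4, 0, 0) (8, 0, 0) (ray (2, 0, 0) 0 1) (lpt 2 0)}

set_option synthInstance.maxSize 8192 in
set_option synthInstance.maxHeartbeats 2000000 in -- one large decidable instance, as in `Pad4TowerRuleDMu4` §5
/-- the witness lies in `◇₈`, and the typed RULE D HOLDS at `zApexGap`. [kernel, `decide`] -/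
theorem apexGap_ruleD : cfgApexGap.InDiamond 8 ∧ zApexGap ∈ cfgApexGap.lower ∧ RuleDMu4N cfgApexGap zApexGap := by
  refine ⟨?_, ?_, ?_⟩ <;> decide +kernel

set_option synthInstance.maxSize 8192 in
set_option synthInstance.maxHeartbeats 2000000 in -- as above
/-- its apex factors `0`, `1` are UNSERVED below, and its covers (on distinct factors) are exactly the diagonal ones on `{0, 1}`. [`decide`] -/
theorem apexGap_partners : (∀ r, ¬ MServedBelow cfgApexGap zApexGap 0 r) ∧ (∀ r, ¬ MServedBelow cfgApexGap zApexGap 1 r) ∧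
    ∀ g a j b : Fin 4, g ≠ j → MCoverBelow cfgApexGap zApexGap g a j b → ((g = 0 ∧ j = 1) ∨ (g = 1 ∧ j = 0)) ∧ a = b := by
  refine ⟨?_, ?_, ?_⟩ <;> decide +kernel

/-- the antisymmetric part `M ↦ M_{AB} − M_{BA}`. -/
noncomputable def skewPart : Matrix (Fin 2) (Fin 2) ℂ →ₗ[ℂ] ℂ where
  toFun M := M 0 1 - M 1 0
  map_add' M N := by simp only [Matrix.add_apply]; ring
  map_smul' s M := by simp only [Matrix.smul_apply, smul_eq_mul, RingHom.id_apply]; ring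

theorem skewPart_vecMulVec_self (ξ : Fin 2 → ℂ) : skewPart (vecMulVec ξ ξ) = 0 := by
  show vecMulVec ξ ξ 0 1 - vecMulVec ξ ξ 1 0 = 0
  simp [vecMulVec_apply, mul_comm]

/-- **THE APEX GAP (kernel).** The pair criterion FAILS at `zApexGap` against its typed partners: at the pair `(0, 1)` every offered plane
is a symmetric line `ξ_a ⊗ ξ_a` (diagonal covers; no legs on the apex factors; legs elsewhere contribute `0`), the pair image
`[[0, 4 − 8],[0, 0]]` is not symmetric. -/
theorem apexGap_not_pairCriterion : ¬ PairCriterion (fun g => blkOfPt (zApexGap g)) (partnersBelow cfgApexGap zApexGap) := by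
  intro hP
  obtain ⟨h0, h1, hcov⟩ := apexGap_partners
  have h01 : (0 : Fin 4) ≠ 1 := by decide
  have hker : absorbAt (partnersBelow cfgApexGap zApexGap) 0 1 ≤ LinearMap.ker skewPart := by
    refine iSup₂_le fun p hp => ?_
    rcases List.mem_append.1 hp with hp | hp
    · obtain ⟨f, -, hp⟩ := List.mem_flatMap.1 hp
      obtain ⟨r, hr, rfl⟩ := of_mem_legsBelow hp
      have hf0 : (0 : Fin 4) ≠ f := by rintro rfl; exact h0 r hr
      have hf1 : (1 : Fin 4) ≠ f := by rintro rfl; exact h1 r hr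
      rw [pairPlane_eq_bot_of_touches (PType.leg f (ξdir r)) (f := f) rfl hf0 hf1]
      exact bot_le
    · obtain ⟨g, a, j, b, hgj, hc, rfl⟩ := of_mem_coversBelow hp
      obtain ⟨hgj', rfl⟩ := hcov g a j b hgj hc
      have hP : pairPlane (PType.r2a g (ξdir a) j (ξdir a)) 0 1 = Submodule.span ℂ {vecMulVec (ξdir a) (ξdir a)} := by
        rcases hgj' with ⟨rfl, rfl⟩ | ⟨rfl, rfl⟩
        exacts [pairPlane_r2a _ _, pairPlane_r2a_flip h01 _ _]
      rw [hP, Submodule.span_le, Set.singleton_subset_iff, SetLike.mem_coe, LinearMap.mem_ker]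
      exact skewPart_vecMulVec_self _
  have h := hker (hP 0 1 h01)
  rw [LinearMap.mem_ker] at h
  revert h
  show Mjg (blkOfPt (zApexGap 0)) (blkOfPt (zApexGap 1)) 0 1 - Mjg (blkOfPt (zApexGap 0)) (blkOfPt (zApexGap 1)) 1 0 ≠ 0
  simp [Mjg, blkOfPt, zApexGap, mcellOf]
  norm_num

/-- **T5-1, the shape of the general bridge (kernel):** «RULE D ⟺ pair criterion» is FALSE in general for the typed RULE D — a `◇₈`
configuration and an `N`-cell of it pass `RuleDMu4N` and fail `PairCriterion` against the typed partners. -/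
theorem ruleDN_iff_pairCriterion_fails :
    ∃ C : MConfig, ∃ Z : MCell, C.InDiamond 8 ∧ Z ∈ C.lower ∧ RuleDMu4N C Z ∧
      ¬ PairCriterion (fun g => blkOfPt (Z g)) (partnersBelow C Z) :=
  ⟨cfgApexGap, zApexGap, apexGap_ruleD.1, apexGap_ruleD.2.1, apexGap_ruleD.2.2, apexGap_not_pairCriterion⟩


/-! ### §9f (rev 11) RULE D IS NECESSARY FOR THE PAIR CRITERION — every cell of `◇_h`, apex factors included (kernel)

The positive half of the general bridge. At ANY `N`-cell (resp. `P`-cell) of a `◇_h` configuration — factors apex or charged, served or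
not, covered or not — the pair criterion against the typed partners IMPLIES the typed RULE D. One functional per clause: if `(g,k)` and
`(j,k′)` are unsettled and the pair uncovered, `φ_{k,k′} = δ_k ⊗ δ_{k′}` kills every offered plane at `(g, j)` (served rows∕columns sit
in the antipodes `k+2`, `k′+2`; a cover `ξ_a ⊗ ξ_b` not killed would have `a ≠ k+2`, `b ≠ k′+2`, which at an apex factor IS F-1's `DirOK`
and at a charged factor forces `a = k`, `b = k′` — a RULE-D cover), while `φ_{k,k′}(M_{(g,j)}) = (i^{k′}/4)(c_k(x_g) − c_{k′}(x_j)) ≠ 0`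
(the frame form; an apex factor is the ray `t·I + 0·ℓ` in EVERY direction, so the frame form applies in the clause's own `k`). With §9e:
the typed RULE D is EXACTLY «necessary for the plane table», strictly weaker in general, equivalent on all-charged (§9d) and thin
(§9–§9c) cells. Consequence for the census: every RULE-D-UNSAT verdict is an UNSAT verdict for the plane-table criterion.
-/

/-- every `◇_h` letter is a ray `t·I + c·ℓ_{i^u}` with `c ≥ 0` (`c = 0`: apex). -/
theorem exists_ray_of_inDiamond {h : ℤ} {x : BPoint} (hx : InDiamond h x) :
    ∃ t c : ℤ, ∃ u : Fin 4, 0 ≤ c ∧ x = ray (t, 0, 0) u c := by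
  obtain ⟨a, b, d⟩ := x
  rcases hx.1 with h0 | ⟨hb, hd⟩ | ⟨hb, hd⟩
  · simp only [Prod.mk.injEq] at h0
    exact ⟨a, 0, 0, le_rfl, by simp [ray, h0.1, h0.2]⟩
  · simp only at hb hd
    rcases lt_or_gt_of_ne hb with hb | hb
    · exact ⟨a + b, -b, 2, by omega, by simp [ray, hd]⟩
    · exact ⟨a - b, b, 0, by omega, by simp [ray, hd]⟩
  · simp only at hb hd
    rcases lt_or_gt_of_ne hd with hd' | hd'
    · exact ⟨a + d, -d, 1, by omega, by simp [ray, hb]⟩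
    · exact ⟨a - d, d, 3, by omega, by simp [ray, hb]⟩

/-- **RULE D IS NECESSARY FOR THE PAIR CRITERION at every `N`-cell (kernel; apex factors included).** -/
theorem ruleDN_of_pairCriterion {h : ℤ} (hC : C.InDiamond h) {Z : MCell} (t c : Fin 4 → ℤ) (u : Fin 4 → Fin 4)
    (hc : ∀ g, 0 ≤ c g) (hZ : ∀ g, Z g = ray (t g, 0, 0) (u g) (c g))
    (hP : PairCriterion (fun g => blkOfPt (Z g)) (partnersBelow C Z)) : RuleDMu4N C Z := by
  have haxis : ∀ P ∈ C.upper, ∀ f, (P f).2.1 = 0 ∨ (P f).2.2 = 0 := fun P hP f => axis_of_inDiamond (hC.2 P hP f)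
  -- each factor is a ray in a frame containing any adapted `k` (an apex factor: `ray (t,0,0) k 0`)
  have hrep : ∀ g k, Adapted (Z g) k → ∃ v, (k = v ∨ k = v + 2) ∧ Z g = ray (t g, 0, 0) v (c g) := by
    intro g k hk
    rcases (hc g).eq_or_lt with h0 | h1
    · refine ⟨k, Or.inl rfl, ?_⟩
      rw [hZ g, ← h0]; simp [ray]
    · exact ⟨u g, (adapted_ray_iff (by omega) (u g) k).1 (hZ g ▸ hk), hZ g⟩
  -- a cover direction off the antipode resolves an adapted coordinate (F-1 at an apex factor; forced `a = k` at a charged one)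
  have hdir : ∀ g k a, Adapted (Z g) k → a ≠ k + 2 → ∀ P ∈ C.upper, (P g).1 < (Z g).1 →
      Z g = ray (P g) a ((Z g).1 - (P g).1) → DirOK (Z g) k a := by
    intro g k a hk hak P hP hlt hray
    rcases (hc g).eq_or_lt with h0 | h1
    · refine Or.inr ⟨?_, hak⟩
      rw [hZ g, ← h0]; simp [isApex]
    · have hkf : k = u g ∨ k = u g + 2 := (adapted_ray_iff (by omega) (u g) k).1 (hZ g ▸ hk)
      rw [hZ g] at hlt hray
      exact Or.inl (frame_eq (dir_below_charged h1 (by omega) (haxis P hP g) hray) hkf hak)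
  intro g j hgj k k' hadg hadj hne
  by_contra hnot
  simp only [not_or] at hnot
  obtain ⟨hSg, hSj, hCov⟩ := hnot
  obtain ⟨v, hkv, hZg⟩ := hrep g k hadg
  obtain ⟨v', hkv', hZj⟩ := hrep j k' hadj
  have hkill : ∀ a b, MCoverBelow C Z g a j b → a = k + 2 ∨ b = k' + 2 := by
    intro a b hcov
    by_contra hab
    simp only [not_or] at hab
    obtain ⟨P, hP, -, h1, h2, h3, h4⟩ := id hcov
    exact hCov ⟨a, b, hdir g k a hadg hab.1 P hP h1 h2, hdir j k' b hadj hab.2 P hP h3 h4, hcov⟩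
  have hker : absorbAt (partnersBelow C Z) g j ≤ LinearMap.ker (φfun (δdir k) (δdir k')) := by
    refine iSup₂_le fun p hp => ?_
    rcases List.mem_append.1 hp with hp | hp
    · obtain ⟨f, -, hp⟩ := List.mem_flatMap.1 hp
      obtain ⟨r, hr, rfl⟩ := of_mem_legsBelow hp
      by_cases hfg : f = g
      · subst hfg
        have hrk : r = k + 2 := by
          by_contra hrk
          exact hSg ⟨r, hrk, hr⟩
        have hPl : pairPlane (PType.leg f (ξdir r)) f j =
            Submodule.span ℂ {vecMulVec (ξdir r) eA, vecMulVec (ξdir r) eB} := by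
          simp [pairPlane]
        rw [hPl, Submodule.span_le]
        rintro _ (rfl | rfl) <;>
          simp only [SetLike.mem_coe, LinearMap.mem_ker, φfun_vecMulVec, hrk, δdir_dot_anti, zero_mul]
      by_cases hfj : f = j
      · subst hfj
        have hrk : r = k' + 2 := by
          by_contra hrk
          exact hSj ⟨r, hrk, hr⟩
        have hPl : pairPlane (PType.leg f (ξdir r)) g f =
            Submodule.span ℂ {vecMulVec eA (ξdir r), vecMulVec eB (ξdir r)} := by
          simp [pairPlane, hfg]
        rw [hPl, Submodule.span_le]
        rintro _ (rfl | rfl) <;>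
          simp only [SetLike.mem_coe, LinearMap.mem_ker, φfun_vecMulVec, hrk, δdir_dot_anti, mul_zero]
      rw [pairPlane_eq_bot_of_touches (PType.leg f (ξdir r)) (f := f) rfl (fun h => hfg h.symm) (fun h => hfj h.symm)]
      exact bot_le
    · obtain ⟨g', a, j', b, -, hcov, rfl⟩ := of_mem_coversBelow hp
      by_cases h1 : g' = g ∧ j' = j
      · obtain ⟨rfl, rfl⟩ := h1
        rw [pairPlane_r2a, Submodule.span_le, Set.singleton_subset_iff, SetLike.mem_coe, LinearMap.mem_ker, φfun_vecMulVec]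
        rcases hkill a b hcov with rfl | rfl
        · rw [δdir_dot_anti, zero_mul]
        · rw [δdir_dot_anti, mul_zero]
      by_cases h2 : g' = j ∧ j' = g
      · obtain ⟨rfl, rfl⟩ := h2
        rw [pairPlane_r2a_flip hgj, Submodule.span_le, Set.singleton_subset_iff, SetLike.mem_coe, LinearMap.mem_ker,
          φfun_vecMulVec]
        rcases hkill b a (mcoverBelow_comm.1 hcov) with rfl | rfl
        · rw [δdir_dot_anti, zero_mul]
        · rw [δdir_dot_anti, mul_zero]
      rw [show pairPlane (PType.r2a g' (ξdir a) j' (ξdir b)) g j = ⊥ by simp [pairPlane, h1, h2]]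
      exact bot_le
  have hM : Mjg (blkOfPt (Z g)) (blkOfPt (Z j)) ∈ absorbAt (partnersBelow C Z) g j := hP g j hgj
  have h0 := LinearMap.mem_ker.1 (hker hM)
  rw [hZg, hZj, frame_coeff_charged (t g) (c g) (t j) (c j) v v' hkv hkv'] at h0
  rw [hZg, hZj] at hne
  exact mul_ne_zero (div_ne_zero (ζu_ne_zero k') (by norm_num)) (by exact_mod_cast sub_ne_zero.2 hne) h0

/-- the same, hypotheses read off `◇_h` membership. -/
theorem ruleDN_of_pairCriterion' {h : ℤ} (hC : C.InDiamond h) {Z : MCell} (hZ : Z ∈ C.lower)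
    (hP : PairCriterion (fun g => blkOfPt (Z g)) (partnersBelow C Z)) : RuleDMu4N C Z := by
  choose t c u hc hZr using fun g => exists_ray_of_inDiamond (hC.1 Z hZ g)
  exact ruleDN_of_pairCriterion hC t c u hc hZr hP

/-- **RULE D IS NECESSARY FOR THE PAIR CRITERION at every `P`-cell (kernel; apex factors included).** -/
theorem ruleDP_of_pairCriterion {h : ℤ} (hC : C.InDiamond h) {P : MCell} (t c : Fin 4 → ℤ) (u : Fin 4 → Fin 4)
    (hc : ∀ g, 0 ≤ c g) (hZ : ∀ g, P g = ray (t g, 0, 0) (u g) (c g))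
    (hP : PairCriterion (fun g => blkOfPt (P g)) (partnersAbove C P)) : RuleDMu4P C P := by
  have haxis : ∀ N ∈ C.lower, ∀ f, (N f).2.1 = 0 ∨ (N f).2.2 = 0 := fun N hN f => axis_of_inDiamond (hC.1 N hN f)
  have hrep : ∀ g k, Adapted (P g) k → ∃ v, (k = v ∨ k = v + 2) ∧ P g = ray (t g, 0, 0) v (c g) := by
    intro g k hk
    rcases (hc g).eq_or_lt with h0 | h1
    · refine ⟨k, Or.inl rfl, ?_⟩
      rw [hZ g, ← h0]; simp [ray]
    · exact ⟨u g, (adapted_ray_iff (by omega) (u g) k).1 (hZ g ▸ hk), hZ g⟩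
  have hdir : ∀ g k a, Adapted (P g) k → a ≠ k + 2 → ∀ N ∈ C.lower, (P g).1 < (N g).1 →
      N g = ray (P g) a ((N g).1 - (P g).1) → DirOK (P g) k a := by
    intro g k a hk hak N hN hlt hray
    rcases (hc g).eq_or_lt with h0 | h1
    · refine Or.inr ⟨?_, hak⟩
      rw [hZ g, ← h0]; simp [isApex]
    · have hkf : k = u g ∨ k = u g + 2 := (adapted_ray_iff (by omega) (u g) k).1 (hZ g ▸ hk)
      rw [hZ g] at hlt hray
      exact Or.inl (frame_eq (dir_above_charged h1 (by omega) (haxis N hN g) hray) hkf hak)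
  intro g j hgj k k' hadg hadj hne
  by_contra hnot
  simp only [not_or] at hnot
  obtain ⟨hSg, hSj, hCov⟩ := hnot
  obtain ⟨v, hkv, hZg⟩ := hrep g k hadg
  obtain ⟨v', hkv', hZj⟩ := hrep j k' hadj
  have hkill : ∀ a b, MCoverAbove C P g a j b → a = k + 2 ∨ b = k' + 2 := by
    intro a b hcov
    by_contra hab
    simp only [not_or] at hab
    obtain ⟨N, hN, -, h1, h2, h3, h4⟩ := id hcov
    exact hCov ⟨a, b, hdir g k a hadg hab.1 N hN h1 h2, hdir j k' b hadj hab.2 N hN h3 h4, hcov⟩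
  have hker : absorbAt (partnersAbove C P) g j ≤ LinearMap.ker (φfun (δdir k) (δdir k')) := by
    refine iSup₂_le fun p hp => ?_
    rcases List.mem_append.1 hp with hp | hp
    · obtain ⟨f, -, hp⟩ := List.mem_flatMap.1 hp
      obtain ⟨r, hr, rfl⟩ := of_mem_legsAbove hp
      by_cases hfg : f = g
      · subst hfg
        have hrk : r = k + 2 := by
          by_contra hrk
          exact hSg ⟨r, hrk, hr⟩
        have hPl : pairPlane (PType.leg f (ξdir r)) f j =
            Submodule.span ℂ {vecMulVec (ξdir r) eA, vecMulVec (ξdir r) eB} := by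
          simp [pairPlane]
        rw [hPl, Submodule.span_le]
        rintro _ (rfl | rfl) <;>
          simp only [SetLike.mem_coe, LinearMap.mem_ker, φfun_vecMulVec, hrk, δdir_dot_anti, zero_mul]
      by_cases hfj : f = j
      · subst hfj
        have hrk : r = k' + 2 := by
          by_contra hrk
          exact hSj ⟨r, hrk, hr⟩
        have hPl : pairPlane (PType.leg f (ξdir r)) g f =
            Submodule.span ℂ {vecMulVec eA (ξdir r), vecMulVec eB (ξdir r)} := by
          simp [pairPlane, hfg]
        rw [hPl, Submodule.span_le]
        rintro _ (rfl | rfl) <;>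
          simp only [SetLike.mem_coe, LinearMap.mem_ker, φfun_vecMulVec, hrk, δdir_dot_anti, mul_zero]
      rw [pairPlane_eq_bot_of_touches (PType.leg f (ξdir r)) (f := f) rfl (fun h => hfg h.symm) (fun h => hfj h.symm)]
      exact bot_le
    · obtain ⟨g', a, j', b, -, hcov, rfl⟩ := of_mem_coversAbove hp
      by_cases h1 : g' = g ∧ j' = j
      · obtain ⟨rfl, rfl⟩ := h1
        rw [pairPlane_r2a, Submodule.span_le, Set.singleton_subset_iff, SetLike.mem_coe, LinearMap.mem_ker, φfun_vecMulVec]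
        rcases hkill a b hcov with rfl | rfl
        · rw [δdir_dot_anti, zero_mul]
        · rw [δdir_dot_anti, mul_zero]
      by_cases h2 : g' = j ∧ j' = g
      · obtain ⟨rfl, rfl⟩ := h2
        rw [pairPlane_r2a_flip hgj, Submodule.span_le, Set.singleton_subset_iff, SetLike.mem_coe, LinearMap.mem_ker,
          φfun_vecMulVec]
        rcases hkill b a (mcoverAbove_comm.1 hcov) with rfl | rfl
        · rw [δdir_dot_anti, zero_mul]
        · rw [δdir_dot_anti, mul_zero]
      rw [show pairPlane (PType.r2a g' (ξdir a) j' (ξdir b)) g j = ⊥ by simp [pairPlane, h1, h2]]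
      exact bot_le
  have hM : Mjg (blkOfPt (P g)) (blkOfPt (P j)) ∈ absorbAt (partnersAbove C P) g j := hP g j hgj
  have h0 := LinearMap.mem_ker.1 (hker hM)
  rw [hZg, hZj, frame_coeff_charged (t g) (c g) (t j) (c j) v v' hkv hkv'] at h0
  rw [hZg, hZj] at hne
  exact mul_ne_zero (div_ne_zero (ζu_ne_zero k') (by norm_num)) (by exact_mod_cast sub_ne_zero.2 hne) h0

/-- the same, hypotheses read off `◇_h` membership. -/
theorem ruleDP_of_pairCriterion' {h : ℤ} (hC : C.InDiamond h) {P : MCell} (hPu : P ∈ C.upper)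
    (hP : PairCriterion (fun g => blkOfPt (P g)) (partnersAbove C P)) : RuleDMu4P C P := by
  choose t c u hc hZr using fun g => exists_ray_of_inDiamond (hC.2 P hPu g)
  exact ruleDP_of_pairCriterion hC t c u hc hZr hP


/-! ### §9g (rev 12) THE GENERAL BRIDGE ON GAP-FREE CELLS — RULE D ⟺ pair criterion (kernel)

The converse of §9f holds at every cell of `◇_h` that has NO «apex gap»: no pair of APEX factors of unequal heights unserved on both
sides (§9e is exactly such a pair). Proof, pair by pair in the frames `{u_g, u_g+2} × {u_j, u_j+2}` (dual-basis expansion; an apex factor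
in any frame): a frame term with non-zero coefficient is a RULE-D clause; at two CHARGED factors the clause names the absorbing row, column
or cover line (§9d); at an APEX factor the clauses at ALL FOUR of its directions against one coordinate of the partner yield two DISTINCT
codirections hitting that coordinate (served rows or F-1 covers `a ≠ k+2` — one direction `d` cannot satisfy `d ≠ k+2` for every `k`),
and two codirections span `V`; at an apex–apex pair the served side (gap-freeness) supplies a row (or column), and off it the clauses at
the unserved antipode again yield two distinct hit coordinates. So on gap-free cells the typed RULE D (F-1 included) IS the plane-table
criterion; all-charged cells (§9d) and the supports of record (R18.44: single apex letter) are gap-free.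
-/

/-- distinct codirections have distinct second coordinates. -/
theorem ξdir_snd_ne {a r : Fin 4} (h : a ≠ r) : ξdir a 1 ≠ ξdir r 1 := by
  fin_cases a <;> fin_cases r <;> first | exact absurd rfl h | norm_num [ξdir, Complex.ext_iff]

/-- any vector is a combination of two distinct codirections. -/
theorem vec_span_pair {d₁ d₂ : Fin 4} (h : d₁ ≠ d₂) (w : Fin 2 → ℂ) : ∃ α β : ℂ, w = α • ξdir d₁ + β • ξdir d₂ := by
  have hne : ξdir d₂ 1 - ξdir d₁ 1 ≠ 0 := sub_ne_zero.2 (ξdir_snd_ne (Ne.symm h))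
  refine ⟨w 0 - (w 1 - w 0 * ξdir d₁ 1) / (ξdir d₂ 1 - ξdir d₁ 1), (w 1 - w 0 * ξdir d₁ 1) / (ξdir d₂ 1 - ξdir d₁ 1), ?_⟩
  funext i
  match i with
  | 0 => simp only [Pi.add_apply, Pi.smul_apply, smul_eq_mul, ξdir_fst]; ring
  | 1 =>
    simp only [Pi.add_apply, Pi.smul_apply, smul_eq_mul]
    field_simp
    ring

/-- two distinct ROW codirections against one column vector absorb every row against it. -/
theorem vmv_mem_of_two_rows {A : Submodule ℂ (Matrix (Fin 2) (Fin 2) ℂ)} {d₁ d₂ : Fin 4} (h : d₁ ≠ d₂) {η : Fin 2 → ℂ}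
    (h1 : vecMulVec (ξdir d₁) η ∈ A) (h2 : vecMulVec (ξdir d₂) η ∈ A) (w : Fin 2 → ℂ) : vecMulVec w η ∈ A := by
  obtain ⟨α, β, rfl⟩ := vec_span_pair h w
  have : vecMulVec (α • ξdir d₁ + β • ξdir d₂) η = α • vecMulVec (ξdir d₁) η + β • vecMulVec (ξdir d₂) η := by
    ext i j; simp [vecMulVec_apply]; ring
  rw [this]
  exact add_mem (A.smul_mem _ h1) (A.smul_mem _ h2)

/-- two distinct COLUMN codirections against one row vector absorb every column against it. -/
theorem vmv_mem_of_two_cols {A : Submodule ℂ (Matrix (Fin 2) (Fin 2) ℂ)} {d₁ d₂ : Fin 4} (h : d₁ ≠ d₂) {ξ : Fin 2 → ℂ}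
    (h1 : vecMulVec ξ (ξdir d₁) ∈ A) (h2 : vecMulVec ξ (ξdir d₂) ∈ A) (w : Fin 2 → ℂ) : vecMulVec ξ w ∈ A := by
  obtain ⟨α, β, rfl⟩ := vec_span_pair h w
  have : vecMulVec ξ (α • ξdir d₁ + β • ξdir d₂) = α • vecMulVec ξ (ξdir d₁) + β • vecMulVec ξ (ξdir d₂) := by
    ext i j; simp [vecMulVec_apply]; ring
  rw [this]
  exact add_mem (A.smul_mem _ h1) (A.smul_mem _ h2)

/-- RULE D's clauses over ALL FOUR directions of an apex factor yield two distinct hits: one direction `d` cannot avoid every antipode. -/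
theorem two_of_clauses {D : Fin 4 → Prop} (h : ∀ k : Fin 4, ∃ d, d ≠ k + 2 ∧ D d) : ∃ d₁ d₂, d₁ ≠ d₂ ∧ D d₁ ∧ D d₂ := by
  have h22 : ∀ x : Fin 4, x + 2 + 2 = x := by decide
  obtain ⟨d₁, -, h1⟩ := h 0
  obtain ⟨d₂, hne, h2⟩ := h (d₁ + 2)
  exact ⟨d₁, d₂, fun h' => hne (h'.symm.trans (h22 d₁).symm), h1, h2⟩


/-- NO APEX GAP below the `N`-cell `Z`: every pair of APEX factors of unequal heights is served below on at least one side (§9e's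
witness is exactly a violation). All-charged cells and cells whose apex factors share one height satisfy it vacuously. -/
def NoApexGapBelow (C : MConfig) (Z : MCell) : Prop :=
  ∀ g j : Fin 4, g ≠ j → isApex (Z g) → isApex (Z j) → (Z g).1 ≠ (Z j).1 →
    (∃ r, MServedBelow C Z g r) ∨ ∃ r, MServedBelow C Z j r

/-- the same above a `P`-cell. -/
def NoApexGapAbove (C : MConfig) (P : MCell) : Prop :=
  ∀ g j : Fin 4, g ≠ j → isApex (P g) → isApex (P j) → (P g).1 ≠ (P j).1 →
    (∃ r, MServedAbove C P g r) ∨ ∃ r, MServedAbove C P j r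

theorem noApexGapBelow_of_one_height {Z : MCell} (a : ℤ) (h : ∀ g, isApex (Z g) → (Z g).1 = a) : NoApexGapBelow C Z :=
  fun g j _ hg hj hne => absurd ((h g hg).trans (h j hj).symm) hne

theorem noApexGapAbove_of_one_height {P : MCell} (a : ℤ) (h : ∀ g, isApex (P g) → (P g).1 = a) : NoApexGapAbove C P :=
  fun g j _ hg hj hne => absurd ((h g hg).trans (h j hj).symm) hne

/-- **THE GENERAL BRIDGE AT A GAP-FREE `N`-CELL (kernel).** For an `N`-cell of a `◇_h` configuration (factors `t_g·I + c_g·ℓ_{i^{u_g}}`,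
`c_g ≥ 0`) with no apex gap below — every pair of apex factors of unequal heights is served below on at least one side —
RULE D ⟺ pair criterion against legs + covers. -/
theorem ruleDN_iff_pairCriterion_of_noGap {h : ℤ} (hC : C.InDiamond h) {Z : MCell} (t c : Fin 4 → ℤ) (u : Fin 4 → Fin 4)
    (hc : ∀ g, 0 ≤ c g) (hZ : ∀ g, Z g = ray (t g, 0, 0) (u g) (c g))
    (hgap : ∀ g j, g ≠ j → c g = 0 → c j = 0 → t g ≠ t j → (∃ r, MServedBelow C Z g r) ∨ ∃ r, MServedBelow C Z j r) :
    RuleDMu4N C Z ↔ PairCriterion (fun g => blkOfPt (Z g)) (partnersBelow C Z) := by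
  refine ⟨fun hD g j hgj => ?_, ruleDN_of_pairCriterion hC t c u hc hZ⟩
  have haxis : ∀ P ∈ C.upper, ∀ f, (P f).2.1 = 0 ∨ (P f).2.2 = 0 := fun P hP f => axis_of_inDiamond (hC.2 P hP f)
  have hk2 : ∀ x : Fin 4, x ≠ x + 2 := by decide
  have h22 : ∀ x : Fin 4, x + 2 + 2 = x := by decide
  have rowA : ∀ r, MServedBelow C Z g r → ∀ η, vecMulVec (ξdir r) η ∈ absorbAt (partnersBelow C Z) g j := fun r hr η =>
    pairPlane_le_absorbAt (List.mem_append.2 (Or.inl (List.mem_flatMap.2 ⟨g, List.mem_finRange g, mem_legsBelow hr⟩))) g j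
      (vecMulVec_mem_pairPlane_row _ _ g j)
  have colA : ∀ r, MServedBelow C Z j r → ∀ w, vecMulVec w (ξdir r) ∈ absorbAt (partnersBelow C Z) g j := fun r hr w =>
    pairPlane_le_absorbAt (List.mem_append.2 (Or.inl (List.mem_flatMap.2 ⟨j, List.mem_finRange j, mem_legsBelow hr⟩))) g j
      (vecMulVec_mem_pairPlane_col hgj _ _)
  have covA : ∀ a b, MCoverBelow C Z g a j b → vecMulVec (ξdir a) (ξdir b) ∈ absorbAt (partnersBelow C Z) g j :=
    fun a b hab => pairPlane_le_absorbAt (List.mem_append.2 (Or.inr (mem_coversBelow hgj hab))) g j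
      (by rw [pairPlane_r2a]; exact Submodule.subset_span rfl)
  have hapex : ∀ f, c f = 0 → (∀ k, Adapted (Z f) k) ∧ (∀ k, coord (Z f) k = t f) ∧ isApex (Z f) := by
    intro f h0
    rw [hZ f, h0]
    exact ⟨fun k => by fin_cases k <;> simp [Adapted], fun k => by fin_cases k <;> simp [coord], by simp [isApex]⟩
  have hdirne : ∀ x k a, DirOK x k a → a ≠ k + 2 := by
    rintro x k a (rfl | ⟨-, h⟩)
    exacts [hk2 a, h]
  have hdirch : ∀ f k a, 1 ≤ c f → DirOK (Z f) k a → a = k := by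
    rintro f k a h1 (h | ⟨h, -⟩)
    · exact h
    · exact absurd h (by rw [hZ f]; exact not_isApex_ray h1 _)
  have hsetch : ∀ f k, 1 ≤ c f → (k = u f ∨ k = u f + 2) → SettledBelow C Z f k → MServedBelow C Z f k :=
    fun f k h1 hk hs => (settledBelow_charged_iff haxis h1 (hZ f) hk).1 hs
  have hadch : ∀ f k, 1 ≤ c f → (k = u f ∨ k = u f + 2) → Adapted (Z f) k :=
    fun f k h1 hk => by rw [hZ f, adapted_ray_iff h1]; exact hk
  -- every frame term with a non-zero coefficient is absorbed
  have term : ∀ k k', (k = u g ∨ k = u g + 2) → (k' = u j ∨ k' = u j + 2) → coord (Z g) k ≠ coord (Z j) k' →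
      vecMulVec (ξdir k) (ξdir k') ∈ absorbAt (partnersBelow C Z) g j := by
    intro k k' hk hk' hne
    rcases (hc g).eq_or_lt with hg0 | hg1 <;> rcases (hc j).eq_or_lt with hj0 | hj1
    · -- apex – apex: the served side supplies a row (column); off it two distinct coordinates are hit
      obtain ⟨hadg, hcg, -⟩ := hapex g hg0.symm
      obtain ⟨hadj, hcj, -⟩ := hapex j hj0.symm
      have htt : t g ≠ t j := by rwa [hcg, hcj] at hne
      rcases hgap g j hgj hg0.symm hj0.symm htt with ⟨r₀, hr₀⟩ | ⟨s₀, hs₀⟩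
      · by_cases h2 : ∃ r₁, r₁ ≠ r₀ ∧ MServedBelow C Z g r₁
        · obtain ⟨r₁, hr₁, hsr₁⟩ := h2
          exact vmv_mem_of_two_rows (Ne.symm hr₁) (rowA r₀ hr₀ _) (rowA r₁ hsr₁ _) _
        · have hE : ∀ k₁ : Fin 4, ∃ d, d ≠ k₁ + 2 ∧ ∃ a, a ≠ r₀ ∧
              vecMulVec (ξdir a) (ξdir d) ∈ absorbAt (partnersBelow C Z) g j := by
            intro k₁
            rcases hD g j hgj (r₀ + 2) k₁ (hadg _) (hadj _) (by rw [hcg, hcj]; exact htt) with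
              ⟨r, hr, hsr⟩ | ⟨s, hs, hss⟩ | ⟨a, b, ha, hb, hab⟩
            · exact (h2 ⟨r, by rwa [h22] at hr, hsr⟩).elim
            · exact ⟨s, hs, r₀ + 2, (hk2 r₀).symm, colA s hss _⟩
            · exact ⟨b, hdirne _ _ _ hb, a, by have h' := hdirne _ _ _ ha; rwa [h22] at h', covA a b hab⟩
          obtain ⟨d₁, d₂, hd, ⟨a₁, ha₁, h₁⟩, ⟨a₂, ha₂, h₂⟩⟩ :=
            two_of_clauses (D := fun d => ∃ a, a ≠ r₀ ∧ vecMulVec (ξdir a) (ξdir d) ∈ absorbAt (partnersBelow C Z) g j) hE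
          have hc₁ := vmv_mem_of_two_rows (Ne.symm ha₁) (rowA r₀ hr₀ (ξdir d₁)) h₁
          have hc₂ := vmv_mem_of_two_rows (Ne.symm ha₂) (rowA r₀ hr₀ (ξdir d₂)) h₂
          exact vmv_mem_of_two_cols hd (hc₁ (ξdir k)) (hc₂ (ξdir k)) _
      · by_cases h2 : ∃ s₁, s₁ ≠ s₀ ∧ MServedBelow C Z j s₁
        · obtain ⟨s₁, hs₁, hss₁⟩ := h2
          exact vmv_mem_of_two_cols (Ne.symm hs₁) (colA s₀ hs₀ _) (colA s₁ hss₁ _) _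
        · have hE : ∀ k₁ : Fin 4, ∃ d, d ≠ k₁ + 2 ∧ ∃ b, b ≠ s₀ ∧
              vecMulVec (ξdir d) (ξdir b) ∈ absorbAt (partnersBelow C Z) g j := by
            intro k₁
            rcases hD g j hgj k₁ (s₀ + 2) (hadg _) (hadj _) (by rw [hcg, hcj]; exact htt) with
              ⟨r, hr, hsr⟩ | ⟨s, hs, hss⟩ | ⟨a, b, ha, hb, hab⟩
            · exact ⟨r, hr, s₀ + 2, (hk2 s₀).symm, rowA r hsr _⟩
            · exact (h2 ⟨s, by rwa [h22] at hs, hss⟩).elim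
            · exact ⟨a, hdirne _ _ _ ha, b, by have h' := hdirne _ _ _ hb; rwa [h22] at h', covA a b hab⟩
          obtain ⟨d₁, d₂, hd, ⟨b₁, hb₁, h₁⟩, ⟨b₂, hb₂, h₂⟩⟩ :=
            two_of_clauses (D := fun d => ∃ b, b ≠ s₀ ∧ vecMulVec (ξdir d) (ξdir b) ∈ absorbAt (partnersBelow C Z) g j) hE
          have hr₁ := vmv_mem_of_two_cols (Ne.symm hb₁) (colA s₀ hs₀ (ξdir d₁)) h₁
          have hr₂ := vmv_mem_of_two_cols (Ne.symm hb₂) (colA s₀ hs₀ (ξdir d₂)) h₂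
          exact vmv_mem_of_two_rows hd (hr₁ (ξdir k')) (hr₂ (ξdir k')) _
    · -- apex – charged: against the partner's coordinate `k′`, the four clauses give two distinct rows
      have hj1' : 1 ≤ c j := by omega
      obtain ⟨hadg, hcg, -⟩ := hapex g hg0.symm
      by_cases hsj : MServedBelow C Z j k'
      · exact colA k' hsj _
      · have hE : ∀ k₁ : Fin 4, ∃ d, d ≠ k₁ + 2 ∧ vecMulVec (ξdir d) (ξdir k') ∈ absorbAt (partnersBelow C Z) g j := by
          intro k₁
          have hne₁ : coord (Z g) k₁ ≠ coord (Z j) k' := by rw [hcg] at hne ⊢; exact hne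
          rcases hD g j hgj k₁ k' (hadg _) (hadch j k' hj1' hk') hne₁ with ⟨r, hr, hsr⟩ | hs | ⟨a, b, ha, hb, hab⟩
          · exact ⟨r, hr, rowA r hsr _⟩
          · exact absurd (hsetch j k' hj1' hk' hs) hsj
          · obtain rfl := hdirch j k' b hj1' hb
            exact ⟨a, hdirne _ _ _ ha, covA a _ hab⟩
        obtain ⟨d₁, d₂, hd, h₁, h₂⟩ :=
          two_of_clauses (D := fun d => vecMulVec (ξdir d) (ξdir k') ∈ absorbAt (partnersBelow C Z) g j) hE
        exact vmv_mem_of_two_rows hd h₁ h₂ _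
    · -- charged – apex
      have hg1' : 1 ≤ c g := by omega
      obtain ⟨hadj, hcj, -⟩ := hapex j hj0.symm
      by_cases hsg : MServedBelow C Z g k
      · exact rowA k hsg _
      · have hE : ∀ k₁ : Fin 4, ∃ d, d ≠ k₁ + 2 ∧ vecMulVec (ξdir k) (ξdir d) ∈ absorbAt (partnersBelow C Z) g j := by
          intro k₁
          have hne₁ : coord (Z g) k ≠ coord (Z j) k₁ := by rw [hcj] at hne ⊢; exact hne
          rcases hD g j hgj k k₁ (hadch g k hg1' hk) (hadj _) hne₁ with hs | ⟨s, hs, hss⟩ | ⟨a, b, ha, hb, hab⟩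
          · exact absurd (hsetch g k hg1' hk hs) hsg
          · exact ⟨s, hs, colA s hss _⟩
          · obtain rfl := hdirch g k a hg1' ha
            exact ⟨b, hdirne _ _ _ hb, covA _ b hab⟩
        obtain ⟨d₁, d₂, hd, h₁, h₂⟩ :=
          two_of_clauses (D := fun d => vecMulVec (ξdir k) (ξdir d) ∈ absorbAt (partnersBelow C Z) g j) hE
        exact vmv_mem_of_two_cols hd h₁ h₂ _
    · -- charged – charged (§9d)
      have hg1' : 1 ≤ c g := by omega
      have hj1' : 1 ≤ c j := by omega
      rcases hD g j hgj k k' (hadch g k hg1' hk) (hadch j k' hj1' hk') hne with hs | hs | ⟨a, b, ha, hb, hab⟩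
      · exact rowA k (hsetch g k hg1' hk hs) _
      · exact colA k' (hsetch j k' hj1' hk' hs) _
      · obtain rfl := hdirch g k a hg1' ha
        obtain rfl := hdirch j k' b hj1' hb
        exact covA _ _ hab
  -- assemble with the dual-basis expansion in the frames `u g`, `u j`
  show Mjg (blkOfPt (Z g)) (blkOfPt (Z j)) ∈ absorbAt (partnersBelow C Z) g j
  have piece : ∀ k k', (k = u g ∨ k = u g + 2) → (k' = u j ∨ k' = u j + 2) →
      φfun (δdir k) (δdir k') (Mjg (blkOfPt (Z g)) (blkOfPt (Z j))) • vecMulVec (ξdir k) (ξdir k') ∈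
        absorbAt (partnersBelow C Z) g j := by
    intro k k' hk hk'
    by_cases hz : coord (Z g) k = coord (Z j) k'
    · rw [hZ g, hZ j] at hz
      rw [hZ g, hZ j, frame_coeff_charged (t g) (c g) (t j) (c j) (u g) (u j) hk hk', hz, sub_self, Int.cast_zero,
        mul_zero, zero_smul]
      exact zero_mem _
    · exact Submodule.smul_mem _ _ (term k k' hk hk' hz)
  rw [frame_expand (u g) (u j) (Mjg _ _)]
  exact add_mem (add_mem (add_mem (piece _ _ (Or.inl rfl) (Or.inl rfl)) (piece _ _ (Or.inl rfl) (Or.inr rfl)))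
    (piece _ _ (Or.inr rfl) (Or.inl rfl))) (piece _ _ (Or.inr rfl) (Or.inr rfl))


/-- **THE GENERAL BRIDGE AT A GAP-FREE `P`-CELL (kernel).** For a `P`-cell of a `◇_h` configuration (factors `t_g·I + c_g·ℓ_{i^{u_g}}`,
`c_g ≥ 0`) with no apex gap above — every pair of apex factors of unequal heights is served above on at least one side —
RULE D ⟺ pair criterion against legs + covers. -/
theorem ruleDP_iff_pairCriterion_of_noGap {h : ℤ} (hC : C.InDiamond h) {Z : MCell} (t c : Fin 4 → ℤ) (u : Fin 4 → Fin 4)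
    (hc : ∀ g, 0 ≤ c g) (hZ : ∀ g, Z g = ray (t g, 0, 0) (u g) (c g))
    (hgap : ∀ g j, g ≠ j → c g = 0 → c j = 0 → t g ≠ t j → (∃ r, MServedAbove C Z g r) ∨ ∃ r, MServedAbove C Z j r) :
    RuleDMu4P C Z ↔ PairCriterion (fun g => blkOfPt (Z g)) (partnersAbove C Z) := by
  refine ⟨fun hD g j hgj => ?_, ruleDP_of_pairCriterion hC t c u hc hZ⟩
  have haxis : ∀ N ∈ C.lower, ∀ f, (N f).2.1 = 0 ∨ (N f).2.2 = 0 := fun N hN f => axis_of_inDiamond (hC.1 N hN f)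
  have hk2 : ∀ x : Fin 4, x ≠ x + 2 := by decide
  have h22 : ∀ x : Fin 4, x + 2 + 2 = x := by decide
  have rowA : ∀ r, MServedAbove C Z g r → ∀ η, vecMulVec (ξdir r) η ∈ absorbAt (partnersAbove C Z) g j := fun r hr η =>
    pairPlane_le_absorbAt (List.mem_append.2 (Or.inl (List.mem_flatMap.2 ⟨g, List.mem_finRange g, mem_legsAbove hr⟩))) g j
      (vecMulVec_mem_pairPlane_row _ _ g j)
  have colA : ∀ r, MServedAbove C Z j r → ∀ w, vecMulVec w (ξdir r) ∈ absorbAt (partnersAbove C Z) g j := fun r hr w =>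
    pairPlane_le_absorbAt (List.mem_append.2 (Or.inl (List.mem_flatMap.2 ⟨j, List.mem_finRange j, mem_legsAbove hr⟩))) g j
      (vecMulVec_mem_pairPlane_col hgj _ _)
  have covA : ∀ a b, MCoverAbove C Z g a j b → vecMulVec (ξdir a) (ξdir b) ∈ absorbAt (partnersAbove C Z) g j :=
    fun a b hab => pairPlane_le_absorbAt (List.mem_append.2 (Or.inr (mem_coversAbove hgj hab))) g j
      (by rw [pairPlane_r2a]; exact Submodule.subset_span rfl)
  have hapex : ∀ f, c f = 0 → (∀ k, Adapted (Z f) k) ∧ (∀ k, coord (Z f) k = t f) ∧ isApex (Z f) := by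
    intro f h0
    rw [hZ f, h0]
    exact ⟨fun k => by fin_cases k <;> simp [Adapted], fun k => by fin_cases k <;> simp [coord], by simp [isApex]⟩
  have hdirne : ∀ x k a, DirOK x k a → a ≠ k + 2 := by
    rintro x k a (rfl | ⟨-, h⟩)
    exacts [hk2 a, h]
  have hdirch : ∀ f k a, 1 ≤ c f → DirOK (Z f) k a → a = k := by
    rintro f k a h1 (h | ⟨h, -⟩)
    · exact h
    · exact absurd h (by rw [hZ f]; exact not_isApex_ray h1 _)
  have hsetch : ∀ f k, 1 ≤ c f → (k = u f ∨ k = u f + 2) → SettledAbove C Z f k → MServedAbove C Z f k :=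
    fun f k h1 hk hs => (settledAbove_charged_iff haxis h1 (hZ f) hk).1 hs
  have hadch : ∀ f k, 1 ≤ c f → (k = u f ∨ k = u f + 2) → Adapted (Z f) k :=
    fun f k h1 hk => by rw [hZ f, adapted_ray_iff h1]; exact hk
  -- every frame term with a non-zero coefficient is absorbed
  have term : ∀ k k', (k = u g ∨ k = u g + 2) → (k' = u j ∨ k' = u j + 2) → coord (Z g) k ≠ coord (Z j) k' →
      vecMulVec (ξdir k) (ξdir k') ∈ absorbAt (partnersAbove C Z) g j := by
    intro k k' hk hk' hne
    rcases (hc g).eq_or_lt with hg0 | hg1 <;> rcases (hc j).eq_or_lt with hj0 | hj1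
    · -- apex – apex: the served side supplies a row (column); off it two distinct coordinates are hit
      obtain ⟨hadg, hcg, -⟩ := hapex g hg0.symm
      obtain ⟨hadj, hcj, -⟩ := hapex j hj0.symm
      have htt : t g ≠ t j := by rwa [hcg, hcj] at hne
      rcases hgap g j hgj hg0.symm hj0.symm htt with ⟨r₀, hr₀⟩ | ⟨s₀, hs₀⟩
      · by_cases h2 : ∃ r₁, r₁ ≠ r₀ ∧ MServedAbove C Z g r₁
        · obtain ⟨r₁, hr₁, hsr₁⟩ := h2
          exact vmv_mem_of_two_rows (Ne.symm hr₁) (rowA r₀ hr₀ _) (rowA r₁ hsr₁ _) _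
        · have hE : ∀ k₁ : Fin 4, ∃ d, d ≠ k₁ + 2 ∧ ∃ a, a ≠ r₀ ∧
              vecMulVec (ξdir a) (ξdir d) ∈ absorbAt (partnersAbove C Z) g j := by
            intro k₁
            rcases hD g j hgj (r₀ + 2) k₁ (hadg _) (hadj _) (by rw [hcg, hcj]; exact htt) with
              ⟨r, hr, hsr⟩ | ⟨s, hs, hss⟩ | ⟨a, b, ha, hb, hab⟩
            · exact (h2 ⟨r, by rwa [h22] at hr, hsr⟩).elim
            · exact ⟨s, hs, r₀ + 2, (hk2 r₀).symm, colA s hss _⟩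
            · exact ⟨b, hdirne _ _ _ hb, a, by have h' := hdirne _ _ _ ha; rwa [h22] at h', covA a b hab⟩
          obtain ⟨d₁, d₂, hd, ⟨a₁, ha₁, h₁⟩, ⟨a₂, ha₂, h₂⟩⟩ :=
            two_of_clauses (D := fun d => ∃ a, a ≠ r₀ ∧ vecMulVec (ξdir a) (ξdir d) ∈ absorbAt (partnersAbove C Z) g j) hE
          have hc₁ := vmv_mem_of_two_rows (Ne.symm ha₁) (rowA r₀ hr₀ (ξdir d₁)) h₁
          have hc₂ := vmv_mem_of_two_rows (Ne.symm ha₂) (rowA r₀ hr₀ (ξdir d₂)) h₂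
          exact vmv_mem_of_two_cols hd (hc₁ (ξdir k)) (hc₂ (ξdir k)) _
      · by_cases h2 : ∃ s₁, s₁ ≠ s₀ ∧ MServedAbove C Z j s₁
        · obtain ⟨s₁, hs₁, hss₁⟩ := h2
          exact vmv_mem_of_two_cols (Ne.symm hs₁) (colA s₀ hs₀ _) (colA s₁ hss₁ _) _
        · have hE : ∀ k₁ : Fin 4, ∃ d, d ≠ k₁ + 2 ∧ ∃ b, b ≠ s₀ ∧
              vecMulVec (ξdir d) (ξdir b) ∈ absorbAt (partnersAbove C Z) g j := by
            intro k₁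
            rcases hD g j hgj k₁ (s₀ + 2) (hadg _) (hadj _) (by rw [hcg, hcj]; exact htt) with
              ⟨r, hr, hsr⟩ | ⟨s, hs, hss⟩ | ⟨a, b, ha, hb, hab⟩
            · exact ⟨r, hr, s₀ + 2, (hk2 s₀).symm, rowA r hsr _⟩
            · exact (h2 ⟨s, by rwa [h22] at hs, hss⟩).elim
            · exact ⟨a, hdirne _ _ _ ha, b, by have h' := hdirne _ _ _ hb; rwa [h22] at h', covA a b hab⟩
          obtain ⟨d₁, d₂, hd, ⟨b₁, hb₁, h₁⟩, ⟨b₂, hb₂, h₂⟩⟩ :=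
            two_of_clauses (D := fun d => ∃ b, b ≠ s₀ ∧ vecMulVec (ξdir d) (ξdir b) ∈ absorbAt (partnersAbove C Z) g j) hE
          have hr₁ := vmv_mem_of_two_cols (Ne.symm hb₁) (colA s₀ hs₀ (ξdir d₁)) h₁
          have hr₂ := vmv_mem_of_two_cols (Ne.symm hb₂) (colA s₀ hs₀ (ξdir d₂)) h₂
          exact vmv_mem_of_two_rows hd (hr₁ (ξdir k')) (hr₂ (ξdir k')) _
    · -- apex – charged: against the partner's coordinate `k′`, the four clauses give two distinct rows
      have hj1' : 1 ≤ c j := by omega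
      obtain ⟨hadg, hcg, -⟩ := hapex g hg0.symm
      by_cases hsj : MServedAbove C Z j k'
      · exact colA k' hsj _
      · have hE : ∀ k₁ : Fin 4, ∃ d, d ≠ k₁ + 2 ∧ vecMulVec (ξdir d) (ξdir k') ∈ absorbAt (partnersAbove C Z) g j := by
          intro k₁
          have hne₁ : coord (Z g) k₁ ≠ coord (Z j) k' := by rw [hcg] at hne ⊢; exact hne
          rcases hD g j hgj k₁ k' (hadg _) (hadch j k' hj1' hk') hne₁ with ⟨r, hr, hsr⟩ | hs | ⟨a, b, ha, hb, hab⟩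
          · exact ⟨r, hr, rowA r hsr _⟩
          · exact absurd (hsetch j k' hj1' hk' hs) hsj
          · obtain rfl := hdirch j k' b hj1' hb
            exact ⟨a, hdirne _ _ _ ha, covA a _ hab⟩
        obtain ⟨d₁, d₂, hd, h₁, h₂⟩ :=
          two_of_clauses (D := fun d => vecMulVec (ξdir d) (ξdir k') ∈ absorbAt (partnersAbove C Z) g j) hE
        exact vmv_mem_of_two_rows hd h₁ h₂ _
    · -- charged – apex
      have hg1' : 1 ≤ c g := by omega
      obtain ⟨hadj, hcj, -⟩ := hapex j hj0.symm
      by_cases hsg : MServedAbove C Z g k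
      · exact rowA k hsg _
      · have hE : ∀ k₁ : Fin 4, ∃ d, d ≠ k₁ + 2 ∧ vecMulVec (ξdir k) (ξdir d) ∈ absorbAt (partnersAbove C Z) g j := by
          intro k₁
          have hne₁ : coord (Z g) k ≠ coord (Z j) k₁ := by rw [hcj] at hne ⊢; exact hne
          rcases hD g j hgj k k₁ (hadch g k hg1' hk) (hadj _) hne₁ with hs | ⟨s, hs, hss⟩ | ⟨a, b, ha, hb, hab⟩
          · exact absurd (hsetch g k hg1' hk hs) hsg
          · exact ⟨s, hs, colA s hss _⟩
          · obtain rfl := hdirch g k a hg1' ha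
            exact ⟨b, hdirne _ _ _ hb, covA _ b hab⟩
        obtain ⟨d₁, d₂, hd, h₁, h₂⟩ :=
          two_of_clauses (D := fun d => vecMulVec (ξdir k) (ξdir d) ∈ absorbAt (partnersAbove C Z) g j) hE
        exact vmv_mem_of_two_cols hd h₁ h₂ _
    · -- charged – charged (§9d)
      have hg1' : 1 ≤ c g := by omega
      have hj1' : 1 ≤ c j := by omega
      rcases hD g j hgj k k' (hadch g k hg1' hk) (hadch j k' hj1' hk') hne with hs | hs | ⟨a, b, ha, hb, hab⟩
      · exact rowA k (hsetch g k hg1' hk hs) _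
      · exact colA k' (hsetch j k' hj1' hk' hs) _
      · obtain rfl := hdirch g k a hg1' ha
        obtain rfl := hdirch j k' b hj1' hb
        exact covA _ _ hab
  -- assemble with the dual-basis expansion in the frames `u g`, `u j`
  show Mjg (blkOfPt (Z g)) (blkOfPt (Z j)) ∈ absorbAt (partnersAbove C Z) g j
  have piece : ∀ k k', (k = u g ∨ k = u g + 2) → (k' = u j ∨ k' = u j + 2) →
      φfun (δdir k) (δdir k') (Mjg (blkOfPt (Z g)) (blkOfPt (Z j))) • vecMulVec (ξdir k) (ξdir k') ∈
        absorbAt (partnersAbove C Z) g j := by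
    intro k k' hk hk'
    by_cases hz : coord (Z g) k = coord (Z j) k'
    · rw [hZ g, hZ j] at hz
      rw [hZ g, hZ j, frame_coeff_charged (t g) (c g) (t j) (c j) (u g) (u j) hk hk', hz, sub_self, Int.cast_zero,
        mul_zero, zero_smul]
      exact zero_mem _
    · exact Submodule.smul_mem _ _ (term k k' hk hk' hz)
  rw [frame_expand (u g) (u j) (Mjg _ _)]
  exact add_mem (add_mem (add_mem (piece _ _ (Or.inl rfl) (Or.inl rfl)) (piece _ _ (Or.inl rfl) (Or.inr rfl)))
    (piece _ _ (Or.inr rfl) (Or.inl rfl))) (piece _ _ (Or.inr rfl) (Or.inr rfl))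


/-- **THE GENERAL BRIDGE, read off `◇_h` membership (kernel):** at a gap-free `N`-cell, RULE D ⟺ pair criterion. -/
theorem ruleDN_iff_pairCriterion_of_noGap' {h : ℤ} (hC : C.InDiamond h) {Z : MCell} (hZ : Z ∈ C.lower)
    (hgap : NoApexGapBelow C Z) : RuleDMu4N C Z ↔ PairCriterion (fun g => blkOfPt (Z g)) (partnersBelow C Z) := by
  choose t c u hc hZr using fun g => exists_ray_of_inDiamond (hC.1 Z hZ g)
  refine ruleDN_iff_pairCriterion_of_noGap hC t c u hc hZr fun g j hgj hg hj htt => hgap g j hgj ?_ ?_ ?_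
  · rw [hZr g, hg]; simp [isApex]
  · rw [hZr j, hj]; simp [isApex]
  · rw [hZr g, hZr j, hg, hj]; simpa [ray] using htt

/-- the same at a gap-free `P`-cell. -/
theorem ruleDP_iff_pairCriterion_of_noGap' {h : ℤ} (hC : C.InDiamond h) {P : MCell} (hPu : P ∈ C.upper)
    (hgap : NoApexGapAbove C P) : RuleDMu4P C P ↔ PairCriterion (fun g => blkOfPt (P g)) (partnersAbove C P) := by
  choose t c u hc hZr using fun g => exists_ray_of_inDiamond (hC.2 P hPu g)
  refine ruleDP_iff_pairCriterion_of_noGap hC t c u hc hZr fun g j hgj hg hj htt => hgap g j hgj ?_ ?_ ?_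
  · rw [hZr g, hg]; simp [isApex]
  · rw [hZr j, hj]; simp [isApex]
  · rw [hZr g, hZr j, hg, hj]; simpa [ray] using htt

/-- in particular at every ALL-CHARGED cell (no apex factor: §9d recovered) and at every cell whose apex factors have ONE height. -/
theorem ruleDN_iff_pairCriterion_of_one_apex_height {h : ℤ} (hC : C.InDiamond h) {Z : MCell} (hZ : Z ∈ C.lower) (a : ℤ)
    (ha : ∀ g, isApex (Z g) → (Z g).1 = a) : RuleDMu4N C Z ↔ PairCriterion (fun g => blkOfPt (Z g)) (partnersBelow C Z) :=
  ruleDN_iff_pairCriterion_of_noGap' hC hZ (noApexGapBelow_of_one_height a ha)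


end Bridge

/-! ## §8b (rev 13) THE THIN-CELL CRITERION FOR AN ARBITRARY LEG SET — the kernel form of the enlarged encoders' service rule (E)

For a thin cell `[O|O|O|b]` whose partner types are legs on `f` with codirections from a list `Ξ` — the one-level enlargement of
record offers at a head `2I+3ℓ_u` the balanced null servers' `ξ_u` (own), `ξ_{u+2}` (anti) AND the twin pair's legs `(1, 3u)` (to
`D₊`), `(3u, 1)` (to `D₋`); at a `D_±` cell the legs from the heads (§7–§8) — the pair criterion for a NON-NULL `b`
(`α α′ ≠ β β̄`: the heads, `det = 16`; `D_±`, `det = −16`) holds IFF `Ξ` contains two codirections of non-zero cross-determinant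
(field coefficients, non-zero codirections): ⟸ is (T1∕T2) `thin_two_legs_pass`; ⟹: pairwise-parallel codirections lie on one
line `K·ξ₀`, parallel legs offer nothing new (`pairPlane_leg_smul_le`), the criterion is monotone in the absorbing spaces
(`pairCriterion_mono`), and (T0) forces `b` null.  For the ◇₈ twin packet (u = 1, real frame) the four head codirections
`(1,1)`, `(1,−1)`, `(1,3)`, `(3,1)` are PAIRWISE INDEPENDENT (`head_codirections_pairwise_indep`), so at a head the criterion reads
«at least two of {own, anti, D₊, D₋} present» (`head_2I3l_twin_legs_pass`: the twin legs ALONE serve the head — the R2 model of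
j323061) — the service rule (E) of SPEC v1.1 §4.2 ∕ j323061 G2 ∕ the twin's G2x is thereby DERIVED from the plane table, not designed
(critic D-4 «common mode» located: it is LINE 5's model, kernel-bridged).  Instrument ≠ kernel for the encoders' clause bytes.
-/

section LegSet

variable {R : Type*} [CommRing R]

/-- legs on factor `f` with the listed codirections. -/
def legsOn (f : Fin 4) (Ξ : List (Fin 2 → R)) : List (PType R) := Ξ.map (PType.leg f)

omit [CommRing R] in
theorem mem_legsOn {f : Fin 4} {Ξ : List (Fin 2 → R)} {ξ : Fin 2 → R} (h : ξ ∈ Ξ) : PType.leg f ξ ∈ legsOn f Ξ :=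
  List.mem_map.2 ⟨ξ, h, rfl⟩

/-- the pair criterion is MONOTONE in the absorbing spaces. -/
theorem pairCriterion_mono {x : Fin 4 → Blk R} {L L' : List (PType R)} (h : PairCriterion x L)
    (hle : ∀ g j, absorbAt L g j ≤ absorbAt L' g j) : PairCriterion x L' := fun g j hgj => hle g j (h g j hgj)

theorem vecMulVec_smul_left (c : R) (ξ η : Fin 2 → R) : vecMulVec (c • ξ) η = c • vecMulVec ξ η := by
  ext i j; simp [vecMulVec_apply, mul_assoc]

theorem vecMulVec_smul_right (c : R) (ξ η : Fin 2 → R) : vecMulVec η (c • ξ) = c • vecMulVec η ξ := by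
  ext i j; simp [vecMulVec_apply]; ring

/-- a leg with a PARALLEL codirection offers nothing new: its planes sit inside the original leg's planes. -/
theorem pairPlane_leg_smul_le (f : Fin 4) (c : R) (ξ : Fin 2 → R) (g j : Fin 4) :
    pairPlane (PType.leg f (c • ξ)) g j ≤ pairPlane (PType.leg f ξ) g j := by
  by_cases hg : f = g
  · have h1 : pairPlane (PType.leg f (c • ξ)) g j = Submodule.span R {vecMulVec (c • ξ) eA, vecMulVec (c • ξ) eB} := by
      simp [pairPlane, hg]
    have h2 : pairPlane (PType.leg f ξ) g j = Submodule.span R {vecMulVec ξ eA, vecMulVec ξ eB} := by simp [pairPlane, hg]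
    rw [h1, h2]
    refine Submodule.span_le.2 ?_
    intro M hM
    simp only [Set.mem_insert_iff, Set.mem_singleton_iff] at hM
    rcases hM with rfl | rfl
    · rw [vecMulVec_smul_left]; exact Submodule.smul_mem _ c (Submodule.subset_span (by simp))
    · rw [vecMulVec_smul_left]; exact Submodule.smul_mem _ c (Submodule.subset_span (by simp))
  · by_cases hj : f = j
    · subst hj
      have h1 : pairPlane (PType.leg f (c • ξ)) g f = Submodule.span R {vecMulVec eA (c • ξ), vecMulVec eB (c • ξ)} := by
        simp [pairPlane, hg]
      have h2 : pairPlane (PType.leg f ξ) g f = Submodule.span R {vecMulVec eA ξ, vecMulVec eB ξ} := by simp [pairPlane, hg]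
      rw [h1, h2]
      refine Submodule.span_le.2 ?_
      intro M hM
      simp only [Set.mem_insert_iff, Set.mem_singleton_iff] at hM
      rcases hM with rfl | rfl
      · rw [vecMulVec_smul_right]; exact Submodule.smul_mem _ c (Submodule.subset_span (by simp))
      · rw [vecMulVec_smul_right]; exact Submodule.smul_mem _ c (Submodule.subset_span (by simp))
    · have h1 : pairPlane (PType.leg f (c • ξ)) g j = ⊥ := by simp [pairPlane, hg, hj]
      rw [h1]; exact bot_le

/-- hence legs whose codirections all lie on one line `R·ξ₀` absorb no more than the single leg `ξ₀`. -/
theorem absorbAt_legsOn_parallel_le (f : Fin 4) (ξ₀ : Fin 2 → R) (Ξ : List (Fin 2 → R)) (hpar : ∀ η ∈ Ξ, ∃ c : R, η = c • ξ₀)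
    (g j : Fin 4) : absorbAt (legsOn f Ξ) g j ≤ absorbAt [PType.leg f ξ₀] g j := by
  rw [absorbAt_singleton]
  refine iSup₂_le fun p hp => ?_
  obtain ⟨η, hη, rfl⟩ := List.mem_map.1 hp
  obtain ⟨c, rfl⟩ := hpar η hη
  exact pairPlane_leg_smul_le f c ξ₀ g j

/-- **(T0′) PARALLEL CODIRECTIONS FORCE A NULL HEAD**: legs on `f` whose codirections lie on one line absorb the thin cell's pair
images only if `b` is null. -/
theorem thin_parallel_codirections_force_null (f : Fin 4) (b : Blk R) (ξ₀ : Fin 2 → R) (Ξ : List (Fin 2 → R))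
    (hpar : ∀ η ∈ Ξ, ∃ c : R, η = c • ξ₀) (h : PairCriterion (thin f b) (legsOn f Ξ)) : b.α * b.α' - b.β * b.βc = 0 :=
  thin_one_codirection_forces_null f b ξ₀ (pairCriterion_mono h (absorbAt_legsOn_parallel_le f ξ₀ Ξ hpar))

variable {K : Type*} [Field K]

/-- over a field, a non-zero vector with zero cross-determinant against `η` has `η` on its line. -/
theorem exists_smul_of_cross_eq_zero {ξ η : Fin 2 → K} (hξ : ξ ≠ 0) (h : ξ 0 * η 1 - ξ 1 * η 0 = 0) : ∃ c : K, η = c • ξ := by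
  by_cases h0 : ξ 0 = 0
  · have h1 : ξ 1 ≠ 0 := by
      intro h1; apply hξ; funext i
      match i with
      | 0 => exact h0
      | 1 => exact h1
    refine ⟨η 1 / ξ 1, funext fun i => ?_⟩
    match i with
    | 0 =>
      have : ξ 1 * η 0 = 0 := by rw [h0, zero_mul, zero_sub, neg_eq_zero] at h; exact h
      simp [h0, (mul_eq_zero.1 this).resolve_left h1]
    | 1 => simp [div_mul_cancel₀ _ h1]
  · refine ⟨η 0 / ξ 0, funext fun i => ?_⟩
    match i with
    | 0 => simp [div_mul_cancel₀ _ h0]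
    | 1 =>
      simp only [Pi.smul_apply, smul_eq_mul]
      field_simp
      linear_combination h

/-- **THE THIN-CELL CRITERION FOR A LEG SET (kernel form of (E)).** For a NON-NULL thin cell `[O|O|O|b]` and legs on `f` with
non-zero codirections `Ξ` (field coefficients): pair criterion ⟺ two listed codirections have non-zero cross-determinant. -/
theorem thin_legsOn_iff (f : Fin 4) (b : Blk K) (hb : b.α * b.α' - b.β * b.βc ≠ 0) (Ξ : List (Fin 2 → K))
    (hΞ : ∀ ξ ∈ Ξ, ξ ≠ 0) :
    PairCriterion (thin f b) (legsOn f Ξ) ↔ ∃ ξ ∈ Ξ, ∃ η ∈ Ξ, ξ 0 * η 1 - ξ 1 * η 0 ≠ 0 := by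
  constructor
  · intro h
    by_cases hex : ∃ ξ ∈ Ξ, ∃ η ∈ Ξ, ξ 0 * η 1 - ξ 1 * η 0 ≠ 0
    · exact hex
    have hne : ∀ ξ ∈ Ξ, ∀ η ∈ Ξ, ξ 0 * η 1 - ξ 1 * η 0 = 0 :=
      fun ξ hξ η hη => by_contra fun hne => hex ⟨ξ, hξ, η, hη, hne⟩
    exfalso
    apply hb
    cases Ξ with
    | nil => exact thin_parallel_codirections_force_null f b ![1, 0] [] (by simp) h
    | cons ξ₀ rest =>
      refine thin_parallel_codirections_force_null f b ξ₀ (ξ₀ :: rest) (fun η hη => ?_) h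
      exact exists_smul_of_cross_eq_zero (hΞ ξ₀ (by simp)) (hne ξ₀ (by simp) η hη)
  · rintro ⟨ξ, hξ, η, hη, hdet⟩
    exact thin_two_legs_pass f b ξ η (isUnit_iff_ne_zero.2 hdet) _ (mem_legsOn hξ) (mem_legsOn hη)

/-- the ◇₈ head's four codirections in the real frame of §7–§8 (phase `ζ_u = 1`): own null leg `(1,1)`, anti null leg `(1,−1)`,
twin legs `(1,3)` (to `D₊`) and `(3,1)` (to `D₋`) — PAIRWISE INDEPENDENT (cross-determinants `−2, 2, −2, 4, 4, −8`). -/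
theorem head_codirections_pairwise_indep :
    ∀ ξ ∈ ([![1, 1], ![1, -1], ![1, 3], ![3, 1]] : List (Fin 2 → ℚ)), ∀ η ∈ ([![1, 1], ![1, -1], ![1, 3], ![3, 1]] : List (Fin 2 → ℚ)),
      ξ ≠ η → ξ 0 * η 1 - ξ 1 * η 0 ≠ 0 := by
  intro ξ hξ η hη hne
  simp only [List.mem_cons, List.not_mem_nil, or_false] at hξ hη
  rcases hξ with rfl | rfl | rfl | rfl <;> rcases hη with rfl | rfl | rfl | rfl <;>
    first | exact absurd rfl hne | norm_num

/-- hence at the ◇₈ head `2I+3ℓ = (5,5,3,3)` with ANY sub-family of those four legs: criterion ⟺ at least two DISTINCT legs present —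
in particular **the twin legs alone serve the head** (the R2 model of j323061 ∕ the (E) groups {D₊, D₋}): -/
theorem head_2I3l_twin_legs_pass (f : Fin 4) :
    PairCriterion (thin f (⟨5, 5, 3, 3⟩ : Blk ℚ)) [PType.leg f ![1, 3], PType.leg f ![3, 1]] :=
  thin_two_legs_pass f _ ![1, 3] ![3, 1] (isUnit_iff_ne_zero.2 (by norm_num)) _ (by simp) (by simp)

/-- … and so does own + `D₊`, anti + `D₋`, etc.; while any family of PARALLEL legs fails (§8 `head_2I3l_one_leg_fails`).  The general
statement for the head over `ℚ`: -/
theorem head_2I3l_legsOn_iff (f : Fin 4) (Ξ : List (Fin 2 → ℚ)) (hΞ : ∀ ξ ∈ Ξ, ξ ≠ 0) :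
    PairCriterion (thin f (⟨5, 5, 3, 3⟩ : Blk ℚ)) (legsOn f Ξ) ↔ ∃ ξ ∈ Ξ, ∃ η ∈ Ξ, ξ 0 * η 1 - ξ 1 * η 0 ≠ 0 :=
  thin_legsOn_iff f _ (by norm_num) Ξ hΞ

/-- and for the server `D₊ = diag(4, −4)`: -/
theorem D8_legsOn_iff (f : Fin 4) (Ξ : List (Fin 2 → ℚ)) (hΞ : ∀ ξ ∈ Ξ, ξ ≠ 0) :
    PairCriterion (thin f (⟨4, -4, 0, 0⟩ : Blk ℚ)) (legsOn f Ξ) ↔ ∃ ξ ∈ Ξ, ∃ η ∈ Ξ, ξ 0 * η 1 - ξ 1 * η 0 ≠ 0 :=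
  thin_legsOn_iff f _ (by norm_num) Ξ hΞ

end LegSet


/-! ## §7b (rev 14) THE REBALANCER CENSUS AT `◇₈` (kernel; the critic's T5-4 «completeness of the rebalancer set», formerly machine ×1)

The balanced letters of `◇₈` are `a·I + c·ℓ_u` read as blocks `⟨a, a, c ζ̄_u, c ζ_u⟩` with `c ≤ a`, `a − c` even, `a + c ≤ 8`
(`c = 0`: the apex `a·I`, one letter; `c ≥ 1`: four phases) — 45 letters.  A letter `x` is a REBALANCER of the twin letter
`D₊ = diag(4, −4)` (resp. `D₋ = diag(−4, 4)`) iff `x − D_±` is rank-one psd, i.e. `det (x − D_±) = 0` with the diagonal of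
`x − D_±` non-negative; `det (x − D_±) = (a − 4)(a + 4) − c² ζ ζ̄ = a² − 16 − c²` (`det_letter_sub_Dplus∕Dminus`), and on the
`◇₈` letter set `a² − c² = 16` has EXACTLY the solutions `(a, c) = (5, 3)` — the four heads `2I + 3ℓ_u` — and `(4, 0)` — the apex
`4I` (`diamond8_rebalancer_census`, `decide` over the bounded range); for these the difference IS a formal outer product
(`letter53_sub_Dplus∕Dminus`: `(1, 3ζ) ⊗ (1, 3ζ̄)`, `(3ζ̄, 1) ⊗ (3ζ, 1)`; `4I − D_± = 8·e_B ⊗ e_B ∕ 8·e_A ⊗ e_A`, §7), with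
diagonal `1, 9` ∕ `0, 8` ≥ 0.  So the rebalancer set of `D_±` in `◇₈` is `{2I+3ℓ_u : u ∈ μ₄} ∪ {4I}` — the first column of the
card's 3 416-row triangle table (`triangles.py` 1e363af61cb886ef) and the twin encoder's derived rebalancers (j324062 smoke: «{2I+3ℓ_u
×4, 4I} both signs») now kernel.  The APEX `4I`'s legs to `D₊`, `D₋` have codirections `e_B = (0,1)`, `e_A = (1,0)`, independent of
each other and of every balanced codirection `(1, ζ̄)`: by §8b the apex is served by `{D₊, D₋}` alone or by any two legs
(`apex4I_twin_legs_pass`, `apex4I_legsOn_iff`) — the kernel form of (E)'s apex clause «17 ⇒ (own servers) ∨ (d₊ ∧ d₋)».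
-/

section Rebalancer

variable {R : Type*} [CommRing R]

/-- the balanced letter `a·I + c·ℓ_u` as a block, phase `ζ = ζ_u` with formal conjugate `ζc`. -/
def letter (a c : ℤ) (ζ ζc : R) : Blk R := ⟨a, a, c * ζc, c * ζ⟩

/-- the twin letters. -/
def Dplus : Blk R := ⟨4, -4, 0, 0⟩
def Dminus : Blk R := ⟨-4, 4, 0, 0⟩

theorem det_letter_sub_Dplus (a c : ℤ) (ζ ζc : R) (h : ζ * ζc = 1) :
    ((letter a c ζ ζc).toMat - (Dplus : Blk R).toMat).det = (a : R) ^ 2 - 16 - (c : R) ^ 2 := by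
  simp [Matrix.det_fin_two, letter, Dplus, Blk.toMat]
  linear_combination -((c : R) ^ 2) * h

theorem det_letter_sub_Dminus (a c : ℤ) (ζ ζc : R) (h : ζ * ζc = 1) :
    ((letter a c ζ ζc).toMat - (Dminus : Blk R).toMat).det = (a : R) ^ 2 - 16 - (c : R) ^ 2 := by
  simp [Matrix.det_fin_two, letter, Dminus, Blk.toMat]
  linear_combination -((c : R) ^ 2) * h

/-- **THE REBALANCER CENSUS (kernel, `decide`):** on the `◇₈` letter set, `det (x − D_±) = 0` iff `x` is a head `2I+3ℓ_u`
(`a = 5, c = 3`) or the apex `4I` (`a = 4, c = 0`). -/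
theorem diamond8_rebalancer_census :
    ∀ a : Fin 9, ∀ c : Fin 9, (c : ℕ) ≤ a → (a : ℕ) + c ≤ 8 → ((a : ℕ) - c) % 2 = 0 →
      (((a : ℕ) : ℤ) ^ 2 - 16 - ((c : ℕ) : ℤ) ^ 2 = 0 ↔ ((a : ℕ) = 5 ∧ (c : ℕ) = 3) ∨ ((a : ℕ) = 4 ∧ (c : ℕ) = 0)) := by
  decide

/-- … and for those letters the difference IS a formal outer product with non-negative diagonal: the heads (any phase) — -/
theorem letter53_sub_Dplus (ζ ζc : R) (h : ζ * ζc = 1) :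
    (letter 5 3 ζ ζc).toMat - (Dplus : Blk R).toMat = vecMulVec ![1, 3 * ζ] ![1, 3 * ζc] := by
  ext i j; fin_cases i <;> fin_cases j <;> simp [letter, Dplus, Blk.toMat, vecMulVec_apply] <;>
    first | (norm_num; done) | (norm_num; linear_combination (-9 : R) * h)

theorem letter53_sub_Dminus (ζ ζc : R) (h : ζ * ζc = 1) :
    (letter 5 3 ζ ζc).toMat - (Dminus : Blk R).toMat = vecMulVec ![3 * ζc, 1] ![3 * ζ, 1] := by
  ext i j; fin_cases i <;> fin_cases j <;> simp [letter, Dminus, Blk.toMat, vecMulVec_apply] <;>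
    first | (norm_num; done) | (norm_num; linear_combination (-9 : R) * h)

/-- — and the apex `4I` (§7 `triangle_D8`, conjuncts 3 and 6, restated with the named letters). -/
theorem apex4I_sub_twin :
    (letter 4 0 (1 : ℤ) 1).toMat - (Dplus : Blk ℤ).toMat = (8 : ℤ) • vecMulVec eB eB ∧
    (letter 4 0 (1 : ℤ) 1).toMat - (Dminus : Blk ℤ).toMat = (8 : ℤ) • vecMulVec eA eA := by
  refine ⟨?_, ?_⟩ <;> (ext i j; fin_cases i <;> fin_cases j <;> rfl)

/-- the apex `4I = (4,4,0,0)` (non-null, `det = 16`) is served by the twin legs `e_B` (to `D₊`), `e_A` (to `D₋`) ALONE … -/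
theorem apex4I_twin_legs_pass (f : Fin 4) :
    PairCriterion (thin f (⟨4, 4, 0, 0⟩ : Blk ℚ)) [PType.leg f ![0, 1], PType.leg f ![1, 0]] :=
  thin_two_legs_pass f _ ![0, 1] ![1, 0] (isUnit_iff_ne_zero.2 (by norm_num)) _ (by simp) (by simp)

/-- … and in general by any leg set with two independent codirections (the twin legs `(0,1)`, `(1,0)` are independent of every
balanced codirection `(1, ζ̄)`: cross-determinants `−1` and `ζ̄`). -/
theorem apex4I_legsOn_iff (f : Fin 4) (Ξ : List (Fin 2 → ℚ)) (hΞ : ∀ ξ ∈ Ξ, ξ ≠ 0) :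
    PairCriterion (thin f (⟨4, 4, 0, 0⟩ : Blk ℚ)) (legsOn f Ξ) ↔ ∃ ξ ∈ Ξ, ∃ η ∈ Ξ, ξ 0 * η 1 - ξ 1 * η 0 ≠ 0 :=
  thin_legsOn_iff f _ (by norm_num) Ξ hΞ

theorem twin_legs_indep_of_balanced {K : Type*} [Field K] (ζc : K) (hζ : ζc ≠ 0) :
    (![0, 1] : Fin 2 → K) 0 * (![1, ζc] : Fin 2 → K) 1 - (![0, 1] : Fin 2 → K) 1 * (![1, ζc] : Fin 2 → K) 0 ≠ 0 ∧
    (![1, 0] : Fin 2 → K) 0 * (![1, ζc] : Fin 2 → K) 1 - (![1, 0] : Fin 2 → K) 1 * (![1, ζc] : Fin 2 → K) 0 ≠ 0 := by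
  constructor <;> simp [hζ]

end Rebalancer


end Summit.HodgeConjecture.HodgeConjecture.Cruxes.BlochSeedDiscOne.TwinLocalityLaw
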